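import Literature.MathematicalPhysics.StatisticalMechanics.CubicLatticeEdgeIsoperimetry
import HarnessLib

/-!
# The box of an `EIP³` minimizer, the `N^{5/6}` law, and [MPSS19] §3 Steps 1–3
# (Mainini–Piovano–Schmidt–Stefanelli 2019, Theorem 1.1 — completed in `CubicLatticeSideFace.lean`)

Companion of `EdgeIsoperimetricFluctuations.lean` (the named facts) and
`CubicLatticeEdgeIsoperimetry.lean` (the edge-isoperimetric problem in `ℤ³` solved:
`EIP³(n) = 2·G₃(n)`).  Everything here is PROVED; no named facts are introduced.  The target is the
vendored fact `MaininiPiovanoSchmidtStefanelli2019_thm11` ([MPSS19] Theorem 1.1, the upper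
bound `min_a #(M_n △ (a + W_n)) ≤ K₁ n^{3/4} + o(n^{3/4})`); this file proves its structural half —
the bounding box of a minimizer —, the law with the weaker exponent `5/6`, and all of [MPSS19] §3
but the last case of the Step-3 arithmetic; the continuation `CubicLatticeSideFace.lean` finishes
that case and DISCHARGES the fact (`MaininiPiovanoSchmidtStefanelli2019_thm11_holds`).

## Results (namespace `Literature.MathematicalPhysics.StatisticalMechanics`)

For an `EIP³` minimizer `C ⊂ ℤ³` with `n` points, write `T_s := #{x_s : x ∈ C}` for the number of
occupied values of the coordinate `s`, `M_s := #π_s(C)` for the size of its projection along `e_s`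
(`dropCoord s C`), `m := ⌊∛n⌋` (`latticeRootFloor 3 n`), `G₃ = cubicEIP`, `⌈2√·⌉ = halfPerim`.

* `IsEIPMinimizer.mem_firstCoords_of_lt_of_lt`, `IsEIPMinimizer.firstCoords_eq_Icc`,
  `IsEIPMinimizer.exists_shift_apply` — **no gaps**: the occupied values of every coordinate form a
  lattice interval, so after a translation `C ⊆ {1,…,T₀} × {1,…,T₁} × {1,…,T₂}` (the minimal cuboid
  `Q(M_n) = Q(ℓ₁+1, ℓ₂+1, ℓ₃+1)` of [MPSS19] §3 eq. (3.1), with `ℓ_s + 1 = T_s`).  Proof: at an empty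
  level the boundary pairs split (`boundaryPairs_eq_union_of_not_mem_firstCoords`), each part pays
  twice its own projection vertically, and the sorted daisy stack of all slices would be strictly
  better (this is the connectedness argument of [MPS14] Theorem 5.1 in three dimensions).
* `IsEIPMinimizer.exists_sliceAt_eq_dropFirst` — **the largest slice is the whole projection**
  (equality in [MS20] Proposition 3.2 for minimizers); hence, the slice being a planar minimizer
  ([MS20] Corollary 3.3, the tree's `MaininiSchmidt2020_cor33_three`) whose numbers of columns and
  rows add up to `⌈2√·⌉` of its size ([MPS14] Proposition 6.3, the tree's
  `IsEIPMinimizer.card_image_add_card_image_rev`):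
  `IsEIPMinimizer.card_image_add_card_image_eq_halfPerim`: **`T_j + T_k = ⌈2√M_i⌉`** for
  `{i, j, k} = {0, 1, 2}`; together with `IsEIPMinimizer.sum_card_dropCoord_eq_cubicEIP`
  (`M₀ + M₁ + M₂ = G₃(n)`, by line-convexity), `card_le_card_dropCoord_mul_card_image`
  (`n ≤ M_s T_s`) and `card_dropCoord_le_mul` (`M_i ≤ T_j T_k`).
* `sq_sub_le_of_add_eq_halfPerim` (`(T_j − T_k)² ≤ 2(T_j + T_k)`: maximal slices are near-square),
  `cubicEIP_le_three_mul_sq` (`G₃(n) ≤ 3(m+1)²`) and `IsEIPMinimizer.box_sides`: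
  **`m − q ≤ T_s ≤ m + 1 + q`, `q = ⌊√(6m+8)⌋`** — all sides of the box within `O(n^{1/6})` of
  `⌊∛n⌋ + 1` ([MPSS19] eq. (3.2) proves `O(n^{1/12})`, which is what the exponent `3/4` needs).
* `MaininiPiovanoSchmidtStefanelli2019_thm11_weak`: **the `N^{5/6}` law** — there is `K` (`= 20000`)
  such that every `EIP³` minimizer `M` with `n` points satisfies
  `#(M △ (a + W_n)) ≤ K n^{5/6} + K` for some `a ∈ ℤ³`, `W_n = [0, ⌊∛n⌋]³ ∩ ℤ³` (`wulffCubeZero n`).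
  The counting (`card_symmDiff_cube_add_le`, `symmDiff_wulffCubeZero_eq_image`) is the one of
  [MPSS19] §3 ("each external face … has cardinality `n^{2/3} + o(n^{2/3})`",
  "`#(Q(M_n) ∖ M_n) = (ℓ₁+1)(ℓ₂+1)(ℓ₃+1) − n`") and is stated so that a future proof of eq. (3.2)
  (`|ℓ_i − ℓ_n| ≤ K n^{1/12} + o(n^{1/12})`) upgrades the exponent to the printed `3/4` by replacing
  `IsEIPMinimizer.box_sides` only.

* `MaininiPiovanoSchmidtStefanelli2019_thm11_of_box_bound` (section `Reduction`): **[MPSS19]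
  Theorem 1.1 follows from its bounding-box claim (3.2)** — if every non-empty `EIP³` minimizer
  with `n` points has `|T_s − (⌊∛n⌋ + 1)| ≤ K(n^{1/12} + 1)` for `s = 0, 1, 2`, then the vendored
  fact `MaininiPiovanoSchmidtStefanelli2019_thm11` holds (with `K₁ = 12K(2+2K)² + 12` for `K ≥ 1` and
  remainder `r ≡ 1 = o(n^{3/4})`); the hypothesis is the printed (3.2), spelled inline, not vendored.

* `cubicEIP_sum_le_profile`, `cubicEIP_multisetSum_le`, `IsEIPMinimizer.exists_optimalProfile`
  (sections `ProfileOptimality`, `Multiset`): **profile optimality** — every nonincreasing profile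
  (indeed every multiset of levels, stacked as daisies) is a competitor, `G₃(Σ f) ≤ f(0) + Σ ⌈2√f(k)⌉`,
  and the sorted slice profile of a minimizer along any axis attains equality, with `f(0) = M_s`:
  `M_s + Σ_k ⌈2√f(k)⌉ = G₃(n)` — the combinatorial input of [MPSS19] §3 in profile form; whence
  `optimalProfile_lt_add_of_three_le` / `IsEIPMinimizer.card_dropCoord_lt_card_add_card`: **no two
  slices of a minimizer fit together inside its projection** (`#C_t + #C_{t'} > M_s` for `t ≠ t'`,
  by strict superadditivity of `⌈2√·⌉`) — at most one slice per axis is at most half full.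

* `greedy_halfPerim_le_sum`, `IsEIPMinimizer.card_dropCoord_add_twoLevel_le` (section `Greedy`):
  **the two-level (quasicube) lower bound** — levels of at most `Q = q(s)` points cost at least
  `⌊N/Q⌋·⌈2√Q⌉ + ⌈2√(N mod Q)⌉` (greedy consolidation by the exchange inequality), hence along
  every axis of a minimizer `M_s + ⌊n/Q⌋·σ + ⌈2√(n mod Q)⌉ ≤ G₃(n)` with `σ = ⌈2√M_s⌉ = T_j + T_k`,
  `Q = q(σ)`: [MPSS19] §3 Steps 1–2 (reduction to the quasicube `ℚ(M_n)`) as an inequality.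

* `IsOptimalLevels` (structure), `IsEIPMinimizer.isOptimalLevels`, `IsOptimalLevels.lt_add`,
  `IsOptimalLevels.exchange`, `IsOptimalLevels.exists_canonical`,
  `IsOptimalLevels.exists_quasicube_accounting`, `IsEIPMinimizer.exists_quasicube_accounting`
  (section `Canonical`): **[MPSS19] §3 Steps 1–2 (the cuboidification, Definition 2.2) at the level
  of slice sizes** — the slice sizes of a minimizer along an axis form an OPTIMAL MULTISET (its daisy
  stack is a minimizer); no two of its levels fit in the largest (`x + y > B`); the exchange
  `{x, y} ↦ {Q, x + y − Q}` (`Q = q(σ) ≤ B` a quasi-square, `x ≤ y < Q`) preserves optimality, the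
  number of levels, of points and the maximum; iterating, all levels but one lie in `[Q, B]`; whence
  the ARITHMETIC OUTPUT: for `Q = q(σ) ≤ M_s < q(σ+1)`, `σ ≥ 2`, there are `u < T_s`, `1 ≤ d ≤ M_s` with
  `G₃(n) = M_s + (T_s − 1)σ + u + ⌈2√d⌉` and `(T_s−1)Q + u + d ≤ n ≤ (T_s−1)Q + u(M_s − Q) + d`.

* `MaininiPiovanoSchmidtStefanelli2019_thm11_of_quasicube_bound` (section `QuasicubeReduction`, with
  `exists_qsq_le_lt`, `IsEIPMinimizer.sum_sides_le` (`T₀ + T₁ + T₂ ≤ 3⌊∛n⌋ + 4`),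
  `IsEIPMinimizer.side_sub_half_pow_four_le`, `IsEIPMinimizer.exists_box_dev_of_quasicube`):
  **the vendored fact follows from the arithmetic of [MPSS19] §3 Step 3 alone** — from
  `∃ K, ∀ n c M σ u d, [the quasicube accounting] → (c − 1 − ⌊σ/2⌋)⁴ ≤ K(σ + 1)`, a statement about
  `cubicEIP`, `qsq`, `halfPerim` only (Steps 4–5: each side exceeds the mean of the other two by
  `O(n^{1/12})`, the sides add up to `≤ 3⌊∛n⌋ + 4`, the product is `≥ n`).

* `tall_quasicube_core` (section `StepThree`): **[MPSS19] §3 Step 3, the core case, as a theorem** —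
  if the profile "`p + 3k` levels of the square `p²` plus a top level of `d ≤ 3k²p + k³` points" is
  optimal then `9k⁴ + 6k² < 4p + 8k³ + 4k` (the printed `4αℓ = 9k⁴ + 12s₁k³ + …` with `s₁ = s₂ = 0`):
  the fourth-order cancellation against the competitor "`p + k − 1` squares `(p+k)²` plus one
  level", via `cubicEIP_multisetSum_le`, `halfPerim_add_le` and the Galois connection
  `halfPerim_le_iff`; no real analysis.  The other residues / parities / top-class levels of the
  arithmetic lemma follow the same template.
* `tall_quasicube` (section `StepThree`): the same with `e` spare levels `p²` kept in place and an
  arbitrary top level `d ≤ p²` (competitor "`p + k − 1` squares `(p+k)²`, one deficient level, `e`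
  spare levels, the old top level", via the zero-tolerant `cubicEIP_multisetSum_le'`): since `e` is
  free, EVERY admissible `k` (`3k²p + k³ ≤ (p+k)²`) below a third of the height excess of an optimal
  square-based quasicube profile obeys `9k⁴ + 6k² < 4p + 8k³ + 4k` — the residues mod `3` of
  [MPSS19] (`r ∈ {0,1,2}`) need no separate treatment.
* `tall_quasicube_odd` (section `StepThree`): the pronic cross-section `p × (p+1)` (`ℓ' = ℓ + 1`,
  `s₂ = 1` in [MPSS19]): every admissible `k` (`3pk² + k³ + k² ≤ (p+k)(p+k+1) + pk`) below a third
  of the height excess of an optimal pronic-based quasicube profile (spare levels, arbitrary top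
  level `d ≤ p(p+1)`) obeys `9k⁴ + 9k² ≤ 4p + 14k³ + 4k`.
* `pureBox_sq_height_pow_four_le` (section `StepThree`): **the arithmetic of Step 3 for square-based
  pure boxes, complete** — if "`c − 1` levels `p²` plus a top level `d ≤ p²`" is optimal then
  `(c − 1 − p)⁴ ≤ 5000·p` (choice `k = min(h/3, ⌊√(p/3)⌋)`; small `p` by `tall_quasicube_small`
  (`2 ≤ p ≤ 8`: excess `≥ 6` impossible), `tall_quasicube_one` (`p = 1`), `k = 2`, `k = 3`).  This
  is the case "`M_s` a square, no top-class levels" of the hypothesis of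
  `MaininiPiovanoSchmidtStefanelli2019_thm11_of_quasicube_bound`.
* `pureBox_pronic_height_pow_four_le` (section `StepThree`): the same for pronic-based pure boxes
  (`c − 1` levels `p(p+1)` + top `d ≤ p(p+1)` optimal ⇒ `(c − 1 − p)⁴ ≤ 5000·p`; small `p` by
  `tall_quasicube_odd_small` (`p ≤ 6`), `tall_quasicube_odd_mid` (`7 ≤ p ≤ 18`), then `k = 3`,
  then `k = min(h/3, ⌊√(p/3)⌋)`).  Together: the hypothesis of `…_of_quasicube_bound` holds
  whenever `M_s` is a quasi-square (`u = 0`); the top-class levels (the side face `F²` of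
  [MPSS19] Step 2) are what remains.
* `MaininiPiovanoSchmidtStefanelli2019_thm11_of_sideFace_bound` (section `StepThree`): **the
  vendored fact follows from the side-face case alone** — from
  `∃ K, ∀ n c M σ u d, 2 ≤ σ → q(σ) < M → M < q(σ+1) → [quasicube accounting] → (c−1−⌊σ/2⌋)⁴ ≤ K(σ+1)`
  (the configurations "box ∪ side strip ∪ top face" of [MPSS19] §3 Step 2, cases 1–3).
* `IsOptimalLevels.topClass_add_gt` (section `SideFace`): in an optimal multiset with maximum
  `B ∈ [q(σ), q(σ+1))` any two top-class levels `x, y > q(σ)` have `x + y > B + q(σ)` (else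
  `{x, y} ↦ {q(σ), x + y − q(σ)}` saves one) — the alignment of the side strip of [MPSS19] Step 2.
* `cubicEIP_multisetSum_le_of_le` (any upper bound `B` of the levels) and `tall_quasicube_hosted`
  (section `SideFace`): **Step 3 with a hosted side face** — the square-based tall profile carrying a
  projection `M = p² + θ` (`θ ≤ p`) with `u` top-class levels and a surplus of at most `u` rows
  `sⱼ ≤ θ`: hosting the rows on the competitor's big and spare levels costs it one unit per row plus
  `θ` for the maximum, exactly what the tall profile pays, so `9k⁴ + 6k² < 4p + 8k³ + 4k` persists
  (CASE I of the side-face case: enough host levels).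
* `tall_quasicube_odd_hosted` (section `SideFace`): the same for the pronic cross-section
  (`M = p(p+1) + θ`, `θ ≤ p`): `9k⁴ + 9k² ≤ 4p + 14k³ + 4k` persists.
* `quasicube_levels_le` (section `SideFace`): the a-priori bound `c − 1 ≤ 62208·σ` from the
  accounting alone (`(c−1)σ ≤ G₃(n) ≤ 3(⌊∛n⌋+1)²`, `n ≤ 3cσ²`), which settles every bounded range of
  `σ` of the side-face case with an explicit constant.

WHAT THIS FILE DOES NOT CONTAIN (size cap): the SIDE-FACE case `q(σ) < M_s < q(σ+1)` of the
quasicube arithmetic (the hypothesis of `MaininiPiovanoSchmidtStefanelli2019_thm11_of_sideFace_bound`,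
an integer-arithmetic statement about `cubicEIP`, `qsq`, `halfPerim` only) and the discharge itself —
both are in `CubicLatticeSideFace.lean` (`sideFace_height_pow_four_le`,
`MaininiPiovanoSchmidtStefanelli2019_thm11_holds`).  (The per-axis relations
`T_j + T_k = ⌈2√M_i⌉`, `Σ M_i = G₃(n)`, `n ≤ M_iT_i` and the two-level bound do NOT suffice by
themselves for (3.2): numerically they admit boxes deviating by `≈ 0.9·n^{1/6}`.)

## References

* [MaininiPiovanoSchmidtStefanelli2019] E. Mainini, P. Piovano, B. Schmidt, U. Stefanelli,
  *N^{3/4} law in the cubic lattice*, J. Stat. Phys. 176 (2019) 1480–1499, arXiv:1807.00811 —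
  Theorem 1.1, §2, §3 (eq. (3.1), (3.2), Steps 1–5).
* [MaininiSchmidt2020] E. Mainini, B. Schmidt, *Maximal fluctuations around the Wulff shape for
  edge-isoperimetric sets in ℤ^d: a sharp scaling law*, Comm. Math. Phys. 380 (2020) 947–971,
  arXiv:2003.01679 — Definition 2.11, Proposition 3.2, Corollary 3.3.
* [MaininiPiovanoStefanelli2014] E. Mainini, P. Piovano, U. Stefanelli, *Finite crystallization in
  the square lattice*, Nonlinearity 27 (2014) 717–737 — Proposition 4.3, Theorem 5.1, Proposition 6.3.
* [FriedrichKreutz2023] M. Friedrich, L. Kreutz, arXiv:2209.14880 — §4.1.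
* [AlonsoCerf1996] L. Alonso, R. Cerf, Electron. J. Combin. 3 (1996) R27 — Corollary 3.4.
-/

open Finset

namespace Literature.MathematicalPhysics.StatisticalMechanics

open Literature.Probability.LatticeModels

/-! ### Splitting a configuration at an unoccupied level -/

section Gap

variable {d : ℕ}

/-- The first coordinate of a unit step `±eᵢ` is `0` or `±1`. [folklore] -/
private theorem unitStep_apply_zero_bounds (i : Fin (d + 1)) (b : Bool) :
    unitStep i b 0 ≤ 1 ∧ -1 ≤ unitStep i b 0 := by
  unfold unitStep
  rw [Pi.single_apply]
  split_ifs <;> norm_num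

/-- A height not attained by `A`: no point of `A` has first coordinate `c`.
[cite: MaininiSchmidt2020, Proposition 3.2 (the set K_s of nonempty sections)] -/
theorem apply_zero_ne_of_not_mem_firstCoords {A : Finset (Site (d + 1))} {c : ℤ}
    (hc : c ∉ firstCoords A) {x : Site (d + 1)} (hx : x ∈ A) : x 0 ≠ c :=
  fun h => hc (mem_image.2 ⟨x, hx, h⟩)

/-- **Splitting at an empty level.**  If no point of `A ⊂ ℤ^{d+1}` has first coordinate `c`, the
boundary pairs of `A` are exactly those of its part below `c` together with those of its part
above `c` (a unit step changes the first coordinate by at most one, so it cannot jump the empty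
level). [cite: MaininiPiovanoStefanelli2014, Theorem 5.1 (connectedness of ground states: the two-cluster computation)] -/
theorem boundaryPairs_eq_union_of_not_mem_firstCoords (A : Finset (Site (d + 1))) {c : ℤ}
    (hc : c ∉ firstCoords A) :
    boundaryPairs A =
      boundaryPairs (A.filter fun x => x 0 < c) ∪ boundaryPairs (A.filter fun x => c < x 0) := by
  classical
  ext ⟨x, i, b⟩
  simp only [mem_union, mem_boundaryPairs, mem_filter, Pi.add_apply]
  obtain ⟨hu1, hu2⟩ := unitStep_apply_zero_bounds i b
  constructor
  · rintro ⟨hx, hout⟩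
    rcases lt_or_gt_of_ne (apply_zero_ne_of_not_mem_firstCoords hc hx) with h | h
    · exact Or.inl ⟨⟨hx, h⟩, fun h' => hout h'.1⟩
    · exact Or.inr ⟨⟨hx, h⟩, fun h' => hout h'.1⟩
  · rintro (⟨⟨hx, h⟩, hout⟩ | ⟨⟨hx, h⟩, hout⟩)
    · refine ⟨hx, fun hy => hout ⟨hy, ?_⟩⟩
      have hne := apply_zero_ne_of_not_mem_firstCoords hc hy
      simp only [Pi.add_apply] at hne
      omega
    · refine ⟨hx, fun hy => hout ⟨hy, ?_⟩⟩
      have hne := apply_zero_ne_of_not_mem_firstCoords hc hy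
      simp only [Pi.add_apply] at hne
      omega

/-- The two parts of a split configuration have disjoint boundary pairs (their base points differ).
[cite: MaininiPiovanoStefanelli2014, Theorem 5.1] -/
theorem disjoint_boundaryPairs_filter_lt_gt (A : Finset (Site (d + 1))) (c : ℤ) :
    Disjoint (boundaryPairs (A.filter fun x => x 0 < c))
      (boundaryPairs (A.filter fun x => c < x 0)) := by
  classical
  rw [Finset.disjoint_left]
  rintro ⟨x, i, b⟩ h1 h2
  rw [mem_boundaryPairs] at h1 h2
  have e1 := (mem_filter.1 h1.1).2
  have e2 := (mem_filter.1 h2.1).2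
  dsimp only at e1 e2
  omega

/-- The occupied heights of the lower part. [cite: MaininiSchmidt2020, Proposition 3.2 (K_s)] -/
theorem firstCoords_filter_lt (A : Finset (Site (d + 1))) (c : ℤ) :
    firstCoords (A.filter fun x => x 0 < c) = (firstCoords A).filter fun t => t < c := by
  classical
  ext t
  simp only [firstCoords, mem_image, mem_filter]
  constructor
  · rintro ⟨x, ⟨hx, hp⟩, rfl⟩
    exact ⟨⟨x, hx, rfl⟩, hp⟩
  · rintro ⟨⟨x, hx, rfl⟩, hp⟩
    exact ⟨x, ⟨hx, hp⟩, rfl⟩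

/-- The occupied heights of the upper part. [cite: MaininiSchmidt2020, Proposition 3.2 (K_s)] -/
theorem firstCoords_filter_gt (A : Finset (Site (d + 1))) (c : ℤ) :
    firstCoords (A.filter fun x => c < x 0) = (firstCoords A).filter fun t => c < t := by
  classical
  ext t
  simp only [firstCoords, mem_image, mem_filter]
  constructor
  · rintro ⟨x, ⟨hx, hp⟩, rfl⟩
    exact ⟨⟨x, hx, rfl⟩, hp⟩
  · rintro ⟨⟨x, hx, rfl⟩, hp⟩
    exact ⟨x, ⟨hx, hp⟩, rfl⟩

/-- Below the cut, the slices of the lower part are the slices of `A`. [cite: MaininiSchmidt2020, Proposition 3.2 (S_{s,k})] -/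
theorem sliceAt_filter_lt (A : Finset (Site (d + 1))) {c t : ℤ} (ht : t < c) :
    sliceAt (A.filter fun x => x 0 < c) t = sliceAt A t := by
  classical
  ext y
  simp only [mem_sliceAt, mem_filter, Fin.cons_zero]
  exact ⟨fun h => h.1, fun h => ⟨h, ht⟩⟩

/-- Above the cut, the slices of the upper part are the slices of `A`. [cite: MaininiSchmidt2020, Proposition 3.2 (S_{s,k})] -/
theorem sliceAt_filter_gt (A : Finset (Site (d + 1))) {c t : ℤ} (ht : c < t) :
    sliceAt (A.filter fun x => c < x 0) t = sliceAt A t := by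
  classical
  ext y
  simp only [mem_sliceAt, mem_filter, Fin.cons_zero]
  exact ⟨fun h => h.1, fun h => ⟨h, ht⟩⟩

end Gap

/-! ### The sorted slice profile, with its maximum identified as a slice -/

section Profile

/-- Summing a function over a list, by position. [folklore] -/
private theorem sum_map_eq_sum_range_getD' (l : List ℕ) (g : ℕ → ℕ) :
    (l.map g).sum = ∑ k ∈ range l.length, g (l.getD k 0) := by
  induction l with
  | nil => simp
  | cons a l ih =>
    rw [List.map_cons, List.sum_cons, List.length_cons, Finset.sum_range_succ', ih]
    simp [add_comm]

/-- **The decreasing rearrangement of the slice cardinalities, with its top identified**: as the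
tree's `exists_sorted_sliceProfile` ([MS20] Proposition 3.2, `τ = f ∘ σ` non-increasing), and in
addition `f(0)` IS the cardinality of some slice of `C` (the largest one).
[cite: MaininiSchmidt2020, Proposition 3.2 (decreasing rearrangement τ = f ∘ σ)] -/
theorem exists_sorted_sliceProfile_max (C : Finset (Site 3)) :
    ∃ f : ℕ → ℕ, Antitone f ∧ (∀ k, k < #(firstCoords C) → 0 < f k) ∧
      (∀ k, #(firstCoords C) ≤ k → f k = 0) ∧
      ∑ k ∈ range #(firstCoords C), f k = #C ∧
      ∑ k ∈ range #(firstCoords C), 2 * halfPerim (f k) =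
        ∑ t ∈ firstCoords C, 2 * halfPerim #(sliceAt C t) ∧
      (0 < #(firstCoords C) → ∃ t ∈ firstCoords C, f 0 = #(sliceAt C t)) := by
  classical
  set μ : Multiset ℕ := (firstCoords C).val.map fun t => #(sliceAt C t) with hμ
  set L : List ℕ := (μ.sort (· ≤ ·)).reverse with hL
  have hLlen : L.length = #(firstCoords C) := by
    rw [hL, List.length_reverse, Multiset.length_sort, hμ, Multiset.card_map, card_val]
  have hLmem : ∀ a ∈ L, ∃ t ∈ firstCoords C, a = #(sliceAt C t) := by
    intro a ha
    rw [hL, List.mem_reverse, Multiset.mem_sort, hμ, Multiset.mem_map] at ha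
    obtain ⟨t, ht, rfl⟩ := ha
    exact ⟨t, by simpa using ht, rfl⟩
  have hLpw : L.Pairwise (· ≥ ·) := by
    rw [hL, List.pairwise_reverse]
    exact Multiset.pairwise_sort _ _
  have hmapsum : ∀ g : ℕ → ℕ, (L.map g).sum = ∑ t ∈ firstCoords C, g #(sliceAt C t) := by
    intro g
    rw [hL, List.map_reverse, List.sum_reverse, ← Multiset.sum_coe, ← Multiset.map_coe,
      Multiset.sort_eq, hμ, Multiset.map_map, sum_eq_multiset_sum]
    rfl
  have hgetD : ∀ k, (hk : k < L.length) → L.getD k 0 = L[k] := fun k hk => by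
    simp [List.getD_eq_getElem?_getD, List.getElem?_eq_getElem hk]
  have hmemk : ∀ k, k < L.length → L.getD k 0 ∈ L := fun k hk => by
    rw [hgetD k hk]; exact List.getElem_mem hk
  refine ⟨fun k => L.getD k 0, ?_, ?_, ?_, ?_, ?_, ?_⟩
  · intro a b hab
    dsimp only
    by_cases hb : b < L.length
    · have ha : a < L.length := lt_of_le_of_lt hab hb
      rw [hgetD b hb, hgetD a ha]
      rcases hab.lt_or_eq with hlt | heq
      · exact List.pairwise_iff_getElem.1 hLpw a b ha hb hlt
      · subst heq; exact le_rfl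
    · have : L.getD b 0 = 0 := by
        simp [List.getD_eq_getElem?_getD, Nat.le_of_not_lt hb]
      rw [this]; exact Nat.zero_le _
  · intro k hk
    rw [← hLlen] at hk
    obtain ⟨t, ht, h⟩ := hLmem _ (hmemk k hk)
    dsimp only
    rw [h, card_pos]
    exact sliceAt_nonempty ht
  · intro k hk
    rw [← hLlen] at hk
    simp [List.getD_eq_getElem?_getD, hk]
  · show ∑ k ∈ range #(firstCoords C), L.getD k 0 = #C
    have h := sum_map_eq_sum_range_getD' L id
    simp only [List.map_id, id] at h
    rw [← hLlen, ← h, ← List.map_id L, hmapsum, card_eq_sum_card_sliceAt (A := C)]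
    rfl
  · rw [← hLlen, ← sum_map_eq_sum_range_getD' L (fun a => 2 * halfPerim a), hmapsum]
  · intro hT
    rw [← hLlen] at hT
    exact hLmem _ (hmemk 0 hT)

end Profile

/-! ### Minimizers have no empty level between occupied levels -/

section NoGap

/-- **An `EIP³` minimizer occupies an interval of heights**: if it has points below and above the
plane `{x₀ = c}`, it meets that plane.  Otherwise its boundary pairs are those of the two parts,
each part pays twice its own projection vertically, and the sorted daisy stack of ALL the slices
(which pays only twice the largest slice) would have at least two boundary pairs fewer at the same
cardinality. [cite: MaininiPiovanoStefanelli2014, Theorem 5.1 (ground states are connected); MaininiSchmidt2020, Proposition 3.2] -/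
theorem IsEIPMinimizer.mem_firstCoords_of_lt_of_lt {C : Finset (Site 3)} (hC : IsEIPMinimizer C)
    {c : ℤ} (hl : ∃ t ∈ firstCoords C, t < c) (hr : ∃ t ∈ firstCoords C, c < t) :
    c ∈ firstCoords C := by
  classical
  by_contra hc
  set A₁ := C.filter fun x => x 0 < c with hA₁
  set A₂ := C.filter fun x => c < x 0 with hA₂
  have hsplit : #(boundaryPairs C) = #(boundaryPairs A₁) + #(boundaryPairs A₂) := by
    rw [boundaryPairs_eq_union_of_not_mem_firstCoords C hc,
      card_union_of_disjoint (disjoint_boundaryPairs_filter_lt_gt C c)]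
  have h1 := sum_card_boundaryPairs_sliceAt_add_le (A := A₁)
  have h2 := sum_card_boundaryPairs_sliceAt_add_le (A := A₂)
  have hfc1 : firstCoords A₁ = (firstCoords C).filter fun t => t < c := firstCoords_filter_lt C c
  have hfc2 : firstCoords A₂ = (firstCoords C).filter fun t => c < t := firstCoords_filter_gt C c
  have hunion : firstCoords C = firstCoords A₁ ∪ firstCoords A₂ := by
    rw [hfc1, hfc2]
    ext t
    simp only [mem_union, mem_filter]
    constructor
    · intro ht
      rcases lt_trichotomy t c with h | h | h
      · exact Or.inl ⟨ht, h⟩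
      · exact absurd ht (h ▸ hc)
      · exact Or.inr ⟨ht, h⟩
    · rintro (⟨ht, -⟩ | ⟨ht, -⟩) <;> exact ht
  have hdisj : Disjoint (firstCoords A₁) (firstCoords A₂) := by
    rw [hfc1, hfc2, disjoint_filter]
    intro t _ h1 h2
    omega
  have hsum : ∑ t ∈ firstCoords C, #(boundaryPairs (sliceAt C t)) =
      ∑ t ∈ firstCoords A₁, #(boundaryPairs (sliceAt A₁ t)) +
        ∑ t ∈ firstCoords A₂, #(boundaryPairs (sliceAt A₂ t)) := by
    rw [hunion, sum_union hdisj]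
    congr 1
    · refine sum_congr rfl fun t ht => ?_
      rw [hfc1, mem_filter] at ht
      rw [sliceAt_filter_lt C ht.2]
    · refine sum_congr rfl fun t ht => ?_
      rw [hfc2, mem_filter] at ht
      rw [sliceAt_filter_gt C ht.2]
  -- the sorted profile of `C` and its daisy stack
  obtain ⟨f, hanti, hpos, hzero, hsumf, hsumg, hmax⟩ := exists_sorted_sliceProfile_max C
  set T := #(firstCoords C) with hT
  have hTpos : 0 < T := by
    obtain ⟨t, ht, -⟩ := hl
    exact card_pos.2 ⟨t, ht⟩
  obtain ⟨t₀, ht₀, hft₀⟩ := hmax hTpos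
  have hstackcard : #(daisyStack f T) = #C := by rw [card_daisyStack, hsumf]
  have hstackbp : #(boundaryPairs (daisyStack f T)) =
      ∑ k ∈ range T, 2 * halfPerim (f k) + 2 * f 0 :=
    card_boundaryPairs_daisyStack hpos hanti (hzero T le_rfl)
  have hmin := hC _ hstackcard
  have h2d : ∑ t ∈ firstCoords C, 2 * halfPerim #(sliceAt C t) ≤
      ∑ t ∈ firstCoords C, #(boundaryPairs (sliceAt C t)) :=
    sum_le_sum fun t _ => two_mul_ceil_two_sqrt_le_card_boundaryPairs _
  -- `f 0` is a slice of one part; the other part is non-empty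
  have key : f 0 + 1 ≤ #(dropFirst A₁) + #(dropFirst A₂) := by
    have ht₀c : t₀ ≠ c := fun h => hc (h ▸ ht₀)
    rcases lt_or_gt_of_ne ht₀c with h | h
    · have e1 : f 0 ≤ #(dropFirst A₁) := by
        rw [hft₀, ← sliceAt_filter_lt C h]
        exact card_sliceAt_le_card_dropFirst _
      have e2 : 1 ≤ #(dropFirst A₂) := by
        obtain ⟨t, ht, htc⟩ := hr
        have ht' : t ∈ firstCoords A₂ := by rw [hfc2, mem_filter]; exact ⟨ht, htc⟩
        obtain ⟨y, hy⟩ := sliceAt_nonempty ht'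
        exact card_pos.2 ⟨y, sliceAt_subset_dropFirst _ hy⟩
      omega
    · have e1 : f 0 ≤ #(dropFirst A₂) := by
        rw [hft₀, ← sliceAt_filter_gt C h]
        exact card_sliceAt_le_card_dropFirst _
      have e2 : 1 ≤ #(dropFirst A₁) := by
        obtain ⟨t, ht, htc⟩ := hl
        have ht' : t ∈ firstCoords A₁ := by rw [hfc1, mem_filter]; exact ⟨ht, htc⟩
        obtain ⟨y, hy⟩ := sliceAt_nonempty ht'
        exact card_pos.2 ⟨y, sliceAt_subset_dropFirst _ hy⟩
      omega
  omega

/-- **The occupied heights of an `EIP³` minimizer form a lattice interval** `{t_min, …, t_max}`.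
[cite: MaininiPiovanoStefanelli2014, Theorem 5.1; MaininiSchmidt2020, Proposition 3.2] -/
theorem IsEIPMinimizer.firstCoords_eq_Icc {C : Finset (Site 3)} (hC : IsEIPMinimizer C)
    (hne : (firstCoords C).Nonempty) :
    firstCoords C = Icc ((firstCoords C).min' hne) ((firstCoords C).max' hne) := by
  refine Subset.antisymm (fun t ht => mem_Icc.2 ⟨min'_le _ _ ht, le_max' _ _ ht⟩) fun t ht => ?_
  rw [mem_Icc] at ht
  rcases ht.1.eq_or_lt with h | h
  · rw [← h]; exact min'_mem _ _
  rcases ht.2.eq_or_lt with h' | h'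
  · rw [h']; exact max'_mem _ _
  exact hC.mem_firstCoords_of_lt_of_lt ⟨_, min'_mem _ _, h⟩ ⟨_, max'_mem _ _, h'⟩

/-- Hence the number of occupied heights is the height DIAMETER plus one, and after a translation
the heights are exactly `1, …, #heights`. [cite: MaininiPiovanoSchmidtStefanelli2019, §3 (Q(M_n) = Q(ℓ₁+1, ℓ₂+1, ℓ₃+1) up to translation)] -/
theorem IsEIPMinimizer.exists_shift_firstCoords {C : Finset (Site 3)} (hC : IsEIPMinimizer C)
    (hne : C.Nonempty) :
    ∃ a : ℤ, ∀ z ∈ C, 1 ≤ z 0 - a ∧ z 0 - a ≤ #(firstCoords C) := by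
  classical
  set K := firstCoords C with hK
  have hKne : K.Nonempty := hne.image _
  have hcard : #K = #(Icc (K.min' hKne) (K.max' hKne)) :=
    congrArg card (hC.firstCoords_eq_Icc hKne)
  rw [Int.card_Icc] at hcard
  have hmm : K.min' hKne ≤ K.max' hKne := min'_le _ _ (max'_mem _ _)
  refine ⟨K.min' hKne - 1, fun z hz => ?_⟩
  have hzK : z 0 ∈ K := mem_image_of_mem _ hz
  have h1 := min'_le _ _ hzK
  have h2 := le_max' _ _ hzK
  constructor
  · omega
  · rw [hcard]; omega

end NoGap

/-! ### The largest slice of a minimizer is its whole projection -/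

section MaxSlice

/-- **In an `EIP³` minimizer the largest slice IS the projection**: some slice `C_t = C ∩ {x₀ = t}`
(as a subset of `ℤ²`) equals the projection of `C` along `e₀` — equality in the slicing bound
`#Θ₃(C) ≥ Σ_t #Θ₂(C_t) + 2·#(projection)` against the sorted daisy stack, which pays only twice the
largest slice. [cite: MaininiSchmidt2020, Proposition 3.2 (equality b_s(C) = b_s(C_s) for minimizers); MaininiPiovanoSchmidtStefanelli2019, Definition 2.2 (i)] -/
theorem IsEIPMinimizer.exists_sliceAt_eq_dropFirst {C : Finset (Site 3)} (hC : IsEIPMinimizer C)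
    (hne : C.Nonempty) : ∃ t ∈ firstCoords C, sliceAt C t = dropFirst C := by
  classical
  obtain ⟨f, hanti, hpos, hzero, hsumf, hsumg, hmax⟩ := exists_sorted_sliceProfile_max C
  set T := #(firstCoords C) with hT
  have hTpos : 0 < T := by
    obtain ⟨x, hx⟩ := hne
    exact card_pos.2 ⟨x 0, mem_image_of_mem _ hx⟩
  obtain ⟨t₀, ht₀, hft₀⟩ := hmax hTpos
  have hstackcard : #(daisyStack f T) = #C := by rw [card_daisyStack, hsumf]
  have hstackbp : #(boundaryPairs (daisyStack f T)) =
      ∑ k ∈ range T, 2 * halfPerim (f k) + 2 * f 0 :=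
    card_boundaryPairs_daisyStack hpos hanti (hzero T le_rfl)
  have hmin := hC _ hstackcard
  have hLB := sum_card_boundaryPairs_sliceAt_add_le (A := C)
  have h2d : ∑ t ∈ firstCoords C, 2 * halfPerim #(sliceAt C t) ≤
      ∑ t ∈ firstCoords C, #(boundaryPairs (sliceAt C t)) :=
    sum_le_sum fun t _ => two_mul_ceil_two_sqrt_le_card_boundaryPairs _
  have hle : #(dropFirst C) ≤ #(sliceAt C t₀) := by omega
  exact ⟨t₀, ht₀, eq_of_subset_of_card_le (sliceAt_subset_dropFirst t₀) hle⟩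

/-- `latticeSection 0 t C` is the slice `sliceAt C t`. [cite: MaininiSchmidt2020, Definition 2.11] -/
theorem latticeSection_zero_eq_sliceAt {n : ℕ} (C : Finset (Site (n + 1))) (t : ℤ) :
    latticeSection 0 t C = sliceAt C t := by
  classical
  ext y
  simp only [latticeSection, sliceAt, mem_image, mem_filter, Fin.removeNth_zero]

/-- The second coordinate of `C ⊂ ℤ³` is the first coordinate of its projection along `e₀`.
[cite: MaininiSchmidt2020, Definition 2.11 (the identification P)] -/
theorem image_apply_one_eq_image_dropFirst (C : Finset (Site 3)) :
    (C.image fun x => x 1) = (dropFirst C).image fun y => y 0 := by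
  classical
  rw [dropFirst, image_image]
  rfl

/-- The third coordinate of `C ⊂ ℤ³` is the second coordinate of its projection along `e₀`.
[cite: MaininiSchmidt2020, Definition 2.11 (the identification P)] -/
theorem image_apply_two_eq_image_dropFirst (C : Finset (Site 3)) :
    (C.image fun x => x 2) = (dropFirst C).image fun y => y 1 := by
  classical
  rw [dropFirst, image_image]
  rfl

/-- **The shadow relation along `e₀`**: for an `EIP³` minimizer `C`, the numbers `T₁, T₂` of
occupied values of the second and third coordinates and the size `M₀` of its projection along
`e₀` satisfy `T₁ + T₂ = ⌈2√M₀⌉` — the projection is the largest slice, an `EIP²` minimizer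
([MS20] Corollary 3.3), whose numbers of columns and rows add up to `⌈2√·⌉` of its cardinality.
[cite: MaininiSchmidt2020, Corollary 3.3 and Proposition 3.2; MaininiPiovanoStefanelli2014, Proposition 6.3] -/
theorem IsEIPMinimizer.card_image_one_add_card_image_two {C : Finset (Site 3)}
    (hC : IsEIPMinimizer C) :
    #(C.image fun x => x 1) + #(C.image fun x => x 2) = halfPerim #(dropFirst C) := by
  classical
  rcases C.eq_empty_or_nonempty with rfl | hne
  · simp [dropFirst, halfPerim_zero]
  obtain ⟨t₀, -, ht₀⟩ := hC.exists_sliceAt_eq_dropFirst hne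
  have hS : IsEIPMinimizer (dropFirst C) := by
    rw [← ht₀, ← latticeSection_zero_eq_sliceAt]
    exact MaininiSchmidt2020_cor33_three C hC 0 t₀
  rw [image_apply_one_eq_image_dropFirst, image_apply_two_eq_image_dropFirst, halfPerim_def]
  exact hS.card_image_add_card_image_rev 0

/-- `#C ≤ M₀ · T₀`: a configuration has at most (#projection) points on each of its `T₀` occupied
heights. [cite: MaininiSchmidt2020, Proposition 3.2 (f(k) ≤ #P(C))] -/
theorem card_le_card_dropFirst_mul_card_firstCoords (C : Finset (Site 3)) :
    #C ≤ #(dropFirst C) * #(firstCoords C) := by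
  rw [card_eq_sum_card_sliceAt (A := C), mul_comm]
  have h := sum_le_card_nsmul (firstCoords C) (fun t => #(sliceAt C t)) #(dropFirst C)
    fun t _ => card_sliceAt_le_card_dropFirst t
  rwa [smul_eq_mul] at h

/-- `M₀ ≤ T₁ · T₂`: the projection along `e₀` lies in the product of the second and third
coordinate ranges. [cite: FriedrichKreutz2023, §4.1 (n ≤ l(s₀)·lᵛ)] -/
theorem card_dropFirst_le_card_image_one_mul_card_image_two (C : Finset (Site 3)) :
    #(dropFirst C) ≤ #(C.image fun x => x 1) * #(C.image fun x => x 2) := by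
  rw [image_apply_one_eq_image_dropFirst, image_apply_two_eq_image_dropFirst]
  exact card_le_card_image_mul_card_image_rev (dropFirst C) 0

/-- **The three projections of an `EIP³` minimizer add up to `G₃(#C)`** (minimizers are convex
along every lattice line, so every occupied line carries exactly two boundary pairs:
`#Θ₃(C) = 2(#π₀C + #π₁C + #π₂C)`, and `#Θ₃(C) = 2G₃(#C)`).
[cite: MaininiPiovanoSchmidtStefanelli2019, §2 (#Θ = 6n − 2b) with MaininiSchmidt2020, Corollary 3.3] -/
theorem IsEIPMinimizer.sum_card_dropCoord_eq_cubicEIP {C : Finset (Site 3)} (hC : IsEIPMinimizer C) :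
    ∑ i : Fin 3, #(dropCoord i C) = cubicEIP #C := by
  have h1 : #(boundaryPairs C) = 2 * ∑ i : Fin 3, #(dropCoord i C) :=
    card_boundaryPairs_eq_two_mul_sum_card_dropCoord_of_isLineConvex C hC.isLineConvex_three
  have h2 := (isEIPMinimizer_iff_card_boundaryPairs_eq_three C).1 hC
  omega

end MaxSlice

/-! ### Every axis: moving `e_s` to the front -/

section Axes

variable (C : Finset (Site 3)) (s : Fin 3)

/-- `C` with the axis `e_s` moved to the front (a lattice symmetry). [cite: MaininiSchmidt2020, Definition 2.11] -/
noncomputable def toFront : Finset (Site 3) := C.image (relabel (Fin.cycleRange s).symm)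

/-- `toFront` preserves cardinality. [cite: MaininiSchmidt2020, Definition 2.11] -/
theorem card_toFront : #(toFront C s) = #C :=
  card_image_of_injective _ (relabel_injective _)

/-- The heights of `toFront C s` are the `s`-th coordinates of `C`. [cite: MaininiSchmidt2020, Definition 2.11] -/
theorem firstCoords_toFront : firstCoords (toFront C s) = C.image fun x => x s := by
  classical
  rw [firstCoords, toFront, image_image]
  refine image_congr fun x _ => ?_
  simp [Function.comp, relabel_cycleRange_symm_eq_cons]

/-- The projection of `toFront C s` along `e₀` is the projection of `C` along `e_s`.
[cite: MaininiSchmidt2020, Definition 2.11 (P)] -/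
theorem dropFirst_toFront : dropFirst (toFront C s) = dropCoord s C := by
  classical
  rw [dropFirst, toFront, dropCoord, image_image]
  refine image_congr fun x _ => ?_
  simp [Function.comp, relabel_cycleRange_symm_eq_cons]

/-- The later coordinates of `toFront C s` are the coordinates `s.succAbove j` of `C`.
[cite: MaininiSchmidt2020, Definition 2.11 (P)] -/
theorem image_toFront_apply_succ (j : Fin 2) :
    ((toFront C s).image fun x => x j.succ) = C.image fun x => x (s.succAbove j) := by
  classical
  rw [toFront, image_image]
  refine image_congr fun x _ => ?_
  simp [Function.comp, relabel_cycleRange_symm_eq_cons, Fin.removeNth]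

variable {C}

/-- `toFront` of a minimizer is a minimizer. [cite: MaininiSchmidt2020, Definition 2.11] -/
theorem IsEIPMinimizer.isEIPMinimizer_toFront (hC : IsEIPMinimizer C) (s : Fin 3) :
    IsEIPMinimizer (toFront C s) :=
  hC.image_relabel _

end Axes

/-! ### The box of a minimizer -/

section Box

variable {C : Finset (Site 3)}

/-- `(1 : Fin 3).succAbove 0 = 0`. [folklore] -/
private theorem succAbove_one_zero : (1 : Fin 3).succAbove 0 = 0 := by decide
/-- `(1 : Fin 3).succAbove 1 = 2`. [folklore] -/
private theorem succAbove_one_one : (1 : Fin 3).succAbove 1 = 2 := by decide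
/-- `(2 : Fin 3).succAbove 0 = 0`. [folklore] -/
private theorem succAbove_two_zero : (2 : Fin 3).succAbove 0 = 0 := by decide
/-- `(2 : Fin 3).succAbove 1 = 1`. [folklore] -/
private theorem succAbove_two_one : (2 : Fin 3).succAbove 1 = 1 := by decide
/-- `(0 : Fin 3).succAbove 0 = 1`. [folklore] -/
private theorem succAbove_zero_zero : (0 : Fin 3).succAbove 0 = 1 := by decide
/-- `(0 : Fin 3).succAbove 1 = 2`. [folklore] -/
private theorem succAbove_zero_one : (0 : Fin 3).succAbove 1 = 2 := by decide

/-- **The shadow relation in every direction**: for an `EIP³` minimizer, the numbers of occupied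
values of the two coordinates other than `s` add up to `⌈2√(#projection along e_s)⌉`.
[cite: MaininiSchmidt2020, Corollary 3.3 and Proposition 3.2; MaininiPiovanoStefanelli2014, Proposition 6.3] -/
theorem IsEIPMinimizer.card_image_add_card_image_eq_halfPerim (hC : IsEIPMinimizer C) (s : Fin 3) :
    #(C.image fun x => x (s.succAbove 0)) + #(C.image fun x => x (s.succAbove 1)) =
      halfPerim #(dropCoord s C) := by
  have h := (hC.isEIPMinimizer_toFront s).card_image_one_add_card_image_two
  have e1 : ((toFront C s).image fun x => x 1) = C.image fun x => x (s.succAbove 0) :=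
    image_toFront_apply_succ C s 0
  have e2 : ((toFront C s).image fun x => x 2) = C.image fun x => x (s.succAbove 1) :=
    image_toFront_apply_succ C s 1
  rwa [e1, e2, dropFirst_toFront] at h

/-- `#C ≤ (#projection along e_s) · (#occupied values of x_s)`. [cite: MaininiSchmidt2020, Proposition 3.2] -/
theorem card_le_card_dropCoord_mul_card_image (C : Finset (Site 3)) (s : Fin 3) :
    #C ≤ #(dropCoord s C) * #(C.image fun x => x s) := by
  have h := card_le_card_dropFirst_mul_card_firstCoords (toFront C s)
  rwa [card_toFront, dropFirst_toFront, firstCoords_toFront] at h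

/-- The projection along `e_s` lies in the product of the other two coordinate ranges.
[cite: FriedrichKreutz2023, §4.1] -/
theorem card_dropCoord_le_mul (C : Finset (Site 3)) (s : Fin 3) :
    #(dropCoord s C) ≤ #(C.image fun x => x (s.succAbove 0)) * #(C.image fun x => x (s.succAbove 1)) := by
  have h := card_dropFirst_le_card_image_one_mul_card_image_two (toFront C s)
  have e1 : ((toFront C s).image fun x => x 1) = C.image fun x => x (s.succAbove 0) :=
    image_toFront_apply_succ C s 0
  have e2 : ((toFront C s).image fun x => x 2) = C.image fun x => x (s.succAbove 1) :=
    image_toFront_apply_succ C s 1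
  rwa [dropFirst_toFront, e1, e2] at h

/-- **No gaps in any direction**: after a translation the `s`-th coordinates of an `EIP³`
minimizer fill exactly `{1, …, T_s}`, `T_s` the number of its occupied values.
[cite: MaininiPiovanoSchmidtStefanelli2019, §3 eq. (3.1) (Q(M_n) = Q(ℓ₁+1, ℓ₂+1, ℓ₃+1))] -/
theorem IsEIPMinimizer.exists_shift_apply (hC : IsEIPMinimizer C) (hne : C.Nonempty) (s : Fin 3) :
    ∃ a : ℤ, ∀ z ∈ C, 1 ≤ z s - a ∧ z s - a ≤ #(C.image fun x => x s) := by
  classical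
  have hne' : (toFront C s).Nonempty := by rw [toFront]; exact hne.image _
  obtain ⟨a, ha⟩ := (hC.isEIPMinimizer_toFront s).exists_shift_firstCoords hne'
  refine ⟨a, fun z hz => ?_⟩
  have h := ha (relabel (Fin.cycleRange s).symm z) (by rw [toFront]; exact mem_image_of_mem _ hz)
  rw [firstCoords_toFront, relabel_cycleRange_symm_eq_cons] at h
  simpa only [Fin.cons_zero] using h

/-- **Near-square shadows**: if `u + v = ⌈2√M⌉` and `M ≤ uv` then `(u − v)² ≤ 2(u + v)` — a
rectangle that is an `EIP²` minimizer is a quasi-square up to `√(perimeter)`.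
[cite: MaininiPiovanoStefanelli2014, Proposition 4.3 (daisies: s' ∈ {s, s+1})] -/
theorem sq_sub_le_of_add_eq_halfPerim {M u v : ℕ} (h : u + v = halfPerim M) (hM : M ≤ u * v) :
    ((u : ℤ) - v) ^ 2 ≤ 2 * ((u : ℤ) + v) := by
  rcases Nat.eq_zero_or_pos (u + v) with h0 | hpos
  · have hu : u = 0 := by omega
    have hv : v = 0 := by omega
    subst hu; subst hv; simp
  obtain ⟨w, hw⟩ : ∃ w, u + v = w + 1 := ⟨u + v - 1, by omega⟩
  have hlt : qsq w < M := qsq_lt_of_lt_halfPerim (by rw [← h]; omega)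
  have hq := sq_le_four_mul_qsq_add_one w
  have h3 : w ^ 2 + 3 ≤ 4 * (u * v) := by omega
  have h4 : ((w : ℤ)) ^ 2 + 3 ≤ 4 * ((u : ℤ) * v) := by exact_mod_cast h3
  have h5 : (u : ℤ) + v = w + 1 := by exact_mod_cast hw
  nlinarith [h4, h5]

/-- `G₃(n) ≤ 3(⌊∛n⌋ + 1)²` (the optimum is at most the surface of the next cube).
[cite: AlonsoCerf1996, Corollary 3.4] -/
theorem cubicEIP_le_three_mul_sq (n : ℕ) : cubicEIP n ≤ 3 * (latticeRootFloor 3 n + 1) ^ 2 := by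
  rcases Nat.eq_zero_or_pos n with hn0 | hnpos
  · rw [hn0, cubicEIP_zero]; exact Nat.zero_le _
  obtain ⟨hm1, hm2⟩ := latticeRootFloor_three_spec n
  set m := latticeRootFloor 3 n with hm
  set F := cubicFace m n with hFdef
  have hF : m * F ≤ n ∧ n < m * F + F ∧ F ≤ (m + 1) ^ 2 := by
    have e1 : (m + 1) ^ 3 = m * (m + 1) ^ 2 + (m + 1) ^ 2 := by ring
    have e2 : m * (m + 1) ^ 2 = m ^ 2 * (m + 1) + m * (m + 1) := by ring
    have e3 : m ^ 2 * (m + 1) = m ^ 3 + m ^ 2 := by ring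
    have e9 : m * (m * (m + 1)) = m ^ 2 * (m + 1) := by ring
    have e13 : m * m ^ 2 = m ^ 3 := by ring
    have i1 : m * (m + 1) ≤ (m + 1) ^ 2 := by nlinarith
    have i2 : m ^ 2 ≤ (m + 1) ^ 2 := by nlinarith
    by_cases htop : m * (m + 1) ^ 2 ≤ n
    · rw [hFdef, cubicFace_of_top htop]; omega
    · by_cases hmid : m ^ 2 * (m + 1) ≤ n
      · rw [hFdef, cubicFace_of_mid (Nat.lt_of_not_le htop) hmid]; omega
      · rw [hFdef, cubicFace_of_bot (Nat.lt_of_not_le hmid)]; omega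
  obtain ⟨hF1, hF2, hF3⟩ := hF
  rw [cubicEIP_eq (by omega) hm1 hm2 hFdef.symm]
  have h1 : halfPerim F ≤ 2 * (m + 1) := by
    rw [← halfPerim_sq (show 1 ≤ m + 1 by omega)]; exact halfPerim_mono hF3
  have h2 : halfPerim (n - m * F) ≤ 2 * (m + 1) :=
    (halfPerim_mono (show n - m * F ≤ F by omega)).trans h1
  have h3 : m * halfPerim F ≤ m * (2 * (m + 1)) := Nat.mul_le_mul_left m h1
  nlinarith
set_option maxHeartbeats 400000 in
/-- **The box of an `EIP³` minimizer** — all three sides within `O(√(⌊∛n⌋))` of `⌊∛n⌋ + 1`: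
with `m = ⌊∛n⌋`, `T_s` the number of occupied values of the coordinate `s` and
`q = ⌊√(6m + 8)⌋`, one has `m − q ≤ T_s ≤ m + 1 + q` for `s = 0, 1, 2` (for a non-empty minimizer).
Mechanism: the three projections add up to `G₃(n) ≤ 3(m+1)²` while each exceeds the quasi-square
below the sum of the two other sides, so `T₀ + T₁ + T₂ ≤ 3m + 4`; and two sides are the shadows of a
maximal slice — a planar minimizer — so they differ by at most `√(2(T_j + T_k))`.
[cite: MaininiPiovanoSchmidtStefanelli2019, §3 eq. (3.2) (max_i |ℓ_i − ℓ_n| ≤ K n^{1/12} + o(n^{1/12}); here the weaker O(n^{1/6}))] -/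
theorem IsEIPMinimizer.box_sides_all (hC : IsEIPMinimizer C) (hne : C.Nonempty) :
    (latticeRootFloor 3 #C ≤ #(C.image fun x => x 0) + Nat.sqrt (6 * latticeRootFloor 3 #C + 8) ∧
      #(C.image fun x => x 0) ≤
        latticeRootFloor 3 #C + 1 + Nat.sqrt (6 * latticeRootFloor 3 #C + 8)) ∧
    (latticeRootFloor 3 #C ≤ #(C.image fun x => x 1) + Nat.sqrt (6 * latticeRootFloor 3 #C + 8) ∧
      #(C.image fun x => x 1) ≤
        latticeRootFloor 3 #C + 1 + Nat.sqrt (6 * latticeRootFloor 3 #C + 8)) ∧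
    (latticeRootFloor 3 #C ≤ #(C.image fun x => x 2) + Nat.sqrt (6 * latticeRootFloor 3 #C + 8) ∧
      #(C.image fun x => x 2) ≤
        latticeRootFloor 3 #C + 1 + Nat.sqrt (6 * latticeRootFloor 3 #C + 8)) := by
  classical
  obtain ⟨hm1, hm2⟩ := latticeRootFloor_three_spec #C
  set m := latticeRootFloor 3 #C with hm
  set q := Nat.sqrt (6 * m + 8) with hq
  set T0 := #(C.image fun x => x 0) with hT0
  set T1 := #(C.image fun x => x 1) with hT1
  set T2 := #(C.image fun x => x 2) with hT2
  set M0 := #(dropCoord 0 C) with hM0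
  set M1 := #(dropCoord 1 C) with hM1
  set M2 := #(dropCoord 2 C) with hM2
  -- the three shadow relations and the product bounds
  have hs0 : T1 + T2 = halfPerim M0 := by
    have h := hC.card_image_add_card_image_eq_halfPerim 0
    simpa only [succAbove_zero_zero, succAbove_zero_one] using h
  have hs1 : T0 + T2 = halfPerim M1 := by
    have h := hC.card_image_add_card_image_eq_halfPerim 1
    simpa only [succAbove_one_zero, succAbove_one_one] using h
  have hs2 : T0 + T1 = halfPerim M2 := by
    have h := hC.card_image_add_card_image_eq_halfPerim 2
    simpa only [succAbove_two_zero, succAbove_two_one] using h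
  have hp0 : M0 ≤ T1 * T2 := by
    have h := card_dropCoord_le_mul C 0
    simpa only [succAbove_zero_zero, succAbove_zero_one] using h
  have hp1 : M1 ≤ T0 * T2 := by
    have h := card_dropCoord_le_mul C 1
    simpa only [succAbove_one_zero, succAbove_one_one] using h
  have hp2 : M2 ≤ T0 * T1 := by
    have h := card_dropCoord_le_mul C 2
    simpa only [succAbove_two_zero, succAbove_two_one] using h
  have hsum : M0 + M1 + M2 = cubicEIP #C := by
    have h := hC.sum_card_dropCoord_eq_cubicEIP
    rwa [Fin.sum_univ_three] at h
  have hG := cubicEIP_le_three_mul_sq #C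
  rw [← hm] at hG
  have hvol : #C ≤ T0 * T1 * T2 := by
    have h := card_le_prod_card_image_apply C
    rwa [Fin.prod_univ_three] at h
  -- positivity of the sides
  obtain ⟨x, hx⟩ := hne
  have hT0p : 1 ≤ T0 := card_pos.2 ⟨_, mem_image_of_mem (fun x : Site 3 => x 0) hx⟩
  have hT1p : 1 ≤ T1 := card_pos.2 ⟨_, mem_image_of_mem (fun x : Site 3 => x 1) hx⟩
  have hT2p : 1 ≤ T2 := card_pos.2 ⟨_, mem_image_of_mem (fun x : Site 3 => x 2) hx⟩
  -- `(σ − 1)² + 3 ≤ 4M` for each axis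
  have key : ∀ {M u v : ℕ}, u + v = halfPerim M → 1 ≤ u + v → (u + v - 1) ^ 2 + 3 ≤ 4 * M := by
    intro M u v h huv
    have hlt : qsq (u + v - 1) < M := qsq_lt_of_lt_halfPerim (by rw [← h]; omega)
    have hq' := sq_le_four_mul_qsq_add_one (u + v - 1)
    omega
  have k0 := key hs0 (by omega)
  have k1 := key hs1 (by omega)
  have k2 := key hs2 (by omega)
  -- `T0 + T1 + T2 ≤ 3m + 4`
  have hsumT : T0 + T1 + T2 ≤ 3 * m + 4 := by
    obtain ⟨a0, ha0⟩ : ∃ a, T1 + T2 = a + 1 := ⟨T1 + T2 - 1, by omega⟩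
    obtain ⟨a1, ha1⟩ : ∃ a, T0 + T2 = a + 1 := ⟨T0 + T2 - 1, by omega⟩
    obtain ⟨a2, ha2⟩ : ∃ a, T0 + T1 = a + 1 := ⟨T0 + T1 - 1, by omega⟩
    rw [ha0, Nat.add_sub_cancel] at k0
    rw [ha1, Nat.add_sub_cancel] at k1
    rw [ha2, Nat.add_sub_cancel] at k2
    have h3 : a0 ^ 2 + a1 ^ 2 + a2 ^ 2 + 9 ≤ 12 * (m + 1) ^ 2 := by omega
    have h4 : (a0 + a1 + a2) ^ 2 ≤ 3 * (a0 ^ 2 + a1 ^ 2 + a2 ^ 2) := by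
      nlinarith [sq_nonneg ((a0 : ℤ) - a1), sq_nonneg ((a1 : ℤ) - a2), sq_nonneg ((a0 : ℤ) - a2)]
    have h5 : (a0 + a1 + a2) ^ 2 < (6 * (m + 1)) ^ 2 := by nlinarith
    have h6 : a0 + a1 + a2 < 6 * (m + 1) := lt_of_pow_lt_pow_left₀ 2 (Nat.zero_le _) h5
    omega
  -- pairwise closeness `(T_j − T_k)² ≤ 2(T_j + T_k) ≤ 6m + 8`
  have c0 := sq_sub_le_of_add_eq_halfPerim hs0 hp0
  have c1 := sq_sub_le_of_add_eq_halfPerim hs1 hp1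
  have c2 := sq_sub_le_of_add_eq_halfPerim hs2 hp2
  have hq1 : q ^ 2 ≤ 6 * m + 8 := Nat.sqrt_le' _
  have hq2 : 6 * m + 8 < (q + 1) ^ 2 := Nat.lt_succ_sqrt' _
  have absle : ∀ {u v : ℕ}, ((u : ℤ) - v) ^ 2 ≤ 2 * ((u : ℤ) + v) → u + v ≤ 3 * m + 4 →
      u ≤ v + q ∧ v ≤ u + q := by
    intro u v h huv
    have h' : ((u : ℤ) - v) ^ 2 < ((q : ℤ) + 1) ^ 2 := by
      have : (2 : ℤ) * ((u : ℤ) + v) ≤ 6 * m + 8 := by omega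
      have hq2' : ((6 * m + 8 : ℕ) : ℤ) < ((q + 1) ^ 2 : ℕ) := by exact_mod_cast hq2
      push_cast at hq2'
      linarith
    have hab := abs_lt_of_sq_lt_sq' h' (by positivity)
    constructor <;> omega
  have d12 := absle c0 (by omega)
  have d02 := absle c1 (by omega)
  have d01 := absle c2 (by omega)
  -- the largest side is at least `m` (volume), hence every side is at least `m − q`
  have hmax : m ≤ T0 ∨ m ≤ T1 ∨ m ≤ T2 := by
    by_contra h0
    push Not at h0
    obtain ⟨h0, h1, h2⟩ := h0
    obtain ⟨k, hk⟩ : ∃ k, m = k + 1 := ⟨m - 1, by omega⟩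
    have h3 : T0 * T1 * T2 ≤ k * (k + 1) * (k + 1) :=
      Nat.mul_le_mul (Nat.mul_le_mul (by omega) (by omega)) (by omega)
    have h4 : m ^ 3 = k * (k + 1) * (k + 1) + (k + 1) ^ 2 := by rw [hk]; ring
    have h5 : 1 ≤ (k + 1) ^ 2 := Nat.one_le_pow _ _ (by omega)
    omega
  refine ⟨⟨?_, ?_⟩, ⟨?_, ?_⟩, ⟨?_, ?_⟩⟩ <;> omega

/-- **The box of an `EIP³` minimizer, side by side**: `m − q ≤ T_s ≤ m + 1 + q` for every axis `s`
(`m = ⌊∛#C⌋`, `q = ⌊√(6m+8)⌋`). [cite: MaininiPiovanoSchmidtStefanelli2019, §3 eq. (3.2)] -/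
theorem IsEIPMinimizer.box_sides (hC : IsEIPMinimizer C) (hne : C.Nonempty) (s : Fin 3) :
    latticeRootFloor 3 #C ≤ #(C.image fun x => x s) + Nat.sqrt (6 * latticeRootFloor 3 #C + 8) ∧
      #(C.image fun x => x s) ≤
        latticeRootFloor 3 #C + 1 + Nat.sqrt (6 * latticeRootFloor 3 #C + 8) := by
  obtain ⟨h0, h1, h2⟩ := hC.box_sides_all hne
  fin_cases s
  exacts [h0, h1, h2]

end Box

/-! ### The `N^{5/6}` fluctuation bound around the Wulff cube -/

section WeakLaw

open scoped symmDiff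

/-- Three-factor telescoping: if `pᵢ ≤ tᵢ ≤ pᵢ + D` and `tᵢ ≤ B` then
`t₀t₁t₂ ≤ p₀p₁p₂ + 3·D·B²`. [folklore] -/
private theorem mul_three_le_of_close {p0 p1 p2 t0 t1 t2 D B : ℕ} (hp0 : p0 ≤ t0) (hp1 : p1 ≤ t1)
    (hp2 : p2 ≤ t2) (h0 : t0 ≤ p0 + D) (h1 : t1 ≤ p1 + D) (h2 : t2 ≤ p2 + D) (b0 : t0 ≤ B)
    (b1 : t1 ≤ B) (b2 : t2 ≤ B) : t0 * t1 * t2 ≤ p0 * p1 * p2 + 3 * D * B ^ 2 := by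
  obtain ⟨d0, rfl⟩ := Nat.exists_eq_add_of_le hp0
  obtain ⟨d1, rfl⟩ := Nat.exists_eq_add_of_le hp1
  obtain ⟨d2, rfl⟩ := Nat.exists_eq_add_of_le hp2
  have e : (p0 + d0) * (p1 + d1) * (p2 + d2) = p0 * p1 * p2 +
      (p0 * p1 * d2 + p0 * d1 * (p2 + d2) + d0 * (p1 + d1) * (p2 + d2)) := by ring
  rw [e]
  have i1 : p0 * p1 * d2 ≤ B * B * D := Nat.mul_le_mul (Nat.mul_le_mul (by omega) (by omega)) (by omega)
  have i2 : p0 * d1 * (p2 + d2) ≤ B * D * B :=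
    Nat.mul_le_mul (Nat.mul_le_mul (by omega) (by omega)) b2
  have i3 : d0 * (p1 + d1) * (p2 + d2) ≤ D * B * B := Nat.mul_le_mul (Nat.mul_le_mul (by omega) b1) b2
  have e2 : B * B * D + B * D * B + D * B * B = 3 * D * B ^ 2 := by ring
  omega

/-- `|S ∆ T| + 2|S ∩ T| = |S| + |T|`. [folklore] -/
private theorem card_symmDiff_add_two_mul_inter (S T : Finset (Site 3)) :
    #(S ∆ T) + 2 * #(S ∩ T) = #S + #T := by
  rw [symmDiff_def, show S \ T ⊔ T \ S = S \ T ∪ T \ S from rfl,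
    card_union_of_disjoint disjoint_sdiff_sdiff]
  have h1 := card_sdiff_add_card_inter S T
  have h2 := card_sdiff_add_card_inter T S
  rw [inter_comm T S] at h2
  omega

/-- `⌊∛0⌋ = 0`. [cite: MaininiPiovanoSchmidtStefanelli2019, §1 eq. (2)] -/
theorem latticeRootFloor_three_zero : latticeRootFloor 3 0 = 0 :=
  latticeRootFloor_three_eq (m := 0) (by norm_num) (by norm_num)

/-- The real-variable step: `(q + 1)·m² ≤ 5·n^{5/6}` for `q² ≤ 14m`, `1 ≤ m`, `m³ ≤ n`.
[cite: MaininiPiovanoSchmidtStefanelli2019, Theorem 1.1 (here with exponent 5/6)] -/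
private theorem weak_real_bound {q m n : ℕ} (hq : q ^ 2 ≤ 14 * m) (hm : 1 ≤ m) (hmn : m ^ 3 ≤ n) :
    (((q + 1) * m ^ 2 : ℕ) : ℝ) ≤ 5 * (n : ℝ) ^ ((5 : ℝ) / 6) := by
  have hm0 : (0 : ℝ) < m := by exact_mod_cast hm
  set r := Real.sqrt (m : ℝ) with hr
  have hr1 : 1 ≤ r := by
    rw [hr, ← Real.sqrt_one]; exact Real.sqrt_le_sqrt (by exact_mod_cast hm)
  have hr2 : r ^ 2 = m := Real.sq_sqrt hm0.le
  -- `q ≤ √14·√m < 4√m`, so `q + 1 ≤ 5√m`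
  have hq' : ((q : ℕ) : ℝ) ^ 2 ≤ 16 * r ^ 2 := by
    rw [hr2]
    have : ((q ^ 2 : ℕ) : ℝ) ≤ ((14 * m : ℕ) : ℝ) := by exact_mod_cast hq
    push_cast at this
    nlinarith
  have hq2 : (q : ℝ) ≤ 4 * r := by
    have h0 : (0 : ℝ) ≤ 4 * r := by positivity
    have := abs_le_of_sq_le_sq' (by nlinarith : ((q : ℕ) : ℝ) ^ 2 ≤ (4 * r) ^ 2) h0
    exact this.2
  have hq3 : (q : ℝ) + 1 ≤ 5 * r := by linarith
  -- `m²·√m = (m³)^{5/6} ≤ n^{5/6}`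
  have hpow : (m : ℝ) ^ 2 * r = (((m ^ 3 : ℕ) : ℝ)) ^ ((5 : ℝ) / 6) := by
    push_cast
    rw [← Real.rpow_natCast (m : ℝ) 3, ← Real.rpow_mul hm0.le,
      show ((3 : ℕ) : ℝ) * ((5 : ℝ) / 6) = 2 + 1 / 2 by norm_num, Real.rpow_add hm0,
      Real.rpow_two, hr, Real.sqrt_eq_rpow]
  have hle : (((m ^ 3 : ℕ) : ℝ)) ^ ((5 : ℝ) / 6) ≤ (n : ℝ) ^ ((5 : ℝ) / 6) :=
    Real.rpow_le_rpow (by positivity) (by exact_mod_cast hmn) (by norm_num)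
  have hm2 : (0 : ℝ) ≤ (m : ℝ) ^ 2 := by positivity
  push_cast
  calc ((q : ℝ) + 1) * (m : ℝ) ^ 2 ≤ 5 * r * (m : ℝ) ^ 2 := by nlinarith
    _ = 5 * ((m : ℝ) ^ 2 * r) := by ring
    _ ≤ 5 * (n : ℝ) ^ ((5 : ℝ) / 6) := by rw [hpow]; linarith

/-- Translating the Wulff cube: `M △ ((v + 1) + W_n)` is the translate by `v` of
`(M − v) △ {1, …, ⌊∛n⌋ + 1}³`. [cite: MaininiPiovanoSchmidtStefanelli2019, §1 eq. (2) (W_n)] -/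
theorem symmDiff_wulffCubeZero_eq_image (M : Finset (Site 3)) (v : Site 3) (n : ℕ) :
    M ∆ ((wulffCubeZero n).image fun w => v + 1 + w) =
      ((M.image fun x => x - v) ∆
        (Fintype.piFinset fun _ : Fin 3 => Icc (1 : ℤ) ((latticeRootFloor 3 n : ℤ) + 1))).image
        fun x => x + v := by
  classical
  rw [image_symmDiff _ _ (add_left_injective v)]
  congr 1
  · rw [image_image]
    have : (fun x : Site 3 => x + v) ∘ (fun x => x - v) = id := by funext x; simp
    rw [this, image_id]
  · ext z
    simp only [wulffCubeZero, mem_image, Fintype.mem_piFinset, mem_Icc]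
    constructor
    · rintro ⟨w, hw, rfl⟩
      refine ⟨w + 1, fun i => ?_, ?_⟩
      · have := hw i
        simp only [Pi.add_apply, Pi.one_apply]
        omega
      · funext i; simp only [Pi.add_apply, Pi.one_apply]; ring
    · rintro ⟨x, hx, rfl⟩
      refine ⟨x - 1, fun i => ?_, ?_⟩
      · have := hx i
        simp only [Pi.sub_apply, Pi.one_apply]
        omega
      · funext i; simp only [Pi.add_apply, Pi.one_apply, Pi.sub_apply]; ring

/-- `#{1,…,T} = T` in `ℤ`. [folklore] -/
private theorem card_Icc_one_natCast (T : ℕ) : #(Icc (1 : ℤ) T) = T := by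
  rw [Int.card_Icc]; omega

/-- **Box counting**: a set `M'` of `n` points inside the box `{1..T₀} × {1..T₁} × {1..T₂}` differs
from the cube `{1, …, μ}³` by at most `(T₀T₁T₂ − n) + (T₀T₁T₂ + μ³ − 2·Π min(Tᵢ, μ))` points.
[cite: MaininiPiovanoSchmidtStefanelli2019, §3 (the count #(Q(M_n) ∖ M_n) + #(Q(M_n) △ (a + W_n)))] -/
theorem card_symmDiff_cube_add_le {M' : Finset (Site 3)} {T0 T1 T2 μ : ℕ}
    (hsub : M' ⊆ Fintype.piFinset ![Icc (1 : ℤ) T0, Icc (1 : ℤ) T1, Icc (1 : ℤ) T2]) :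
    #(M' ∆ Fintype.piFinset fun _ : Fin 3 => Icc (1 : ℤ) μ) + #M' +
        2 * (min T0 μ * min T1 μ * min T2 μ) ≤ 2 * (T0 * T1 * T2) + μ ^ 3 := by
  classical
  set Bx : Finset (Site 3) := Fintype.piFinset ![Icc (1 : ℤ) T0, Icc (1 : ℤ) T1, Icc (1 : ℤ) T2]
    with hBx
  set W₁ : Finset (Site 3) := Fintype.piFinset fun _ : Fin 3 => Icc (1 : ℤ) μ with hW₁
  have hBxcard : #Bx = T0 * T1 * T2 := by
    rw [hBx, Fintype.card_piFinset, Fin.prod_univ_three]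
    simp only [Matrix.cons_val_zero, Matrix.cons_val_one, Matrix.cons_val]
    rw [card_Icc_one_natCast, card_Icc_one_natCast, card_Icc_one_natCast]
  have hWcard : #W₁ = μ ^ 3 := by
    rw [hW₁, Fintype.card_piFinset, Fin.prod_const, card_Icc_one_natCast]
  have hBW : #(Bx ∩ W₁) = min T0 μ * min T1 μ * min T2 μ := by
    have heq : Bx ∩ W₁ = Fintype.piFinset ![Icc (1 : ℤ) ((min T0 μ : ℕ) : ℤ),
        Icc (1 : ℤ) ((min T1 μ : ℕ) : ℤ), Icc (1 : ℤ) ((min T2 μ : ℕ) : ℤ)] := by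
      ext z
      rw [mem_inter, hBx, hW₁, Fintype.mem_piFinset, Fintype.mem_piFinset, Fintype.mem_piFinset,
        Fin.forall_fin_succ, Fin.forall_fin_two, Fin.forall_fin_succ, Fin.forall_fin_two,
        Fin.forall_fin_succ, Fin.forall_fin_two]
      simp only [Matrix.cons_val_zero, Matrix.cons_val_succ, Matrix.cons_val_one, mem_Icc,
        Nat.cast_min]
      omega
    rw [heq, Fintype.card_piFinset, Fin.prod_univ_three]
    simp only [Matrix.cons_val_zero, Matrix.cons_val_one, Matrix.cons_val]
    rw [card_Icc_one_natCast, card_Icc_one_natCast, card_Icc_one_natCast]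
  have hΔsub : M' ∆ W₁ ⊆ (Bx \ M') ∪ (Bx ∆ W₁) := by
    intro z hz
    rw [mem_symmDiff] at hz
    rw [mem_union, Finset.mem_sdiff, mem_symmDiff]
    rcases hz with ⟨hzC, hzW⟩ | ⟨hzW, hzC⟩
    · exact Or.inr (Or.inl ⟨hsub hzC, hzW⟩)
    · by_cases hzB : z ∈ Bx
      · exact Or.inl ⟨hzB, hzC⟩
      · exact Or.inr (Or.inr ⟨hzW, hzB⟩)
  have hΔ1 : #(M' ∆ W₁) ≤ #(Bx \ M') + #(Bx ∆ W₁) :=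
    (card_le_card hΔsub).trans (card_union_le _ _)
  have hΔ2 := card_symmDiff_add_two_mul_inter Bx W₁
  have hΔ3 := card_sdiff_add_card_eq_card hsub
  rw [hBxcard, hWcard, hBW] at hΔ2
  rw [hBxcard] at hΔ3
  omega

/-- The integer arithmetic of the `N^{5/6}` law: sides `Tᵢ ∈ [m − q, m + 1 + q]` force the count of
`card_symmDiff_cube_add_le` (with `μ = m + 1`, `n ≥ m³`) below `2613·(q+1)·m²` (for `q² ≤ 6m+8`,
`m ≥ 1`). [cite: MaininiPiovanoSchmidtStefanelli2019, §3 ((n^{1/3} + K n^{1/12} + O(1))³ − n)] -/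
theorem weak_box_arith {X n m q T0 T1 T2 : ℕ} (hm : 1 ≤ m) (hq : q ^ 2 ≤ 6 * m + 8)
    (hn : m ^ 3 ≤ n) (l0 : m ≤ T0 + q) (u0 : T0 ≤ m + 1 + q) (l1 : m ≤ T1 + q)
    (u1 : T1 ≤ m + 1 + q) (l2 : m ≤ T2 + q) (u2 : T2 ≤ m + 1 + q)
    (hX : X + n + 2 * (min T0 (m + 1) * min T1 (m + 1) * min T2 (m + 1)) ≤
      2 * (T0 * T1 * T2) + (m + 1) ^ 3) :
    X ≤ 2613 * ((q + 1) * m ^ 2) := by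
  set p0 := min T0 (m + 1) with hp0
  set p1 := min T1 (m + 1) with hp1
  set p2 := min T2 (m + 1) with hp2
  set K := 3 * (q + 1) * (m + q + 2) ^ 2 with hK
  have hTTT : T0 * T1 * T2 ≤ p0 * p1 * p2 + K :=
    mul_three_le_of_close (min_le_left _ _) (min_le_left _ _) (min_le_left _ _)
      (by omega) (by omega) (by omega) (by omega) (by omega) (by omega)
  have hmmm : (m + 1) * (m + 1) * (m + 1) ≤ p0 * p1 * p2 + K :=
    mul_three_le_of_close (min_le_right _ _) (min_le_right _ _) (min_le_right _ _)
      (by omega) (by omega) (by omega) (by omega) (by omega) (by omega)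
  have hppp : p0 * p1 * p2 ≤ (m + 1) * (m + 1) * (m + 1) :=
    Nat.mul_le_mul (Nat.mul_le_mul (min_le_right _ _) (min_le_right _ _)) (min_le_right _ _)
  have e1 : (m + 1) ^ 3 = (m + 1) * (m + 1) * (m + 1) := by ring
  have e2 : (m + 1) * (m + 1) * (m + 1) = m ^ 3 + 3 * m ^ 2 + 3 * m + 1 := by ring
  have hX1 : X ≤ 3 * K + 3 * m ^ 2 + 3 * m + 1 := by omega
  have hqq : q ≤ 14 * m := by
    have := Nat.le_mul_self q
    rw [← sq] at this
    omega
  have h1 : (m + q + 2) ^ 2 ≤ (17 * m) ^ 2 := Nat.pow_le_pow_left (by omega) 2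
  have h2 : K ≤ 3 * (q + 1) * (17 * m) ^ 2 := by rw [hK]; exact Nat.mul_le_mul_left _ h1
  have h3 : 3 * m ^ 2 + 3 * m + 1 ≤ 7 * ((q + 1) * m ^ 2) := by nlinarith
  nlinarith

/-- **The `N^{5/6}` law in the cubic lattice (a theorem; the printed exponent is `3/4`)**: every
`EIP³` minimizer `M` with `n` points has a translate of the Wulff cube `W_n = [0, ⌊∛n⌋]³ ∩ ℤ³` with
`#(M △ (a + W_n)) ≤ K·n^{5/6} + K` (`K = 20000`).  This is [MPSS19] Theorem 1.1 with the weaker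
exponent `5/6` that the elementary box estimate `IsEIPMinimizer.box_sides` gives (all sides of the
bounding box within `O(n^{1/6})` of `⌊∛n⌋ + 1`, the box gap-free by
`IsEIPMinimizer.exists_shift_apply`); the printed `n^{3/4}` needs the sides within `O(n^{1/12})`
([MPSS19] eq. (3.2)), which is NOT proved here.
[cite: MaininiPiovanoSchmidtStefanelli2019, Theorem 1.1 (weaker exponent 5/6 in place of 3/4)] -/
theorem MaininiPiovanoSchmidtStefanelli2019_thm11_weak :
    ∃ K : ℝ, 0 < K ∧ ∀ (n : ℕ) (M : Finset (Site 3)), IsEIPMinimizer M → #M = n →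
      ∃ a : Site 3,
        (#(M ∆ ((wulffCubeZero n).image fun w => a + w)) : ℝ) ≤
          K * (n : ℝ) ^ ((5 : ℝ) / 6) + K := by
  classical
  refine ⟨20000, by norm_num, fun n M hM hMn => ?_⟩
  rcases M.eq_empty_or_nonempty with rfl | hne
  · refine ⟨0, ?_⟩
    have hn : n = 0 := by rw [← hMn, card_empty]
    subst hn
    have h1 : #((∅ : Finset (Site 3)) ∆ ((wulffCubeZero 0).image fun w => (0 : Site 3) + w)) ≤ 1 := by
      rw [show (∅ : Finset (Site 3)) = ⊥ from rfl, bot_symmDiff]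
      calc #((wulffCubeZero 0).image fun w => (0 : Site 3) + w) ≤ #(wulffCubeZero 0) := card_image_le
        _ = 1 := by rw [card_wulffCubeZero, latticeRootFloor_three_zero]; norm_num
    have h2 : (#((∅ : Finset (Site 3)) ∆ ((wulffCubeZero 0).image fun w => (0 : Site 3) + w)) : ℝ)
        ≤ 1 := by
      exact_mod_cast h1
    have h3 : (0 : ℝ) ≤ 20000 * ((0 : ℕ) : ℝ) ^ ((5 : ℝ) / 6) := by positivity
    linarith
  -- `n ≥ 1`, `m = ⌊∛n⌋ ≥ 1`
  obtain ⟨hm1, hm2⟩ := latticeRootFloor_three_spec n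
  have hn1 : 1 ≤ n := by rw [← hMn]; exact card_pos.2 hne
  have hm0 : 1 ≤ latticeRootFloor 3 n := by
    by_contra h0
    have : latticeRootFloor 3 n = 0 := by omega
    rw [this] at hm2
    norm_num at hm2
    omega
  have hq1 : Nat.sqrt (6 * latticeRootFloor 3 n + 8) ^ 2 ≤ 6 * latticeRootFloor 3 n + 8 :=
    Nat.sqrt_le' _
  -- the box and the shifts
  obtain ⟨⟨l0, u0⟩, ⟨l1, u1⟩, ⟨l2, u2⟩⟩ := hM.box_sides_all hne
  rw [hMn] at l0 u0 l1 u1 l2 u2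
  obtain ⟨a0, ha0⟩ := hM.exists_shift_apply hne 0
  obtain ⟨a1, ha1⟩ := hM.exists_shift_apply hne 1
  obtain ⟨a2, ha2⟩ := hM.exists_shift_apply hne 2
  let v : Site 3 := ![a0, a1, a2]
  refine ⟨v + 1, ?_⟩
  rw [symmDiff_wulffCubeZero_eq_image M v n, card_image_of_injective _ (add_left_injective v)]
  have hsub : (M.image fun x => x - v) ⊆ Fintype.piFinset ![Icc (1 : ℤ) #(M.image fun x => x 0),
      Icc (1 : ℤ) #(M.image fun x => x 1), Icc (1 : ℤ) #(M.image fun x => x 2)] := by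
    intro z hz
    obtain ⟨x, hxM, rfl⟩ := mem_image.1 hz
    rw [Fintype.mem_piFinset]
    intro i
    fin_cases i
    · simpa [v] using ha0 x hxM
    · simpa [v] using ha1 x hxM
    · simpa [v] using ha2 x hxM
  have hcount := card_symmDiff_cube_add_le (μ := latticeRootFloor 3 n + 1) hsub
  rw [card_image_of_injective _ (sub_left_injective), hMn] at hcount
  have hX := weak_box_arith hm0 hq1 hm1 l0 u0 l1 u1 l2 u2 (by exact_mod_cast hcount)
  have hreal := weak_real_bound (show Nat.sqrt (6 * latticeRootFloor 3 n + 8) ^ 2 ≤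
    14 * latticeRootFloor 3 n by omega) hm0 hm1
  have hpos : (0 : ℝ) ≤ (n : ℝ) ^ ((5 : ℝ) / 6) := by positivity
  have hcast : ((latticeRootFloor 3 n : ℤ) + 1) = ((latticeRootFloor 3 n + 1 : ℕ) : ℤ) := by
    push_cast; ring
  rw [hcast]
  calc (#((M.image fun x => x - v) ∆ Fintype.piFinset fun _ : Fin 3 =>
          Icc (1 : ℤ) ((latticeRootFloor 3 n + 1 : ℕ) : ℤ)) : ℝ)
        ≤ ((2613 * ((Nat.sqrt (6 * latticeRootFloor 3 n + 8) + 1) * latticeRootFloor 3 n ^ 2) : ℕ) : ℝ) := by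
          exact_mod_cast hX
    _ = 2613 * ((((Nat.sqrt (6 * latticeRootFloor 3 n + 8) + 1) *
          latticeRootFloor 3 n ^ 2 : ℕ) : ℝ)) := by push_cast; ring
    _ ≤ 2613 * (5 * (n : ℝ) ^ ((5 : ℝ) / 6)) := by linarith
    _ ≤ 20000 * (n : ℝ) ^ ((5 : ℝ) / 6) + 20000 := by nlinarith

end WeakLaw

/-! ### Reduction of [MPSS19] Theorem 1.1 to the bounding-box claim (3.2) -/

section Reduction

open scoped symmDiff
open Filter Asymptotics

/-- The integer count behind both exponents: a gap-free box with sides `Tᵢ`,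
`|Tᵢ − (m+1)| ≤ D`, holding `n ≥ m³` points, differs from the cube `{1,…,m+1}³` by at most
`6·D·(m+1+D)² + 3m² + 3m + 1` points (input: the count of `card_symmDiff_cube_add_le`).
[cite: MaininiPiovanoSchmidtStefanelli2019, §3 (#(Q(M_n) △ (a+W_n)) ≤ 3K n^{3/4} + o, #(Q(M_n) ∖ M_n) = (ℓ₁+1)(ℓ₂+1)(ℓ₃+1) − n)] -/
theorem box_count_of_sides {X n m D T0 T1 T2 : ℕ} (hn : m ^ 3 ≤ n) (l0 : m + 1 ≤ T0 + D)
    (u0 : T0 ≤ m + 1 + D) (l1 : m + 1 ≤ T1 + D) (u1 : T1 ≤ m + 1 + D) (l2 : m + 1 ≤ T2 + D)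
    (u2 : T2 ≤ m + 1 + D)
    (hX : X + n + 2 * (min T0 (m + 1) * min T1 (m + 1) * min T2 (m + 1)) ≤
      2 * (T0 * T1 * T2) + (m + 1) ^ 3) :
    X ≤ 6 * D * (m + 1 + D) ^ 2 + 3 * m ^ 2 + 3 * m + 1 := by
  set p0 := min T0 (m + 1) with hp0
  set p1 := min T1 (m + 1) with hp1
  set p2 := min T2 (m + 1) with hp2
  set K := 3 * D * (m + 1 + D) ^ 2 with hK
  have hTTT : T0 * T1 * T2 ≤ p0 * p1 * p2 + K :=
    mul_three_le_of_close (min_le_left _ _) (min_le_left _ _) (min_le_left _ _)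
      (by omega) (by omega) (by omega) (by omega) (by omega) (by omega)
  have hmmm : (m + 1) * (m + 1) * (m + 1) ≤ p0 * p1 * p2 + K :=
    mul_three_le_of_close (min_le_right _ _) (min_le_right _ _) (min_le_right _ _)
      (by omega) (by omega) (by omega) (by omega) (by omega) (by omega)
  have hppp : p0 * p1 * p2 ≤ (m + 1) * (m + 1) * (m + 1) :=
    Nat.mul_le_mul (Nat.mul_le_mul (min_le_right _ _) (min_le_right _ _)) (min_le_right _ _)
  have e1 : (m + 1) ^ 3 = (m + 1) * (m + 1) * (m + 1) := by ring
  have e2 : (m + 1) * (m + 1) * (m + 1) = m ^ 3 + 3 * m ^ 2 + 3 * m + 1 := by ring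
  have e3 : 6 * D * (m + 1 + D) ^ 2 = 2 * K := by rw [hK]; ring
  rw [e3]
  omega

/-- The constant `1` is `o(n^{3/4})`. [cite: MaininiPiovanoSchmidtStefanelli2019, Theorem 1.1 (the o(n^{3/4}) remainder)] -/
private theorem isLittleO_one_rpow_three_quarters :
    (fun _ : ℕ => (1 : ℝ)) =o[atTop] fun n : ℕ => (n : ℝ) ^ ((3 : ℝ) / 4) := by
  rw [isLittleO_const_left]
  right
  have h1 : Tendsto (fun n : ℕ => ((n : ℝ)) ^ ((3 : ℝ) / 4)) atTop atTop :=
    (tendsto_rpow_atTop (by norm_num)).comp tendsto_natCast_atTop_atTop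
  refine (tendsto_congr fun n => ?_).2 h1
  simp only [Function.comp, Real.norm_eq_abs]
  exact abs_of_nonneg (by positivity)

/-- The real-variable step of the reduction: with `y = n^{1/12} ≥ 1`, `μ = m + 1 ≤ y⁴ + 1`,
`R ≤ K(y + 1)`, `K ≥ 1`: `6R(μ + R)² + 3μ² ≤ (12K(2+2K)² + 12)·y⁹` and `y⁹ = n^{3/4}`.
[cite: MaininiPiovanoSchmidtStefanelli2019, §3 ((n^{1/3} + K n^{1/12} + O(1))³ − n = 3K n^{3/4} + o(n^{3/4}))] -/
private theorem reduction_real_bound {K R μ : ℝ} {n : ℕ} (hK : 1 ≤ K) (hn : 1 ≤ n) (hR0 : 0 ≤ R)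
    (hR : R ≤ K * ((n : ℝ) ^ ((1 : ℝ) / 12) + 1)) (hμ0 : 0 ≤ μ)
    (hμ : μ ≤ (n : ℝ) ^ ((1 : ℝ) / 3) + 1) :
    6 * R * (μ + R) ^ 2 + 3 * μ ^ 2 ≤ (12 * K * (2 + 2 * K) ^ 2 + 12) * (n : ℝ) ^ ((3 : ℝ) / 4) := by
  have hn0 : (0 : ℝ) < n := by exact_mod_cast hn
  set y := (n : ℝ) ^ ((1 : ℝ) / 12) with hy
  have hy1 : 1 ≤ y := by
    rw [hy]; exact Real.one_le_rpow (by exact_mod_cast hn) (by norm_num)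
  have hy4 : (n : ℝ) ^ ((1 : ℝ) / 3) = y ^ 4 := by
    rw [hy, ← Real.rpow_natCast, ← Real.rpow_mul hn0.le]; norm_num
  have hy9 : (n : ℝ) ^ ((3 : ℝ) / 4) = y ^ 9 := by
    rw [hy, ← Real.rpow_natCast, ← Real.rpow_mul hn0.le]; norm_num
  rw [hy4] at hμ
  rw [hy9]
  have hy0 : 0 ≤ y := by linarith
  have h14 : y ≤ y ^ 4 := by nlinarith [pow_le_pow_right₀ hy1 (show 1 ≤ 4 by norm_num)]
  have hμ' : μ ≤ 2 * y ^ 4 := by nlinarith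
  have hR' : R ≤ 2 * K * y := by nlinarith
  have hsum : μ + R ≤ (2 + 2 * K) * y ^ 4 := by nlinarith
  have hsum0 : 0 ≤ μ + R := by linarith
  have h1 : (μ + R) ^ 2 ≤ ((2 + 2 * K) * y ^ 4) ^ 2 := pow_le_pow_left₀ hsum0 hsum 2
  have h2 : 6 * R * (μ + R) ^ 2 ≤ 6 * (2 * K * y) * ((2 + 2 * K) * y ^ 4) ^ 2 := by
    have := mul_le_mul hR' h1 (by positivity) (by positivity)
    nlinarith
  have h3 : 3 * μ ^ 2 ≤ 12 * y ^ 9 := by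
    have : μ ^ 2 ≤ (2 * y ^ 4) ^ 2 := pow_le_pow_left₀ hμ0 hμ' 2
    have hy89 : y ^ 8 ≤ y ^ 9 := pow_le_pow_right₀ hy1 (by norm_num)
    nlinarith
  have e : 6 * (2 * K * y) * ((2 + 2 * K) * y ^ 4) ^ 2 = 12 * K * (2 + 2 * K) ^ 2 * y ^ 9 := by ring
  nlinarith

/-- **[MPSS19] Theorem 1.1 reduced to its bounding-box claim (3.2).**  If every `EIP³` minimizer
`C` with `n ≥ 1` points has all three sides of its (gap-free) bounding box within
`K(n^{1/12} + 1)` of `⌊∛n⌋ + 1` — the printed estimate (3.2) "`max_i |ℓ_i − ℓ_n| ≤ K n^{1/12} + o(n^{1/12})`",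
Steps 1–5 of §3 — then the vendored fact `MaininiPiovanoSchmidtStefanelli2019_thm11` (the `n^{3/4}`
upper bound) holds, by the counting of this file ("Once this is proved, Theorem 1.1 follows").
The hypothesis is spelled inline (it is not vendored as a fact); `IsEIPMinimizer.box_sides` proves
its `O(n^{1/6})` version unconditionally.
[cite: MaininiPiovanoSchmidtStefanelli2019, §3 eq. (3.2) and the paragraph following it] -/
theorem MaininiPiovanoSchmidtStefanelli2019_thm11_of_box_bound
    (hbox : ∃ K : ℝ, ∀ (C : Finset (Site 3)), IsEIPMinimizer C → C.Nonempty → ∀ s : Fin 3,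
      |(#(C.image fun x => x s) : ℝ) - (latticeRootFloor 3 #C + 1)| ≤
        K * ((#C : ℝ) ^ ((1 : ℝ) / 12) + 1)) :
    MaininiPiovanoSchmidtStefanelli2019_thm11 := by
  classical
  obtain ⟨K₀, hK₀⟩ := hbox
  set K := max K₀ 1 with hKdef
  have hK1 : 1 ≤ K := le_max_right _ _
  have hK : ∀ (C : Finset (Site 3)), IsEIPMinimizer C → C.Nonempty → ∀ s : Fin 3,
      |(#(C.image fun x => x s) : ℝ) - (latticeRootFloor 3 #C + 1)| ≤
        K * ((#C : ℝ) ^ ((1 : ℝ) / 12) + 1) := fun C hC hne s =>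
    (hK₀ C hC hne s).trans (mul_le_mul_of_nonneg_right (le_max_left _ _) (by positivity))
  refine ⟨12 * K * (2 + 2 * K) ^ 2 + 12, by positivity, fun _ => 1,
    isLittleO_one_rpow_three_quarters, fun n M hM hMn => ?_⟩
  rcases M.eq_empty_or_nonempty with rfl | hne
  · refine ⟨0, ?_⟩
    have hn : n = 0 := by rw [← hMn, card_empty]
    subst hn
    have h1 : #((∅ : Finset (Site 3)) ∆ ((wulffCubeZero 0).image fun w => (0 : Site 3) + w)) ≤ 1 := by
      rw [show (∅ : Finset (Site 3)) = ⊥ from rfl, bot_symmDiff]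
      calc #((wulffCubeZero 0).image fun w => (0 : Site 3) + w) ≤ #(wulffCubeZero 0) := card_image_le
        _ = 1 := by rw [card_wulffCubeZero, latticeRootFloor_three_zero]; norm_num
    have h2 : (#((∅ : Finset (Site 3)) ∆ ((wulffCubeZero 0).image fun w => (0 : Site 3) + w)) : ℝ)
        ≤ 1 := by
      exact_mod_cast h1
    have h3 : (0 : ℝ) ≤ (12 * K * (2 + 2 * K) ^ 2 + 12) * ((0 : ℕ) : ℝ) ^ ((3 : ℝ) / 4) := by
      positivity
    linarith
  obtain ⟨hm1, hm2⟩ := latticeRootFloor_three_spec n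
  set m := latticeRootFloor 3 n with hm
  have hn1 : 1 ≤ n := by rw [← hMn]; exact card_pos.2 hne
  -- the integer deviation bound `D`
  set R : ℝ := K * ((n : ℝ) ^ ((1 : ℝ) / 12) + 1) with hR
  have hR0 : 0 ≤ R := by positivity
  set D := ⌊R⌋₊ with hD
  have hDR : (D : ℝ) ≤ R := Nat.floor_le hR0
  have hside : ∀ s : Fin 3, m + 1 ≤ #(M.image fun x => x s) + D ∧ #(M.image fun x => x s) ≤ m + 1 + D := by
    intro s
    have h := hK M hM hne s
    rw [hMn, ← hm] at h
    rw [abs_le] at h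
    obtain ⟨h1, h2⟩ := h
    have hlt := Nat.lt_floor_add_one R
    rw [← hD] at hlt
    constructor
    · by_contra h0
      have h0' : (#(M.image fun x => x s) : ℝ) + D + 1 ≤ (m : ℝ) + 1 := by exact_mod_cast (by omega)
      linarith
    · by_contra h0
      have h0' : (m : ℝ) + 1 + D + 1 ≤ (#(M.image fun x => x s) : ℝ) := by exact_mod_cast (by omega)
      linarith
  obtain ⟨l0, u0⟩ := hside 0
  obtain ⟨l1, u1⟩ := hside 1
  obtain ⟨l2, u2⟩ := hside 2
  -- the shifts and the count
  obtain ⟨a0, ha0⟩ := hM.exists_shift_apply hne 0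
  obtain ⟨a1, ha1⟩ := hM.exists_shift_apply hne 1
  obtain ⟨a2, ha2⟩ := hM.exists_shift_apply hne 2
  let v : Site 3 := ![a0, a1, a2]
  refine ⟨v + 1, ?_⟩
  rw [symmDiff_wulffCubeZero_eq_image M v n, card_image_of_injective _ (add_left_injective v)]
  have hsub : (M.image fun x => x - v) ⊆ Fintype.piFinset ![Icc (1 : ℤ) #(M.image fun x => x 0),
      Icc (1 : ℤ) #(M.image fun x => x 1), Icc (1 : ℤ) #(M.image fun x => x 2)] := by
    intro z hz
    obtain ⟨x, hxM, rfl⟩ := mem_image.1 hz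
    rw [Fintype.mem_piFinset]
    intro i
    fin_cases i
    · simpa [v] using ha0 x hxM
    · simpa [v] using ha1 x hxM
    · simpa [v] using ha2 x hxM
  have hcount := card_symmDiff_cube_add_le (μ := m + 1) hsub
  rw [card_image_of_injective _ (sub_left_injective), hMn] at hcount
  have hX := box_count_of_sides hm1 l0 u0 l1 u1 l2 u2 hcount
  -- real bound
  have hμ : ((m : ℝ) + 1) ≤ (n : ℝ) ^ ((1 : ℝ) / 3) + 1 := by
    have h1 : ((m : ℝ)) ^ (3 : ℕ) ≤ (n : ℝ) := by exact_mod_cast hm1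
    have h2 : (m : ℝ) = (((m : ℝ)) ^ (3 : ℕ)) ^ ((1 : ℝ) / 3) := by
      rw [← Real.rpow_natCast, ← Real.rpow_mul (by positivity)]; norm_num
    have h3 : (((m : ℝ)) ^ (3 : ℕ)) ^ ((1 : ℝ) / 3) ≤ (n : ℝ) ^ ((1 : ℝ) / 3) :=
      Real.rpow_le_rpow (by positivity) h1 (by norm_num)
    linarith
  have hreal := reduction_real_bound (R := (D : ℝ)) (μ := (m : ℝ) + 1) hK1 hn1 (Nat.cast_nonneg D)
    hDR (by positivity) hμ
  have hXr : (#((M.image fun x => x - v) ∆ Fintype.piFinset fun _ : Fin 3 =>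
      Icc (1 : ℤ) ((m + 1 : ℕ) : ℤ)) : ℝ) ≤
      6 * (D : ℝ) * ((m : ℝ) + 1 + D) ^ 2 + 3 * ((m : ℝ) + 1) ^ 2 := by
    have e : ((6 * D * (m + 1 + D) ^ 2 + 3 * m ^ 2 + 3 * m + 1 : ℕ) : ℝ) =
        6 * (D : ℝ) * ((m : ℝ) + 1 + D) ^ 2 + 3 * (m : ℝ) ^ 2 + 3 * m + 1 := by
      push_cast; ring
    have h : (#((M.image fun x => x - v) ∆ Fintype.piFinset fun _ : Fin 3 =>
        Icc (1 : ℤ) ((m + 1 : ℕ) : ℤ)) : ℝ) ≤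
        ((6 * D * (m + 1 + D) ^ 2 + 3 * m ^ 2 + 3 * m + 1 : ℕ) : ℝ) := by
      exact_mod_cast hX
    rw [e] at h
    have hm0 : (0 : ℝ) ≤ m := Nat.cast_nonneg m
    nlinarith
  have hcast : ((latticeRootFloor 3 n : ℤ) + 1) = ((m + 1 : ℕ) : ℤ) := by
    rw [hm]; push_cast; ring
  rw [hcast]
  dsimp only
  have hpos : (0 : ℝ) ≤ (n : ℝ) ^ ((3 : ℝ) / 4) := by positivity
  linarith

end Reduction

/-! ### The slice profile of a minimizer is an optimal profile -/

section ProfileOptimality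

/-- **Every profile is a competitor**: for a nonincreasing profile `f` of `T` positive levels,
`G₃(Σ_k f(k)) ≤ f(0) + Σ_k ⌈2√f(k)⌉` — its daisy stack is a configuration of `Σ f` points with
exactly twice that many boundary pairs. [cite: MaininiSchmidt2020, Proposition 3.2; AgnarssonLauria2013, Observation 3.1] -/
theorem cubicEIP_sum_le_profile {f : ℕ → ℕ} {T : ℕ} (hpos : ∀ k, k < T → 0 < f k)
    (hf : Antitone f) (hT : f T = 0) :
    cubicEIP (∑ k ∈ range T, f k) ≤ f 0 + ∑ k ∈ range T, halfPerim (f k) := by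
  have h1 := two_mul_cubicEIP_le_card_boundaryPairs (daisyStack f T)
  rw [card_daisyStack, card_boundaryPairs_daisyStack hpos hf hT, ← mul_sum] at h1
  omega

variable {C : Finset (Site 3)}

/-- **The slice profile of an `EIP³` minimizer along any axis is an optimal profile**: sorting the
cardinalities of the slices of `C` perpendicular to `e_s` into `f(0) ≥ f(1) ≥ ⋯ ≥ f(T_s − 1) ≥ 1`
(`T_s` = number of occupied values of `x_s`), one has `Σ f = #C`, `f(0) = #π_s(C)` (the largest
slice is the projection) and the PERIMETER IDENTITY `f(0) + Σ_k ⌈2√f(k)⌉ = G₃(#C)` — equality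
throughout [MS20] Proposition 3.2 for minimizers.  With `cubicEIP_sum_le_profile` this says that
no profile with the same number of points does better: the combinatorial input of [MPSS19] §3.
[cite: MaininiSchmidt2020, Proposition 3.2 and Corollary 3.3; MaininiPiovanoSchmidtStefanelli2019, Definition 2.2 (i) and Remark 2.3] -/
theorem IsEIPMinimizer.exists_optimalProfile (hC : IsEIPMinimizer C) (s : Fin 3) :
    ∃ f : ℕ → ℕ, Antitone f ∧ (∀ k, k < #(C.image fun x => x s) → 0 < f k) ∧
      (∀ k, #(C.image fun x => x s) ≤ k → f k = 0) ∧
      ∑ k ∈ range #(C.image fun x => x s), f k = #C ∧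
      f 0 = #(dropCoord s C) ∧
      f 0 + ∑ k ∈ range #(C.image fun x => x s), halfPerim (f k) = cubicEIP #C := by
  classical
  set C' := toFront C s with hC'
  obtain ⟨f, hanti, hpos, hzero, hsumf, hsumg, hmax⟩ := exists_sorted_sliceProfile_max C'
  rw [firstCoords_toFront] at hpos hzero hsumf hsumg hmax
  rw [card_toFront] at hsumf
  set T := #(C.image fun x => x s) with hT
  refine ⟨f, hanti, hpos, hzero, hsumf, ?_⟩
  have hbp : #(boundaryPairs C') = 2 * cubicEIP #C := by
    rw [← card_toFront C s]
    exact (isEIPMinimizer_iff_card_boundaryPairs_eq_three C').1 (hC.isEIPMinimizer_toFront s)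
  have hLB := sum_card_boundaryPairs_sliceAt_add_le (A := C')
  rw [firstCoords_toFront, dropFirst_toFront] at hLB
  have h2d : ∑ t ∈ C.image (fun x => x s), 2 * halfPerim #(sliceAt C' t) ≤
      ∑ t ∈ C.image (fun x => x s), #(boundaryPairs (sliceAt C' t)) :=
    sum_le_sum fun t _ => two_mul_ceil_two_sqrt_le_card_boundaryPairs _
  have hcomp := cubicEIP_sum_le_profile hpos hanti (hzero T le_rfl)
  rw [hsumf] at hcomp
  have hsumg' : ∑ k ∈ range T, 2 * halfPerim (f k) = 2 * ∑ k ∈ range T, halfPerim (f k) := by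
    rw [← mul_sum]
  have hf0 : f 0 ≤ #(dropCoord s C) := by
    rcases Nat.eq_zero_or_pos T with hT0 | hTpos
    · rw [hzero 0 (by omega)]; exact Nat.zero_le _
    · obtain ⟨t, -, ht⟩ := hmax hTpos
      rw [ht, ← dropFirst_toFront]
      exact card_sliceAt_le_card_dropFirst t
  constructor <;> omega

end ProfileOptimality

/-! ### Competitors from multisets of levels; no two slices of a minimizer fit in its projection -/

section Multiset

/-- **Every multiset of levels is a competitor**: for a multiset `μ` of positive level sizes with
maximum `B ∈ μ`, `G₃(Σ μ) ≤ B + Σ_{a ∈ μ} ⌈2√a⌉` (sort the levels decreasingly and stack their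
daisies). [cite: MaininiSchmidt2020, Proposition 3.2 (decreasing rearrangement); AgnarssonLauria2013, Observation 3.1] -/
theorem cubicEIP_multisetSum_le {μ : Multiset ℕ} (hpos : ∀ a ∈ μ, 0 < a) {B : ℕ} (hB : B ∈ μ)
    (hle : ∀ a ∈ μ, a ≤ B) : cubicEIP μ.sum ≤ B + (μ.map halfPerim).sum := by
  classical
  set L : List ℕ := (μ.sort (· ≤ ·)).reverse with hL
  have hLlen : L.length = Multiset.card μ := by
    rw [hL, List.length_reverse, Multiset.length_sort]
  have hLmem : ∀ a, a ∈ L ↔ a ∈ μ := fun a => by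
    rw [hL, List.mem_reverse, Multiset.mem_sort]
  have hLpw : L.Pairwise (· ≥ ·) := by
    rw [hL, List.pairwise_reverse]
    exact Multiset.pairwise_sort _ _
  have hmapsum : ∀ g : ℕ → ℕ, (L.map g).sum = (μ.map g).sum := by
    intro g
    rw [hL, List.map_reverse, List.sum_reverse, ← Multiset.sum_coe, ← Multiset.map_coe,
      Multiset.sort_eq]
  have hgetD : ∀ k, (hk : k < L.length) → L.getD k 0 = L[k] := fun k hk => by
    simp [List.getD_eq_getElem?_getD, List.getElem?_eq_getElem hk]
  have hmemk : ∀ k, k < L.length → L.getD k 0 ∈ L := fun k hk => by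
    rw [hgetD k hk]; exact List.getElem_mem hk
  set f : ℕ → ℕ := fun k => L.getD k 0 with hf
  set T := L.length with hT
  have hanti : Antitone f := by
    intro a b hab
    simp only [hf]
    by_cases hb : b < L.length
    · have ha : a < L.length := lt_of_le_of_lt hab hb
      rw [hgetD b hb, hgetD a ha]
      rcases hab.lt_or_eq with hlt | heq
      · exact List.pairwise_iff_getElem.1 hLpw a b ha hb hlt
      · subst heq; exact le_rfl
    · have : L.getD b 0 = 0 := by
        simp [List.getD_eq_getElem?_getD, Nat.le_of_not_lt hb]
      rw [this]; exact Nat.zero_le _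
  have hfpos : ∀ k, k < T → 0 < f k := fun k hk => hpos _ ((hLmem _).1 (hmemk k hk))
  have hfT : f T = 0 := by simp [hf, hT, List.getD_eq_getElem?_getD]
  have hsumf : ∑ k ∈ range T, f k = μ.sum := by
    have h := sum_map_eq_sum_range_getD' L id
    simp only [List.map_id, id] at h
    rw [hT, ← h, ← List.map_id L, hmapsum, Multiset.map_id]
  have hsumg : ∑ k ∈ range T, halfPerim (f k) = (μ.map halfPerim).sum := by
    rw [hT, ← sum_map_eq_sum_range_getD' L halfPerim, hmapsum]
  have hTpos : 0 < T := by
    rw [hLlen, Multiset.card_pos_iff_exists_mem]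
    exact ⟨B, hB⟩
  have hf0 : f 0 = B := by
    have h0mem : f 0 ∈ μ := (hLmem _).1 (hmemk 0 hTpos)
    refine le_antisymm (hle _ h0mem) ?_
    obtain ⟨k, hk, hkB⟩ := List.getElem_of_mem ((hLmem B).2 hB)
    have : f k = B := by simp only [hf]; rw [hgetD k hk, hkB]
    rw [← this]
    exact hanti (Nat.zero_le k)
  have h := cubicEIP_sum_le_profile hfpos hanti hfT
  rwa [hsumf, hsumg, hf0] at h

/-- **Strict superadditivity in use: no two levels of an optimal profile fit together in its
largest level.**  If a nonincreasing profile `f` of `T ≥ 3` positive levels with `Σ f = n` is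
optimal (`f(0) + Σ ⌈2√f(k)⌉ ≤ G₃(n)`), then its two smallest levels satisfy
`f(T−2) + f(T−1) > f(0)` — otherwise merging them into one level (still below the maximum) saves
at least one unit of half-perimeter (`⌈2√(x+y)⌉ + 1 ≤ ⌈2√x⌉ + ⌈2√y⌉`).
[cite: MaininiPiovanoSchmidtStefanelli2019, Remark 2.3 (minimality is never broken by the rearrangements); MaininiPiovanoStefanelli2014, Theorem 5.1] -/
theorem optimalProfile_lt_add_of_three_le {f : ℕ → ℕ} {T n : ℕ} (hanti : Antitone f)
    (hpos : ∀ k, k < T → 0 < f k) (hsum : ∑ k ∈ range T, f k = n)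
    (hopt : f 0 + ∑ k ∈ range T, halfPerim (f k) ≤ cubicEIP n) (hT : 3 ≤ T) :
    f 0 < f (T - 2) + f (T - 1) := by
  classical
  by_contra hle
  push Not at hle
  obtain ⟨S, rfl⟩ : ∃ S, T = S + 2 := ⟨T - 2, by omega⟩
  have hS1 : 1 ≤ S := by omega
  rw [show S + 2 - 2 = S by omega, show S + 2 - 1 = S + 1 by omega] at hle
  set z := f S + f (S + 1) with hz
  set μ : Multiset ℕ := (range S).val.map f + {z} with hμ
  have hzpos : 0 < z := by have := hpos S (by omega); omega
  have hμpos : ∀ a ∈ μ, 0 < a := by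
    intro a ha
    rw [hμ, Multiset.mem_add, Multiset.mem_map, Multiset.mem_singleton] at ha
    rcases ha with ⟨k, hk, rfl⟩ | rfl
    · exact hpos k (by rw [mem_val, mem_range] at hk; omega)
    · exact hzpos
  have hB : f 0 ∈ μ := by
    rw [hμ, Multiset.mem_add]
    exact Or.inl (Multiset.mem_map.2 ⟨0, by rw [mem_val, mem_range]; omega, rfl⟩)
  have hμle : ∀ a ∈ μ, a ≤ f 0 := by
    intro a ha
    rw [hμ, Multiset.mem_add, Multiset.mem_map, Multiset.mem_singleton] at ha
    rcases ha with ⟨k, -, rfl⟩ | rfl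
    · exact hanti (Nat.zero_le k)
    · exact hle
  have hμsum : μ.sum = n := by
    rw [hμ, Multiset.sum_add, Multiset.sum_singleton, ← hsum, sum_range_succ, sum_range_succ]
    change (Multiset.map f (range S).val).sum + z = _
    rw [← Finset.sum_eq_multiset_sum]
    omega
  have hμg : (μ.map halfPerim).sum = ∑ k ∈ range S, halfPerim (f k) + halfPerim z := by
    rw [hμ, Multiset.map_add, Multiset.sum_add, Multiset.map_singleton, Multiset.sum_singleton,
      Multiset.map_map, Finset.sum_eq_multiset_sum]
    rfl
  have hcomp := cubicEIP_multisetSum_le hμpos hB hμle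
  rw [hμsum, hμg] at hcomp
  have hstrict : halfPerim z + 1 ≤ halfPerim (f S) + halfPerim (f (S + 1)) := by
    rw [hz, halfPerim_def, halfPerim_def, halfPerim_def]
    exact ceil_two_sqrt_add_one_le (hpos S (by omega)) (hpos (S + 1) (by omega))
  rw [sum_range_succ, sum_range_succ] at hopt
  omega

variable {C : Finset (Site 3)}

/-- **No two slices of an `EIP³` minimizer fit together inside its projection**: for distinct
occupied values `t ≠ t'` of the coordinate `x_s`, the two slices `C ∩ {x_s = t}`, `C ∩ {x_s = t'}`
have more than `#π_s(C)` points in total (for two slices other than the largest this is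
`optimalProfile_lt_add_of_three_le`; if one of them is the largest slice — which IS the projection —
it is immediate).  In particular at most one slice has at most half the points of the projection.
[cite: MaininiPiovanoSchmidtStefanelli2019, Remark 2.3; MaininiSchmidt2020, Proposition 3.2] -/
theorem IsEIPMinimizer.card_dropCoord_lt_card_add_card (hC : IsEIPMinimizer C) (s : Fin 3) {t t' : ℤ}
    (ht : t ∈ C.image fun x => x s) (ht' : t' ∈ C.image fun x => x s) (htt' : t ≠ t') :
    #(dropCoord s C) < #(sliceAt (toFront C s) t) + #(sliceAt (toFront C s) t') := by
  classical
  set K := C.image fun x => x s with hK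
  have hfc : firstCoords (toFront C s) = K := firstCoords_toFront C s
  have hne : C.Nonempty := by
    obtain ⟨x, hx, -⟩ := mem_image.1 ht
    exact ⟨x, hx⟩
  have hne' : (toFront C s).Nonempty := by rw [toFront]; exact hne.image _
  by_contra hle
  push Not at hle
  set z := #(sliceAt (toFront C s) t) + #(sliceAt (toFront C s) t') with hz
  set μ : Multiset ℕ :=
    ((K.erase t).erase t').val.map (fun u => #(sliceAt (toFront C s) u)) + {z} with hμ
  have ht'K : t' ∈ K.erase t := mem_erase.2 ⟨htt'.symm, ht'⟩
  have htfc : t ∈ firstCoords (toFront C s) := by rw [hfc]; exact ht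
  have ht'fc : t' ∈ firstCoords (toFront C s) := by rw [hfc]; exact ht'
  have hzpos : 0 < z := by
    have := card_pos.2 (sliceAt_nonempty htfc)
    omega
  have hμpos : ∀ a ∈ μ, 0 < a := by
    intro a ha
    rw [hμ, Multiset.mem_add, Multiset.mem_map, Multiset.mem_singleton] at ha
    rcases ha with ⟨u, hu, rfl⟩ | rfl
    · rw [mem_val] at hu
      have hu' : u ∈ firstCoords (toFront C s) := by
        rw [hfc]; exact mem_of_mem_erase (mem_of_mem_erase hu)
      exact card_pos.2 (sliceAt_nonempty hu')
    · exact hzpos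
  -- the largest slice is the projection; it is one of the slices
  obtain ⟨t₀, ht₀, hmax⟩ := (hC.isEIPMinimizer_toFront s).exists_sliceAt_eq_dropFirst hne'
  rw [hfc] at ht₀
  rw [dropFirst_toFront] at hmax
  have hM : ∀ u, #(sliceAt (toFront C s) u) ≤ #(dropCoord s C) := fun u => by
    rw [← dropFirst_toFront]; exact card_sliceAt_le_card_dropFirst u
  have hMt₀ : #(sliceAt (toFront C s) t₀) = #(dropCoord s C) := by rw [hmax]
  have hB : #(dropCoord s C) ∈ μ := by
    rw [hμ, Multiset.mem_add, Multiset.mem_singleton]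
    by_cases h0 : t₀ = t ∨ t₀ = t'
    · right
      rcases h0 with h0 | h0
      · rw [h0] at hMt₀; have := hM t'; omega
      · rw [h0] at hMt₀; have := hM t; omega
    · left
      push Not at h0
      exact Multiset.mem_map.2 ⟨t₀, by rw [mem_val]; exact mem_erase.2 ⟨h0.2, mem_erase.2 ⟨h0.1, ht₀⟩⟩,
        hMt₀⟩
  have hμle : ∀ a ∈ μ, a ≤ #(dropCoord s C) := by
    intro a ha
    rw [hμ, Multiset.mem_add, Multiset.mem_map, Multiset.mem_singleton] at ha
    rcases ha with ⟨u, -, rfl⟩ | rfl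
    · exact hM u
    · exact hle
  -- sums
  have hsplit : ∀ g : ℤ → ℕ, ∑ u ∈ K, g u = ∑ u ∈ (K.erase t).erase t', g u + g t + g t' := by
    intro g
    rw [← add_sum_erase K g ht, ← add_sum_erase (K.erase t) g ht'K]
    ring
  have hμsum : μ.sum = #C := by
    have h1 : μ.sum = ∑ u ∈ (K.erase t).erase t', #(sliceAt (toFront C s) u) + z := by
      rw [hμ, Multiset.sum_add, Multiset.sum_singleton, Finset.sum_eq_multiset_sum]
    rw [h1, hz, ← card_toFront C s, card_eq_sum_card_sliceAt (A := toFront C s), hfc,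
      hsplit (fun u => #(sliceAt (toFront C s) u))]
    omega
  have hμg : (μ.map halfPerim).sum =
      ∑ u ∈ (K.erase t).erase t', halfPerim #(sliceAt (toFront C s) u) + halfPerim z := by
    rw [hμ, Multiset.map_add, Multiset.sum_add, Multiset.map_singleton, Multiset.sum_singleton,
      Multiset.map_map, Finset.sum_eq_multiset_sum]
    rfl
  have hcomp := cubicEIP_multisetSum_le hμpos hB hμle
  rw [hμsum, hμg] at hcomp
  -- the perimeter identity of `C` along `e_s`
  have hbp : #(boundaryPairs (toFront C s)) = 2 * cubicEIP #C := by
    rw [← card_toFront C s]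
    exact (isEIPMinimizer_iff_card_boundaryPairs_eq_three _).1 (hC.isEIPMinimizer_toFront s)
  have hLB := sum_card_boundaryPairs_sliceAt_add_le (A := toFront C s)
  rw [hfc, dropFirst_toFront] at hLB
  have h2d : ∑ u ∈ K, 2 * halfPerim #(sliceAt (toFront C s) u) ≤
      ∑ u ∈ K, #(boundaryPairs (sliceAt (toFront C s) u)) :=
    sum_le_sum fun u _ => two_mul_ceil_two_sqrt_le_card_boundaryPairs _
  rw [← mul_sum, hsplit (fun u => halfPerim #(sliceAt (toFront C s) u))] at h2d
  have hstrict : halfPerim z + 1 ≤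
      halfPerim #(sliceAt (toFront C s) t) + halfPerim #(sliceAt (toFront C s) t') := by
    rw [hz, halfPerim_def, halfPerim_def, halfPerim_def]
    exact ceil_two_sqrt_add_one_le (card_pos.2 (sliceAt_nonempty htfc))
      (card_pos.2 (sliceAt_nonempty ht'fc))
  omega

end Multiset

/-! ### Greedy consolidation into quasi-squares: the two-level lower bound -/

section Greedy

/-- **Filling quasi-squares greedily is never worse**: if every level has at most `Q = q(s)` points,
then `⌊N/Q⌋·⌈2√Q⌉ + ⌈2√(N mod Q)⌉ ≤ Σ ⌈2√(level)⌉`, `N` the total number of points — by the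
quasi-square exchange inequality and subadditivity, one level at a time (the two-level profile
"`Q, …, Q, remainder`" of [MPSS19]'s quasicubes minimises the planar cost among all ways of
distributing `N` points into levels of size at most `Q`).
[cite: AgnarssonLauria2013, §5 (P(2,·)) and §6; MaininiPiovanoSchmidtStefanelli2019, Definition 2.2 (ii)–(iii) and Remark 2.3] -/
theorem greedy_halfPerim_le_sum (s : ℕ) (l : List ℕ) (hl : ∀ x ∈ l, x ≤ qsq s) :
    l.sum / qsq s * halfPerim (qsq s) + halfPerim (l.sum % qsq s) ≤ (l.map halfPerim).sum := by
  induction l with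
  | nil => simp [halfPerim_zero]
  | cons x l ih =>
    have hx : x ≤ qsq s := hl x (by simp)
    have ih' := ih fun y hy => hl y (by simp [hy])
    rw [List.sum_cons, List.map_cons, List.sum_cons]
    set Q := qsq s with hQ
    set N := l.sum with hN
    rcases Nat.eq_zero_or_pos Q with hQ0 | hQpos
    · -- `Q = 0`: all levels are empty
      have hx0 : x = 0 := by omega
      rw [hQ0, Nat.div_zero, Nat.mod_zero] at ih' ⊢
      rw [hx0, zero_add, halfPerim_zero, zero_add]
      simpa using ih'
    set k := N / Q with hk
    set ρ := N % Q with hρ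
    have hNdef : N = Q * k + ρ := (Nat.div_add_mod N Q).symm
    have hρQ : ρ < Q := Nat.mod_lt _ hQpos
    by_cases hcase : x + ρ < Q
    · have hdiv : (x + N) / Q = k := by
        rw [hNdef, show x + (Q * k + ρ) = (x + ρ) + Q * k by ring, Nat.add_mul_div_left _ _ hQpos,
          Nat.div_eq_of_lt hcase, zero_add]
      have hmod : (x + N) % Q = x + ρ := by
        rw [hNdef, show x + (Q * k + ρ) = (x + ρ) + Q * k by ring, Nat.add_mul_mod_self_left,
          Nat.mod_eq_of_lt hcase]
      rw [hdiv, hmod]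
      have hsub := halfPerim_add_le x ρ
      omega
    · have hge : Q ≤ x + ρ := Nat.le_of_not_lt hcase
      have hlt : x + ρ - Q < Q := by omega
      have hdiv : (x + N) / Q = k + 1 := by
        rw [hNdef, show x + (Q * k + ρ) = (x + ρ - Q) + Q * (k + 1) by
            rw [Nat.mul_succ]; omega,
          Nat.add_mul_div_left _ _ hQpos, Nat.div_eq_of_lt hlt, zero_add]
      have hmod : (x + N) % Q = x + ρ - Q := by
        rw [hNdef, show x + (Q * k + ρ) = (x + ρ - Q) + Q * (k + 1) by
            rw [Nat.mul_succ]; omega,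
          Nat.add_mul_mod_self_left, Nat.mod_eq_of_lt hlt]
      rw [hdiv, hmod, Nat.succ_mul]
      have hex := halfPerim_qsq_add_halfPerim_sub_le hx hρQ.le hge
      rw [← hQ] at hex
      omega

/-- `⌈2√q(⌈2√M⌉)⌉ = ⌈2√M⌉`: the quasi-square with the half-perimeter of `M` has that half-perimeter.
[cite: AlonsoCerf1996, Proposition 2.1] -/
theorem halfPerim_qsq_halfPerim (M : ℕ) : halfPerim (qsq (halfPerim M)) = halfPerim M :=
  le_antisymm (halfPerim_le_iff.2 le_rfl) (halfPerim_mono (le_qsq_halfPerim M))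

variable {C : Finset (Site 3)}

/-- **The two-level lower bound for an `EIP³` minimizer** ([MPSS19] §3 Steps 1–2 in inequality
form): along every axis `s`, with `M = #π_s(C)` (the largest slice), `σ = ⌈2√M⌉` (`= T_j + T_k`, the
sum of the two other sides) and `Q = q(σ)` (the quasi-square of that half-perimeter, `Q ≥ M`), the
quasicube profile "`⌊n/Q⌋` levels of `Q` plus the remainder" costs at most `G₃(n) − M`:
`M + ⌊n/Q⌋·σ + ⌈2√(n mod Q)⌉ ≤ G₃(n)`.  (Every slice has at most `M ≤ Q` points; consolidate the
slice profile greedily and use the perimeter identity `M + Σ ⌈2√(slice)⌉ = G₃(n)`.)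
[cite: MaininiPiovanoSchmidtStefanelli2019, §3 Step 1 (the quasicubic minimizer ℚ(M_n)) and Remark 2.3] -/
theorem IsEIPMinimizer.card_dropCoord_add_twoLevel_le (hC : IsEIPMinimizer C) (s : Fin 3) :
    #(dropCoord s C) +
        #C / qsq (halfPerim #(dropCoord s C)) * halfPerim #(dropCoord s C) +
        halfPerim (#C % qsq (halfPerim #(dropCoord s C))) ≤ cubicEIP #C := by
  classical
  obtain ⟨f, hanti, hpos, hzero, hsumf, hf0, hopt⟩ := hC.exists_optimalProfile s
  set T := #(C.image fun x => x s) with hT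
  set M := #(dropCoord s C) with hM
  set L : List ℕ := (List.range T).map f with hL
  have hLsum : L.sum = #C := by
    rw [hL, ← hsumf, ← List.sum_toFinset _ List.nodup_range, List.toFinset_range]
  have hLmap : (L.map halfPerim).sum = ∑ k ∈ range T, halfPerim (f k) := by
    rw [hL, List.map_map, ← List.sum_toFinset _ List.nodup_range, List.toFinset_range]
    rfl
  have hle : ∀ x ∈ L, x ≤ qsq (halfPerim M) := by
    intro x hx
    rw [hL, List.mem_map] at hx
    obtain ⟨k, -, rfl⟩ := hx
    exact ((hanti (Nat.zero_le k)).trans (hf0.le)).trans (le_qsq_halfPerim M)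
  have hg := greedy_halfPerim_le_sum (halfPerim M) L hle
  rw [hLsum, hLmap, halfPerim_qsq_halfPerim] at hg
  omega

end Greedy

/-! ### Optimal multisets of levels and the exchange steps of the cuboidification -/

section Canonical

/-- An **optimal multiset of levels** with maximum `B`: positive level sizes, `B` the largest, and
the stack of their daisies is an `EIP³` minimizer, i.e. `B + Σ ⌈2√a⌉ ≤ G₃(Σ a)` (the reverse
inequality is `cubicEIP_multisetSum_le`) — the slice sizes of a minimizer along an axis
(`IsEIPMinimizer.isOptimalLevels`), and every intermediate stage of [MPSS19]'s cuboidification.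
[cite: MaininiPiovanoSchmidtStefanelli2019, Definition 2.2 and Remark 2.3] -/
structure IsOptimalLevels (μ : Multiset ℕ) (B : ℕ) : Prop where
  /-- all levels are non-empty -/
  pos : ∀ a ∈ μ, 0 < a
  /-- `B` is a level -/
  mem : B ∈ μ
  /-- `B` is the largest level -/
  le : ∀ a ∈ μ, a ≤ B
  /-- the daisy stack is a minimizer -/
  cost : B + (μ.map halfPerim).sum ≤ cubicEIP μ.sum

variable {C : Finset (Site 3)}

/-- **The slice sizes of an `EIP³` minimizer along any axis form an optimal multiset** with maximum
the projection `#π_s(C)`, `T_s` elements and sum `#C`. [cite: MaininiSchmidt2020, Proposition 3.2; MaininiPiovanoSchmidtStefanelli2019, Definition 2.2 (i)] -/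
theorem IsEIPMinimizer.isOptimalLevels (hC : IsEIPMinimizer C) (hne : C.Nonempty) (s : Fin 3) :
    ∃ μ : Multiset ℕ, IsOptimalLevels μ #(dropCoord s C) ∧
      Multiset.card μ = #(C.image fun x => x s) ∧ μ.sum = #C := by
  classical
  obtain ⟨f, hanti, hpos, hzero, hsumf, hf0, hopt⟩ := hC.exists_optimalProfile s
  set T := #(C.image fun x => x s) with hT
  have hTpos : 0 < T := by
    obtain ⟨x, hx⟩ := hne
    exact card_pos.2 ⟨x s, mem_image_of_mem (fun x : Site 3 => x s) hx⟩
  refine ⟨(range T).val.map f, ⟨?_, ?_, ?_, ?_⟩, by simp, ?_⟩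
  · intro a ha
    obtain ⟨k, hk, rfl⟩ := Multiset.mem_map.1 ha
    exact hpos k (by simpa using hk)
  · exact Multiset.mem_map.2 ⟨0, by simpa using hTpos, hf0⟩
  · intro a ha
    obtain ⟨k, -, rfl⟩ := Multiset.mem_map.1 ha
    rw [← hf0]; exact hanti (Nat.zero_le k)
  · have h1 : ((range T).val.map f).sum = #C := by rw [← hsumf, Finset.sum_eq_multiset_sum]
    have h2 : (((range T).val.map f).map halfPerim).sum = ∑ k ∈ range T, halfPerim (f k) := by
      rw [Multiset.map_map, Finset.sum_eq_multiset_sum]; rfl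
    rw [h1, h2, ← hf0, hopt]
  · rw [← hsumf, Finset.sum_eq_multiset_sum]

namespace IsOptimalLevels

variable {μ : Multiset ℕ} {B : ℕ}

/-- An optimal multiset attains `G₃`: `B + Σ ⌈2√a⌉ = G₃(Σ a)`. [cite: MaininiPiovanoSchmidtStefanelli2019, Remark 2.3] -/
theorem cost_eq (h : IsOptimalLevels μ B) : B + (μ.map halfPerim).sum = cubicEIP μ.sum :=
  le_antisymm h.cost (cubicEIP_multisetSum_le h.pos h.mem h.le)

/-- Splitting off two levels. [cite: MaininiPiovanoSchmidtStefanelli2019, Definition 2.2 (ii)] -/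
private theorem eq_cons_cons {x y : ℕ} (hx : x ∈ μ) (hy : y ∈ μ.erase x) :
    μ = x ::ₘ y ::ₘ (μ.erase x).erase y := by
  rw [Multiset.cons_erase hy, Multiset.cons_erase hx]

/-- **No two levels of an optimal multiset fit together in the largest one**: `x + y > B` for any two
levels (counted with multiplicity) — merging them would save a unit of half-perimeter.
[cite: MaininiPiovanoSchmidtStefanelli2019, Remark 2.3; MaininiPiovanoStefanelli2014, Theorem 5.1] -/
theorem lt_add (h : IsOptimalLevels μ B) {x y : ℕ} (hx : x ∈ μ) (hy : y ∈ μ.erase x) : B < x + y := by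
  classical
  by_contra hle
  push Not at hle
  have hx0 : 0 < x := h.pos x hx
  have hy0 : 0 < y := h.pos y (Multiset.mem_of_mem_erase hy)
  set ρ := (μ.erase x).erase y with hρ
  have hμ : μ = x ::ₘ y ::ₘ ρ := eq_cons_cons hx hy
  set μ' := (x + y) ::ₘ ρ with hμ'
  have hBρ : B ∈ ρ := by
    rw [hρ, Multiset.mem_erase_of_ne (by omega : B ≠ y), Multiset.mem_erase_of_ne (by omega : B ≠ x)]
    exact h.mem
  have hpos' : ∀ a ∈ μ', 0 < a := by
    intro a ha
    rw [hμ', Multiset.mem_cons] at ha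
    rcases ha with rfl | ha
    · omega
    · exact h.pos a (Multiset.mem_of_mem_erase (Multiset.mem_of_mem_erase ha))
  have hle' : ∀ a ∈ μ', a ≤ B := by
    intro a ha
    rw [hμ', Multiset.mem_cons] at ha
    rcases ha with rfl | ha
    · exact hle
    · exact h.le a (Multiset.mem_of_mem_erase (Multiset.mem_of_mem_erase ha))
  have hcomp := cubicEIP_multisetSum_le hpos' (Multiset.mem_cons_of_mem hBρ) hle'
  have hsum : μ'.sum = μ.sum := by
    rw [hμ', hμ, Multiset.sum_cons, Multiset.sum_cons, Multiset.sum_cons]; ring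
  have hmap : (μ'.map halfPerim).sum + 1 ≤ (μ.map halfPerim).sum := by
    rw [hμ', hμ, Multiset.map_cons, Multiset.map_cons, Multiset.map_cons, Multiset.sum_cons,
      Multiset.sum_cons, Multiset.sum_cons]
    have := ceil_two_sqrt_add_one_le hx0 hy0
    rw [← halfPerim_def, ← halfPerim_def, ← halfPerim_def] at this
    omega
  have hcost := h.cost
  rw [hsum] at hcomp
  omega

/-- **The exchange step of the cuboidification keeps optimality**: if `Q = q(σ) ≤ B` and `x ≤ y < Q`
are two levels of an optimal multiset, then replacing them by `Q` and `x + y − Q` (fill a quasi-square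
from the smaller level; `x + y > B ≥ Q` by `lt_add`) gives an optimal multiset with the same maximum,
the same number of levels and the same number of points.
[cite: MaininiPiovanoSchmidtStefanelli2019, Definition 2.2 (ii)–(iii) and Remark 2.3; AgnarssonLauria2013, §5 (P(2,·))] -/
theorem exchange (h : IsOptimalLevels μ B) {σ x y : ℕ} (hQB : qsq σ ≤ B) (hx : x ∈ μ)
    (hy : y ∈ μ.erase x) (hxy : x ≤ y) (hyQ : y < qsq σ) :
    IsOptimalLevels (qsq σ ::ₘ (x + y - qsq σ) ::ₘ (μ.erase x).erase y) B ∧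
      Multiset.card (qsq σ ::ₘ (x + y - qsq σ) ::ₘ (μ.erase x).erase y) = Multiset.card μ ∧
      (qsq σ ::ₘ (x + y - qsq σ) ::ₘ (μ.erase x).erase y).sum = μ.sum := by
  classical
  have hlt := h.lt_add hx hy
  set Q := qsq σ with hQ
  set ρ := (μ.erase x).erase y with hρ
  have hμ : μ = x ::ₘ y ::ₘ ρ := eq_cons_cons hx hy
  have hBρ : B ∈ ρ := by
    rw [hρ, Multiset.mem_erase_of_ne (by omega : B ≠ y), Multiset.mem_erase_of_ne (by omega : B ≠ x)]
    exact h.mem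
  have hsum : (Q ::ₘ (x + y - Q) ::ₘ ρ).sum = μ.sum := by
    rw [hμ, Multiset.sum_cons, Multiset.sum_cons, Multiset.sum_cons, Multiset.sum_cons]; omega
  have hcard : Multiset.card (Q ::ₘ (x + y - Q) ::ₘ ρ) = Multiset.card μ := by
    rw [hμ]; simp
  have hex := halfPerim_qsq_add_halfPerim_sub_le (s := σ) (by omega : x ≤ qsq σ) hyQ.le (by omega)
  rw [← hQ] at hex
  refine ⟨⟨?_, Multiset.mem_cons_of_mem (Multiset.mem_cons_of_mem hBρ), ?_, ?_⟩, hcard, hsum⟩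
  · intro a ha
    rw [Multiset.mem_cons, Multiset.mem_cons] at ha
    rcases ha with rfl | rfl | ha
    · omega
    · omega
    · exact h.pos a (Multiset.mem_of_mem_erase (Multiset.mem_of_mem_erase ha))
  · intro a ha
    rw [Multiset.mem_cons, Multiset.mem_cons] at ha
    rcases ha with rfl | rfl | ha
    · exact hQB
    · have := h.le y (Multiset.mem_of_mem_erase hy); omega
    · exact h.le a (Multiset.mem_of_mem_erase (Multiset.mem_of_mem_erase ha))
  · rw [hsum]
    have hm : (μ.map halfPerim).sum = halfPerim x + (halfPerim y + (ρ.map halfPerim).sum) := by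
      have : (μ.map halfPerim).sum = ((x ::ₘ y ::ₘ ρ).map halfPerim).sum := by rw [← hμ]
      rw [this, Multiset.map_cons, Multiset.map_cons, Multiset.sum_cons, Multiset.sum_cons]
    have hcost := h.cost
    rw [hm] at hcost
    rw [Multiset.map_cons, Multiset.map_cons, Multiset.sum_cons, Multiset.sum_cons]
    omega

/-- **Cuboidification at the level of slice sizes** ([MPSS19] Definition 2.2, Steps (ii)–(iii), and
Step 1 of §3: "we can construct another minimizer … that is quasicubic"): for any quasi-square
`Q = q(σ) ≤ B`, repeated exchange steps turn an optimal multiset into an optimal multiset with the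
same maximum, the same number of levels and of points, in which AT MOST ONE level has fewer than `Q`
points (all other levels lie in `[Q, B]`). [cite: MaininiPiovanoSchmidtStefanelli2019, Definition 2.2 and §3 Step 1] -/
theorem exists_canonical (h : IsOptimalLevels μ B) {σ : ℕ} (hQB : qsq σ ≤ B) :
    ∃ μ' : Multiset ℕ, IsOptimalLevels μ' B ∧ Multiset.card μ' = Multiset.card μ ∧ μ'.sum = μ.sum ∧
      Multiset.card (μ'.filter fun a => a < qsq σ) ≤ 1 := by
  classical
  set Q := qsq σ with hQ
  suffices main : ∀ (k : ℕ) (ν : Multiset ℕ), IsOptimalLevels ν B →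
      Multiset.card (ν.filter fun a => a < Q) = k →
      ∃ μ' : Multiset ℕ, IsOptimalLevels μ' B ∧ Multiset.card μ' = Multiset.card ν ∧
        μ'.sum = ν.sum ∧ Multiset.card (μ'.filter fun a => a < Q) ≤ 1 from main _ μ h rfl
  intro k
  induction k with
  | zero => intro ν hν hk; exact ⟨ν, hν, rfl, rfl, by omega⟩
  | succ k ih =>
    intro ν hν hk
    by_cases hk1 : k = 0
    · exact ⟨ν, hν, rfl, rfl, by omega⟩
    -- the smallest level `x` lies below `Q`
    set F := ν.filter fun a => a < Q with hF
    have hFne : F.toFinset.Nonempty := by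
      rw [Finset.nonempty_iff_ne_empty, Ne, Multiset.toFinset_eq_empty]
      intro h0; rw [h0] at hk; simp at hk
    set x := F.toFinset.min' hFne with hx
    have hxF : x ∈ F := Multiset.mem_toFinset.1 (min'_mem _ hFne)
    have hxmin : ∀ a ∈ F, x ≤ a := fun a ha => min'_le _ _ (Multiset.mem_toFinset.2 ha)
    have hxν : x ∈ ν := (Multiset.mem_filter.1 hxF).1
    have hxQ : x < Q := (Multiset.mem_filter.1 hxF).2
    -- another level `y < Q`
    have hνx : ν = x ::ₘ ν.erase x := (Multiset.cons_erase hxν).symm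
    have hcardF' : Multiset.card ((ν.erase x).filter fun a => a < Q) = k := by
      have : F = x ::ₘ (ν.erase x).filter fun a => a < Q := by
        rw [hF]; conv_lhs => rw [hνx]
        rw [Multiset.filter_cons_of_pos (p := fun a => a < Q) _ hxQ]
      rw [this, Multiset.card_cons] at hk
      omega
    obtain ⟨y, hyF'⟩ : ∃ y, y ∈ (ν.erase x).filter fun a => a < Q :=
      Multiset.card_pos_iff_exists_mem.1 (by omega)
    have hy : y ∈ ν.erase x := (Multiset.mem_filter.1 hyF').1
    have hyQ : y < Q := (Multiset.mem_filter.1 hyF').2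
    have hxy : x ≤ y :=
      hxmin y (Multiset.mem_filter.2 ⟨Multiset.mem_of_mem_erase hy, hyQ⟩)
    -- exchange and recurse
    obtain ⟨h', hcard', hsum'⟩ := hν.exchange hQB hxν hy hxy hyQ
    have hlt := hν.lt_add hxν hy
    have hk' : Multiset.card ((qsq σ ::ₘ (x + y - qsq σ) ::ₘ (ν.erase x).erase y).filter
        fun a => a < Q) = k := by
      have hρ : (ν.erase x).filter (fun a => a < Q) =
          y ::ₘ ((ν.erase x).erase y).filter fun a => a < Q := by
        conv_lhs => rw [← Multiset.cons_erase hy]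
        rw [Multiset.filter_cons_of_pos (p := fun a => a < Q) _ hyQ]
      rw [hρ, Multiset.card_cons] at hcardF'
      rw [← hQ, Multiset.filter_cons_of_neg (p := fun a => a < Q) _ (lt_irrefl Q),
        Multiset.filter_cons_of_pos (p := fun a => a < Q) _ (show x + y - Q < Q by omega),
        Multiset.card_cons]
      omega
    obtain ⟨μ', h1, h2, h3, h4⟩ := ih _ h' hk'
    exact ⟨μ', h1, h2.trans hcard', h3.trans hsum', h4⟩

/-- Counting by an indicator. [cite: MaininiPiovanoSchmidtStefanelli2019, §3 Step 2] -/
private theorem sum_map_ite_eq_card_filter (ν : Multiset ℕ) (p : ℕ → Prop) [DecidablePred p] :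
    (ν.map fun a => if p a then 1 else 0).sum = Multiset.card (ν.filter p) := by
  induction ν using Multiset.induction_on with
  | empty => simp
  | cons a ν ih =>
    rw [Multiset.map_cons, Multiset.sum_cons, ih]
    by_cases ha : p a
    · rw [if_pos ha, Multiset.filter_cons_of_pos _ ha, Multiset.card_cons]; omega
    · rw [if_neg ha, Multiset.filter_cons_of_neg _ ha]; omega

/-- **The quasicube accounting** ([MPSS19] §3 Steps 1–2, output): if an optimal multiset with
maximum `B`, `c` levels and `n` points has all but at most one level in `[Q, B]`, where
`Q = q(σ) ≤ B < q(σ+1)` (`σ ≥ 2`), then with `u` = the number of those levels exceeding `Q` and `d`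
the remaining level: `G₃(n) = B + (c−1)σ + u + ⌈2√d⌉` and
`(c−1)Q + u + d ≤ n ≤ (c−1)Q + u(B − Q) + d`. [cite: MaininiPiovanoSchmidtStefanelli2019, §3 Steps 1–2 (eq. (3.3) and the form (3.6) of the quasicubic minimizer)] -/
theorem exists_quasicube_accounting (h : IsOptimalLevels μ B) {σ : ℕ} (hσ2 : 2 ≤ σ)
    (hQB : qsq σ ≤ B) (hBQ : B < qsq (σ + 1))
    (hcan : Multiset.card (μ.filter fun a => a < qsq σ) ≤ 1) :
    ∃ u d : ℕ, u + 1 ≤ Multiset.card μ ∧ 1 ≤ d ∧ d ≤ B ∧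
      cubicEIP μ.sum = B + (Multiset.card μ - 1) * σ + u + halfPerim d ∧
      (Multiset.card μ - 1) * qsq σ + u + d ≤ μ.sum ∧
      μ.sum ≤ (Multiset.card μ - 1) * qsq σ + u * (B - qsq σ) + d := by
  classical
  set Q := qsq σ with hQ
  -- choose the exceptional level `d` and the rest `ρ`, all of whose levels lie in `[Q, B]`
  obtain ⟨d, hdμ, hrest⟩ : ∃ d ∈ μ, ∀ a ∈ μ.erase d, Q ≤ a := by
    by_cases h0 : ∃ d ∈ μ, d < Q
    · obtain ⟨d, hdμ, hdQ⟩ := h0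
      refine ⟨d, hdμ, fun a ha => ?_⟩
      by_contra haQ
      push Not at haQ
      have h2 : 2 ≤ Multiset.card (μ.filter fun a => a < Q) := by
        have e : μ = d ::ₘ a ::ₘ (μ.erase d).erase a := by
          rw [Multiset.cons_erase ha, Multiset.cons_erase hdμ]
        rw [e, Multiset.filter_cons_of_pos (p := fun a => a < Q) _ hdQ,
          Multiset.filter_cons_of_pos (p := fun a => a < Q) _ haQ, Multiset.card_cons,
          Multiset.card_cons]
        omega
      omega
    · push Not at h0
      exact ⟨B, h.mem, fun a ha => h0 a (Multiset.mem_of_mem_erase ha)⟩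
  set ρ := μ.erase d with hρ
  have hμ : μ = d ::ₘ ρ := (Multiset.cons_erase hdμ).symm
  have hcardρ : Multiset.card ρ = Multiset.card μ - 1 := by
    rw [hρ, Multiset.card_erase_of_mem hdμ]; rfl
  have hρle : ∀ a ∈ ρ, a ≤ B := fun a ha => h.le a (Multiset.mem_of_mem_erase ha)
  set u := Multiset.card (ρ.filter fun a => Q < a) with hu
  -- the planar costs on `ρ`: `σ` for a level `= Q`, `σ + 1` for a level in `(Q, B]`
  have hgρ : ∀ a ∈ ρ, halfPerim a = σ + if Q < a then 1 else 0 := by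
    intro a ha
    by_cases hQa : Q < a
    · rw [if_pos hQa]
      exact halfPerim_eq_of (by omega) ((hρle a ha).trans hBQ.le) (by simpa using hQa)
    · rw [if_neg hQa, add_zero]
      have haQ : a = Q := le_antisymm (Nat.le_of_not_lt hQa) (hrest a ha)
      rw [haQ, hQ]
      refine halfPerim_eq_of (by omega) le_rfl ?_
      obtain ⟨τ, hτ⟩ : ∃ τ, σ = τ + 1 := ⟨σ - 1, by omega⟩
      rw [hτ, Nat.add_sub_cancel, qsq_succ]
      omega
  have hsumg : (ρ.map halfPerim).sum = Multiset.card ρ * σ + u := by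
    rw [Multiset.map_congr rfl hgρ, Multiset.sum_map_add, Multiset.map_const', Multiset.sum_replicate,
      smul_eq_mul, hu, sum_map_ite_eq_card_filter]
  -- volume bounds on `ρ`
  have hlow : (ρ.map fun a => Q + if Q < a then 1 else 0).sum ≤ (ρ.map id).sum :=
    Multiset.sum_map_le_sum_map _ _ fun a ha => by
      by_cases hQa : Q < a
      · rw [if_pos hQa]; exact hQa
      · rw [if_neg hQa]; exact hrest a ha
  have hup : (ρ.map id).sum ≤ (ρ.map fun a => Q + if Q < a then B - Q else 0).sum :=
    Multiset.sum_map_le_sum_map _ _ fun a ha => by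
      by_cases hQa : Q < a
      · rw [if_pos hQa]; have := hρle a ha; simp only [id]; omega
      · rw [if_neg hQa]; simp only [id]; exact Nat.le_of_not_lt hQa
  rw [Multiset.map_id] at hlow hup
  rw [Multiset.sum_map_add, Multiset.map_const', Multiset.sum_replicate, smul_eq_mul,
    sum_map_ite_eq_card_filter, ← hu] at hlow
  have hite : (ρ.map fun a => if Q < a then B - Q else 0) = (ρ.map fun a => if Q < a then 1 else 0).map
      fun i => i * (B - Q) := by
    rw [Multiset.map_map]
    refine Multiset.map_congr rfl fun a _ => ?_
    by_cases hQa : Q < a <;> simp [hQa]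
  rw [Multiset.sum_map_add, Multiset.map_const', Multiset.sum_replicate, smul_eq_mul, hite,
    Multiset.sum_map_mul_right, Multiset.map_id', sum_map_ite_eq_card_filter, ← hu] at hup
  -- assemble
  have hd0 : 1 ≤ d := h.pos d hdμ
  have hdB : d ≤ B := h.le d hdμ
  have hcost := h.cost_eq
  have hsum : μ.sum = d + ρ.sum := by rw [hμ, Multiset.sum_cons]
  have hmap : (μ.map halfPerim).sum = halfPerim d + (ρ.map halfPerim).sum := by
    rw [hμ, Multiset.map_cons, Multiset.sum_cons]
  have hcardμ : Multiset.card μ = Multiset.card ρ + 1 := by rw [hμ, Multiset.card_cons]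
  have huρ : u ≤ Multiset.card ρ := by rw [hu]; exact Multiset.card_le_card (Multiset.filter_le _ _)
  refine ⟨u, d, by omega, hd0, hdB, ?_, ?_, ?_⟩
  · rw [← hcost, hmap, hsumg, hcardρ]; ring
  · rw [hsum, ← hcardρ]; omega
  · rw [hsum, ← hcardρ]; omega

end IsOptimalLevels

/-- **[MPSS19] §3 Steps 1–2 for an arbitrary `EIP³` minimizer, as arithmetic**: along every axis `s`
(`T_s ≥ 1` levels, projection `M = #π_s(C)`, `Q = q(σ) ≤ M < q(σ+1)`, `σ ≥ 2`) there are `u < T_s`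
and `1 ≤ d ≤ M` with `G₃(n) = M + (T_s − 1)σ + u + ⌈2√d⌉` and
`(T_s−1)Q + u + d ≤ n ≤ (T_s−1)Q + u(M − Q) + d` — the bond count and the cardinality of the
quasicubic minimizer `ℚ(M_n) = (ℤ³ ∩ Q(ℓ+1, ℓ'+1, ℓ₃)) ∪ F¹ ∪ F²` with the same number of levels.
What remains for eq. (3.2) is the arithmetic Step 3 (comparison with the cube-like competitor).
[cite: MaininiPiovanoSchmidtStefanelli2019, §3 Steps 1–2 and Definition 2.4 (quasicubes)] -/
theorem IsEIPMinimizer.exists_quasicube_accounting (hC : IsEIPMinimizer C) (hne : C.Nonempty)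
    (s : Fin 3) {σ : ℕ} (hσ2 : 2 ≤ σ) (hQM : qsq σ ≤ #(dropCoord s C))
    (hMQ : #(dropCoord s C) < qsq (σ + 1)) :
    ∃ u d : ℕ, u + 1 ≤ #(C.image fun x => x s) ∧ 1 ≤ d ∧ d ≤ #(dropCoord s C) ∧
      cubicEIP #C = #(dropCoord s C) + (#(C.image fun x => x s) - 1) * σ + u + halfPerim d ∧
      (#(C.image fun x => x s) - 1) * qsq σ + u + d ≤ #C ∧
      #C ≤ (#(C.image fun x => x s) - 1) * qsq σ + u * (#(dropCoord s C) - qsq σ) + d := by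
  obtain ⟨μ, hμ, hcard, hsum⟩ := hC.isOptimalLevels hne s
  obtain ⟨μ', hμ', hcard', hsum', hcan⟩ := hμ.exists_canonical hQM
  obtain ⟨u, d, h1, h2, h3, h4, h5, h6⟩ := hμ'.exists_quasicube_accounting hσ2 hQM hMQ hcan
  rw [hcard', hcard] at h1 h4 h5 h6
  rw [hsum', hsum] at h4 h5 h6
  exact ⟨u, d, h1, h2, h3, h4, h5, h6⟩

end Canonical

/-! ### Reduction of [MPSS19] Theorem 1.1 to the quasicube arithmetic of §3 Step 3 -/

section QuasicubeReduction

variable {C : Finset (Site 3)}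

/-- The quasi-square scale of `M ≥ 1`: a `σ ≥ 2` with `q(σ) ≤ M < q(σ+1)`.
[cite: AlonsoCerf1996, §2 (quasisquares); MaininiPiovanoSchmidtStefanelli2019, Definition 2.4] -/
theorem exists_qsq_le_lt (M : ℕ) (hM : 1 ≤ M) :
    ∃ σ : ℕ, 2 ≤ σ ∧ σ ≤ halfPerim M ∧ qsq σ ≤ M ∧ M < qsq (σ + 1) := by
  have hg2 : 2 ≤ halfPerim M := by
    rw [← halfPerim_one]; exact halfPerim_mono hM
  by_cases h : qsq (halfPerim M) = M
  · refine ⟨halfPerim M, hg2, le_rfl, h.le, ?_⟩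
    rw [qsq_succ]; omega
  · have hlt : M < qsq (halfPerim M) := lt_of_le_of_ne (le_qsq_halfPerim M) (Ne.symm h)
    obtain ⟨τ, hτ⟩ : ∃ τ, halfPerim M = τ + 1 := ⟨halfPerim M - 1, by omega⟩
    have hτM : qsq τ < M := qsq_lt_of_lt_halfPerim (by omega)
    refine ⟨τ, ?_, by omega, hτM.le, by rwa [← hτ]⟩
    by_contra hτ2
    have hτ1 : τ ≤ 1 := by omega
    have : qsq (τ + 1) ≤ qsq 2 := qsq_mono (by omega)
    rw [← hτ] at this
    rw [qsq_two_mul 1] at this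
    omega

/-- `T₀ + T₁ + T₂ ≤ 3⌊∛n⌋ + 4` for the three sides of a non-empty `EIP³` minimizer.
[cite: MaininiPiovanoSchmidtStefanelli2019, §3 eq. (3.2)] -/
theorem IsEIPMinimizer.sum_sides_le (hC : IsEIPMinimizer C) (hne : C.Nonempty) :
    #(C.image fun x => x 0) + #(C.image fun x => x 1) + #(C.image fun x => x 2) ≤
      3 * latticeRootFloor 3 #C + 4 := by
  classical
  set m := latticeRootFloor 3 #C with hm
  set T0 := #(C.image fun x => x 0) with hT0
  set T1 := #(C.image fun x => x 1) with hT1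
  set T2 := #(C.image fun x => x 2) with hT2
  have hs0 : T1 + T2 = halfPerim #(dropCoord 0 C) := by
    have h := hC.card_image_add_card_image_eq_halfPerim 0
    simpa only [succAbove_zero_zero, succAbove_zero_one] using h
  have hs1 : T0 + T2 = halfPerim #(dropCoord 1 C) := by
    have h := hC.card_image_add_card_image_eq_halfPerim 1
    simpa only [succAbove_one_zero, succAbove_one_one] using h
  have hs2 : T0 + T1 = halfPerim #(dropCoord 2 C) := by
    have h := hC.card_image_add_card_image_eq_halfPerim 2
    simpa only [succAbove_two_zero, succAbove_two_one] using h
  have hsum : #(dropCoord 0 C) + #(dropCoord 1 C) + #(dropCoord 2 C) = cubicEIP #C := by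
    have h := hC.sum_card_dropCoord_eq_cubicEIP
    rwa [Fin.sum_univ_three] at h
  have hG := cubicEIP_le_three_mul_sq #C
  rw [← hm] at hG
  obtain ⟨x, hx⟩ := hne
  have hT0p : 1 ≤ T0 := card_pos.2 ⟨_, mem_image_of_mem (fun x : Site 3 => x 0) hx⟩
  have hT1p : 1 ≤ T1 := card_pos.2 ⟨_, mem_image_of_mem (fun x : Site 3 => x 1) hx⟩
  have hT2p : 1 ≤ T2 := card_pos.2 ⟨_, mem_image_of_mem (fun x : Site 3 => x 2) hx⟩
  have key : ∀ {M u v : ℕ}, u + v = halfPerim M → 1 ≤ u + v → (u + v - 1) ^ 2 + 3 ≤ 4 * M := by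
    intro M u v h huv
    have hlt : qsq (u + v - 1) < M := qsq_lt_of_lt_halfPerim (by rw [← h]; omega)
    have hq' := sq_le_four_mul_qsq_add_one (u + v - 1)
    omega
  have k0 := key hs0 (by omega)
  have k1 := key hs1 (by omega)
  have k2 := key hs2 (by omega)
  obtain ⟨a0, ha0⟩ : ∃ a, T1 + T2 = a + 1 := ⟨T1 + T2 - 1, by omega⟩
  obtain ⟨a1, ha1⟩ : ∃ a, T0 + T2 = a + 1 := ⟨T0 + T2 - 1, by omega⟩
  obtain ⟨a2, ha2⟩ : ∃ a, T0 + T1 = a + 1 := ⟨T0 + T1 - 1, by omega⟩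
  rw [ha0, Nat.add_sub_cancel] at k0
  rw [ha1, Nat.add_sub_cancel] at k1
  rw [ha2, Nat.add_sub_cancel] at k2
  have h3 : a0 ^ 2 + a1 ^ 2 + a2 ^ 2 + 9 ≤ 12 * (m + 1) ^ 2 := by omega
  have h4 : (a0 + a1 + a2) ^ 2 ≤ 3 * (a0 ^ 2 + a1 ^ 2 + a2 ^ 2) := by
    nlinarith [sq_nonneg ((a0 : ℤ) - a1), sq_nonneg ((a1 : ℤ) - a2), sq_nonneg ((a0 : ℤ) - a2)]
  have h5 : (a0 + a1 + a2) ^ 2 < (6 * (m + 1)) ^ 2 := by nlinarith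
  have h6 : a0 + a1 + a2 < 6 * (m + 1) := lt_of_pow_lt_pow_left₀ 2 (Nat.zero_le _) h5
  omega

/-- **Per-axis consequence of the quasicube arithmetic**: if Step 3 of [MPSS19] §3 holds as the
arithmetic statement "`(c − 1 − ⌊σ/2⌋)⁴ ≤ K(σ + 1)` under the quasicube accounting", then every side
of a non-empty minimizer exceeds the mean of the two other sides by at most `1 + D` with
`D⁴ ≤ K·(T_j + T_k + 1)`. [cite: MaininiPiovanoSchmidtStefanelli2019, §3 Step 3 (ℓ₃ − ℓ = √6 α^{1/4} ℓ^{1/4} + o(ℓ^{1/4}))] -/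
theorem IsEIPMinimizer.side_sub_half_pow_four_le (hC : IsEIPMinimizer C) (hne : C.Nonempty) {K : ℕ}
    (hK : ∀ n c M σ u d : ℕ, 2 ≤ σ → qsq σ ≤ M → M < qsq (σ + 1) → u + 1 ≤ c → 1 ≤ d → d ≤ M →
      cubicEIP n = M + (c - 1) * σ + u + halfPerim d →
      (c - 1) * qsq σ + u + d ≤ n → n ≤ (c - 1) * qsq σ + u * (M - qsq σ) + d →
      (c - 1 - σ / 2) ^ 4 ≤ K * (σ + 1))
    (s : Fin 3) :
    (#(C.image fun x => x s) - 1 -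
        (#(C.image fun x => x (s.succAbove 0)) + #(C.image fun x => x (s.succAbove 1))) / 2) ^ 4 ≤
      K * (#(C.image fun x => x (s.succAbove 0)) + #(C.image fun x => x (s.succAbove 1)) + 1) := by
  classical
  set M := #(dropCoord s C) with hM
  have hM1 : 1 ≤ M := by
    obtain ⟨x, hx⟩ := hne
    exact card_pos.2 ⟨_, mem_image_of_mem _ hx⟩
  obtain ⟨σ, hσ2, hσg, hQM, hMQ⟩ := exists_qsq_le_lt M hM1
  obtain ⟨u, d, h1, h2, h3, h4, h5, h6⟩ := hC.exists_quasicube_accounting hne s hσ2 hQM hMQ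
  have hbound := hK _ _ _ _ _ _ hσ2 hQM hMQ h1 h2 h3 h4 h5 h6
  have hshadow := hC.card_image_add_card_image_eq_halfPerim s
  rw [← hM] at hshadow
  set g := #(C.image fun x => x (s.succAbove 0)) + #(C.image fun x => x (s.succAbove 1)) with hg
  have hσg' : σ / 2 ≤ g / 2 := Nat.div_le_div_right (hshadow ▸ hσg)
  calc (#(C.image fun x => x s) - 1 - g / 2) ^ 4 ≤ (#(C.image fun x => x s) - 1 - σ / 2) ^ 4 :=
        Nat.pow_le_pow_left (by omega) 4
    _ ≤ K * (σ + 1) := hbound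
    _ ≤ K * (g + 1) := Nat.mul_le_mul_left K (by rw [hg]; omega)
set_option maxHeartbeats 400000 in
/-- The integer box bound from the quasicube arithmetic: all three sides of a non-empty minimizer
satisfy `|T_s − (m + 1)| ≤ 2D + 4` for some `D` with `D⁴ ≤ K(3m + 5)`, `m = ⌊∛n⌋`.
[cite: MaininiPiovanoSchmidtStefanelli2019, §3 Steps 3–5 (eq. (3.2) from (3.13) and Step 5)] -/
theorem IsEIPMinimizer.exists_box_dev_of_quasicube (hC : IsEIPMinimizer C) (hne : C.Nonempty) {K : ℕ}
    (hK : ∀ n c M σ u d : ℕ, 2 ≤ σ → qsq σ ≤ M → M < qsq (σ + 1) → u + 1 ≤ c → 1 ≤ d → d ≤ M →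
      cubicEIP n = M + (c - 1) * σ + u + halfPerim d →
      (c - 1) * qsq σ + u + d ≤ n → n ≤ (c - 1) * qsq σ + u * (M - qsq σ) + d →
      (c - 1 - σ / 2) ^ 4 ≤ K * (σ + 1)) :
    ∃ D : ℕ, D ^ 4 ≤ K * (3 * latticeRootFloor 3 #C + 5) ∧ ∀ s : Fin 3,
      latticeRootFloor 3 #C + 1 ≤ #(C.image fun x => x s) + (2 * D + 4) ∧
        #(C.image fun x => x s) ≤ latticeRootFloor 3 #C + 1 + (2 * D + 4) := by
  classical
  obtain ⟨hm1, hm2⟩ := latticeRootFloor_three_spec #C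
  set m := latticeRootFloor 3 #C with hm
  set T0 := #(C.image fun x => x 0) with hT0
  set T1 := #(C.image fun x => x 1) with hT1
  set T2 := #(C.image fun x => x 2) with hT2
  have hsumT := hC.sum_sides_le hne
  rw [← hm, ← hT0, ← hT1, ← hT2] at hsumT
  have hvol : #C ≤ T0 * T1 * T2 := by
    have h := card_le_prod_card_image_apply C
    rwa [Fin.prod_univ_three] at h
  have e0 := hC.side_sub_half_pow_four_le hne hK 0
  have e1 := hC.side_sub_half_pow_four_le hne hK 1
  have e2 := hC.side_sub_half_pow_four_le hne hK 2
  simp only [succAbove_zero_zero, succAbove_zero_one, succAbove_one_zero, succAbove_one_one,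
    succAbove_two_zero, succAbove_two_one] at e0 e1 e2
  rw [← hT0, ← hT1, ← hT2] at e0 e1 e2
  -- `D` := the largest of the three deviations
  set D0 := T0 - 1 - (T1 + T2) / 2 with hD0
  set D1 := T1 - 1 - (T0 + T2) / 2 with hD1
  set D2 := T2 - 1 - (T0 + T1) / 2 with hD2
  set D := max D0 (max D1 D2) with hD
  have hD0le : D0 ≤ D := le_max_left _ _
  have hD1le : D1 ≤ D := (le_max_left _ _).trans (le_max_right _ _)
  have hD2le : D2 ≤ D := (le_max_right _ _).trans (le_max_right _ _)
  have hD4 : D ^ 4 ≤ K * (3 * m + 5) := by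
    have b0 : D0 ^ 4 ≤ K * (3 * m + 5) := e0.trans (Nat.mul_le_mul_left K (by omega))
    have b1 : D1 ^ 4 ≤ K * (3 * m + 5) := e1.trans (Nat.mul_le_mul_left K (by omega))
    have b2 : D2 ^ 4 ≤ K * (3 * m + 5) := e2.trans (Nat.mul_le_mul_left K (by omega))
    rw [hD]
    rcases max_choice D0 (max D1 D2) with h | h
    · rw [h]; exact b0
    · rw [h]
      rcases max_choice D1 D2 with h' | h'
      · rw [h']; exact b1
      · rw [h']; exact b2
  refine ⟨D, hD4, ?_⟩
  -- upper bounds `T_s ≤ m + 2 + D`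
  have u0 : T0 ≤ m + 2 + D := by omega
  have u1 : T1 ≤ m + 2 + D := by omega
  have u2 : T2 ≤ m + 2 + D := by omega
  -- lower bounds from the volume
  have lower : ∀ {t p r : ℕ}, m ^ 3 ≤ t * p * r → p ≤ m + 2 + D → r ≤ m + 2 + D → m ≤ t + 2 * D + 3 := by
    intro t p r hv hp hr
    by_contra hlt
    push Not at hlt
    have ht : t + 2 * D + 4 ≤ m := by omega
    have h1 : t * p * r ≤ t * (m + 2 + D) * (m + 2 + D) :=
      Nat.mul_le_mul (Nat.mul_le_mul le_rfl hp) hr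
    have h2 : (t + 2 * (D + 2)) * (m + 2 + D) ^ 2 ≤ m * (m + 2 + D) ^ 2 :=
      Nat.mul_le_mul_right _ (by omega)
    -- `(m − 2e)(m + e)² < m³` with `e = D + 2`
    have h3 : t * (m + 2 + D) * (m + 2 + D) + (3 * (D + 2) ^ 2 * m + 2 * (D + 2) ^ 3) ≤
        m ^ 3 := by
      have e : (t + 2 * (D + 2)) * (m + 2 + D) ^ 2 =
          t * (m + 2 + D) * (m + 2 + D) + 2 * (D + 2) * (m + 2 + D) ^ 2 := by ring
      have e' : m * (m + 2 + D) ^ 2 + (3 * (D + 2) ^ 2 * m + 2 * (D + 2) ^ 3) =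
          m ^ 3 + 2 * (D + 2) * (m + 2 + D) ^ 2 := by ring
      nlinarith
    have h4 : 1 ≤ 2 * (D + 2) ^ 3 := by nlinarith
    omega
  have hv' : m ^ 3 ≤ T0 * T1 * T2 := hm1.trans hvol
  have l0 := lower (t := T0) (p := T1) (r := T2) hv' u1 u2
  have l1 := lower (t := T1) (p := T0) (r := T2) (by
    calc m ^ 3 ≤ T0 * T1 * T2 := hv'
      _ = T1 * T0 * T2 := by ring) u0 u2
  have l2 := lower (t := T2) (p := T0) (r := T1) (by
    calc m ^ 3 ≤ T0 * T1 * T2 := hv'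
      _ = T2 * T0 * T1 := by ring) u0 u1
  intro s
  fin_cases s
  · exact ⟨by show m + 1 ≤ T0 + (2 * D + 4); omega, by show T0 ≤ m + 1 + (2 * D + 4); omega⟩
  · exact ⟨by show m + 1 ≤ T1 + (2 * D + 4); omega, by show T1 ≤ m + 1 + (2 * D + 4); omega⟩
  · exact ⟨by show m + 1 ≤ T2 + (2 * D + 4); omega, by show T2 ≤ m + 1 + (2 * D + 4); omega⟩

/-- The real-variable step: `D⁴ ≤ K(3m + 5)`, `m³ ≤ n`, `K ≥ 1` give `2D + 4 ≤ 16K(n^{1/12} + 1)`.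
[cite: MaininiPiovanoSchmidtStefanelli2019, §3 Step 5 (eq. (3.2) from (3.13) with ℓ = n^{1/3} + o(n^{1/3}))] -/
private theorem dev_real_bound {D m n K : ℕ} (hK : 1 ≤ K) (hD : D ^ 4 ≤ K * (3 * m + 5))
    (hmn : m ^ 3 ≤ n) : ((2 * D + 4 : ℕ) : ℝ) ≤ 16 * K * ((n : ℝ) ^ ((1 : ℝ) / 12) + 1) := by
  have hK' : (1 : ℝ) ≤ K := by exact_mod_cast hK
  have hn0 : (0 : ℝ) ≤ (n : ℝ) ^ ((1 : ℝ) / 12) := by positivity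
  rcases Nat.eq_zero_or_pos m with hm0 | hmpos
  · -- `m = 0`: `D⁴ ≤ 5K`, so `D ≤ 5K`
    subst hm0
    have hD1 : D ≤ 5 * K := by
      rcases Nat.eq_zero_or_pos D with h0 | hDpos
      · omega
      · have : D ≤ D ^ 4 := Nat.le_self_pow (by norm_num) D
        omega
    have : ((2 * D + 4 : ℕ) : ℝ) ≤ 10 * K + 4 := by
      have h := (Nat.cast_le (α := ℝ)).2 hD1; push_cast at h ⊢; linarith
    nlinarith
  · -- `m ≥ 1`: `D⁴ ≤ (2K)⁴ m`, so `D ≤ 2K m^{1/4} ≤ 2K n^{1/12}`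
    have h1 : D ^ 4 ≤ (2 * K) ^ 4 * m := by
      have : K * (3 * m + 5) ≤ 8 * K * m := by nlinarith
      have hK4 : 8 * K ≤ (2 * K) ^ 4 := by
        have : K ≤ K ^ 4 := Nat.le_self_pow (by norm_num) K
        nlinarith
      calc D ^ 4 ≤ K * (3 * m + 5) := hD
        _ ≤ 8 * K * m := this
        _ ≤ (2 * K) ^ 4 * m := Nat.mul_le_mul_right m hK4
    have hm0 : (0 : ℝ) ≤ m := Nat.cast_nonneg m
    have h2 : ((D : ℝ)) ^ (4 : ℕ) ≤ ((2 * K : ℕ) : ℝ) ^ (4 : ℕ) * (m : ℝ) := by exact_mod_cast h1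
    have h3 : (D : ℝ) ≤ 2 * (K : ℝ) * (m : ℝ) ^ ((1 : ℝ) / 4) := by
      have h := Real.rpow_le_rpow (by positivity) h2 (by norm_num : (0 : ℝ) ≤ 1 / 4)
      rw [← Real.rpow_natCast (D : ℝ) 4, ← Real.rpow_mul (by positivity),
        Real.mul_rpow (by positivity) hm0, ← Real.rpow_natCast _ 4,
        ← Real.rpow_mul (by positivity)] at h
      norm_num at h
      exact_mod_cast h
    have h4 : (m : ℝ) ^ ((1 : ℝ) / 4) ≤ (n : ℝ) ^ ((1 : ℝ) / 12) := by
      have hm3 : ((m : ℝ)) ^ (3 : ℕ) ≤ (n : ℝ) := by exact_mod_cast hmn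
      have e : (m : ℝ) ^ ((1 : ℝ) / 4) = (((m : ℝ)) ^ (3 : ℕ)) ^ ((1 : ℝ) / 12) := by
        rw [← Real.rpow_natCast _ 3, ← Real.rpow_mul hm0]; norm_num
      rw [e]
      exact Real.rpow_le_rpow (by positivity) hm3 (by norm_num)
    have h5 : (D : ℝ) ≤ 2 * K * (n : ℝ) ^ ((1 : ℝ) / 12) := by
      have hK0 : (0 : ℝ) ≤ 2 * K := by positivity
      nlinarith [mul_le_mul_of_nonneg_left h4 hK0]
    push_cast
    nlinarith

/-- **[MPSS19] Theorem 1.1 reduced to the arithmetic of its Step 3.**  If the quasicube accounting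
(the output of `IsEIPMinimizer.exists_quasicube_accounting`, i.e. of the cuboidification) forces
the height excess `c − 1 − ⌊σ/2⌋` of a quasicube with cross-section half-perimeter `σ` to be
`O(σ^{1/4})` — the content of Step 3 of §3 (`ℓ₃ − ℓ = √6 α^{1/4} ℓ^{1/4} + o(ℓ^{1/4})`), here in the form
`(c − 1 − ⌊σ/2⌋)⁴ ≤ K(σ + 1)` — then the vendored fact `MaininiPiovanoSchmidtStefanelli2019_thm11`
holds.  This leaves a statement about `cubicEIP`, `qsq` and `halfPerim` only.
[cite: MaininiPiovanoSchmidtStefanelli2019, §3 Steps 3–5] -/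
theorem MaininiPiovanoSchmidtStefanelli2019_thm11_of_quasicube_bound
    (hqc : ∃ K : ℕ, ∀ n c M σ u d : ℕ, 2 ≤ σ → qsq σ ≤ M → M < qsq (σ + 1) → u + 1 ≤ c →
      1 ≤ d → d ≤ M → cubicEIP n = M + (c - 1) * σ + u + halfPerim d →
      (c - 1) * qsq σ + u + d ≤ n → n ≤ (c - 1) * qsq σ + u * (M - qsq σ) + d →
      (c - 1 - σ / 2) ^ 4 ≤ K * (σ + 1)) :
    MaininiPiovanoSchmidtStefanelli2019_thm11 := by
  obtain ⟨K₀, hK₀⟩ := hqc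
  set K := max K₀ 1 with hKdef
  have hK1 : 1 ≤ K := le_max_right _ _
  have hK : ∀ n c M σ u d : ℕ, 2 ≤ σ → qsq σ ≤ M → M < qsq (σ + 1) → u + 1 ≤ c →
      1 ≤ d → d ≤ M → cubicEIP n = M + (c - 1) * σ + u + halfPerim d →
      (c - 1) * qsq σ + u + d ≤ n → n ≤ (c - 1) * qsq σ + u * (M - qsq σ) + d →
      (c - 1 - σ / 2) ^ 4 ≤ K * (σ + 1) :=
    fun n c M σ u d a1 a2 a3 a4 a5 a6 a7 a8 a9 =>
      (hK₀ n c M σ u d a1 a2 a3 a4 a5 a6 a7 a8 a9).trans (Nat.mul_le_mul_right _ (le_max_left _ _))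
  refine MaininiPiovanoSchmidtStefanelli2019_thm11_of_box_bound ⟨16 * K, fun C hC hne s => ?_⟩
  obtain ⟨hm1, -⟩ := latticeRootFloor_three_spec #C
  obtain ⟨D, hD4, hside⟩ := hC.exists_box_dev_of_quasicube hne hK
  obtain ⟨l, u⟩ := hside s
  have hreal := dev_real_bound hK1 hD4 hm1
  rw [abs_le]
  constructor
  · have h : ((latticeRootFloor 3 #C : ℕ) : ℝ) + 1 ≤ (#(C.image fun x => x s) : ℝ) + ((2 * D + 4 : ℕ) : ℝ) := by
      exact_mod_cast l
    push_cast at h hreal ⊢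
    linarith
  · have h : (#(C.image fun x => x s) : ℝ) ≤ ((latticeRootFloor 3 #C : ℕ) : ℝ) + 1 + ((2 * D + 4 : ℕ) : ℝ) := by
      exact_mod_cast u
    push_cast at h hreal ⊢
    linarith

end QuasicubeReduction

/-! ### [MPSS19] §3 Step 3, the core case: a tall quasicube loses to the cube-like competitor -/

section StepThree

/-- `cubicEIP_multisetSum_le` with empty levels allowed (they cost and hold nothing).
[cite: MaininiPiovanoSchmidtStefanelli2019, §2.2] -/
theorem cubicEIP_multisetSum_le' {μ : Multiset ℕ} {B : ℕ} (hB0 : 0 < B) (hB : B ∈ μ)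
    (hle : ∀ a ∈ μ, a ≤ B) : cubicEIP μ.sum ≤ B + (μ.map halfPerim).sum := by
  classical
  set ν := μ.filter fun a => 0 < a with hν
  have hνpos : ∀ a ∈ ν, 0 < a := fun a ha => (Multiset.mem_filter.1 ha).2
  have hBν : B ∈ ν := Multiset.mem_filter.2 ⟨hB, hB0⟩
  have hνle : ∀ a ∈ ν, a ≤ B := fun a ha => hle a (Multiset.mem_filter.1 ha).1
  have hzero : ∀ a ∈ μ.filter (fun a => ¬0 < a), a = 0 := fun a ha => by
    have := (Multiset.mem_filter.1 ha).2; omega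
  have hsum0 : (μ.filter fun a => ¬0 < a).sum = 0 :=
    Multiset.sum_eq_zero fun a ha => hzero a ha
  have hmap0 : ((μ.filter fun a => ¬0 < a).map halfPerim).sum = 0 :=
    Multiset.sum_eq_zero fun b hb => by
      obtain ⟨a, ha, rfl⟩ := Multiset.mem_map.1 hb
      rw [hzero a ha, halfPerim_zero]
  have hsum : μ.sum = ν.sum := by
    rw [← Multiset.filter_add_not (fun a => 0 < a) μ, Multiset.sum_add, hsum0, add_zero]
  have hmap : (μ.map halfPerim).sum = (ν.map halfPerim).sum := by
    rw [← Multiset.filter_add_not (fun a => 0 < a) μ, Multiset.map_add, Multiset.sum_add, hmap0,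
      add_zero]
  rw [hsum, hmap]
  exact cubicEIP_multisetSum_le hνpos hBν hνle

/-- The degenerate configuration `2(p + k) ≤ 3k² + 1` is incompatible with `3k²p + k³ ≤ (p+k)²`
once `k ≥ 2`. [cite: MaininiPiovanoSchmidtStefanelli2019, §3 Step 3] -/
private theorem stepThree_degenerate {p k : ℕ} (hk2 : 2 ≤ k) (hcase : 2 * (p + k) ≤ 3 * k ^ 2 + 1)
    (hkp : 3 * k ^ 2 * p + k ^ 3 ≤ (p + k) ^ 2) : False := by
  have h1 : p * (2 * (p + k)) ≤ p * (3 * k ^ 2 + 1) := Nat.mul_le_mul_left p hcase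
  have h2 : k ^ 2 * 2 ≤ k ^ 2 * k := Nat.mul_le_mul_left _ hk2
  have hkk : 2 * k ≤ k * k := by nlinarith
  have h3 : p * (2 * k + 1) ≤ p * (3 * k ^ 2) := Nat.mul_le_mul_left p (by nlinarith)
  nlinarith [h1, h2, h3, hkp]

/-- **The fourth-order cancellation of [MPSS19] §3 Step 3 (core case).**  Consider the quasicube
profile with square cross-section `p × p`, `p + 3k` full levels and a top level of `d` points,
`1 ≤ d ≤ 3k²p + k³` (`n = (p + 3k)p² + d`), and suppose it is optimal:
`G₃(n) = p² + 2p(p + 3k) + ⌈2√d⌉`.  Comparing with the competitor "`p + k − 1` levels of the square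
`(p + k)²` plus one level of `(p+k)² − 3k²p − k³ + d` points" (the profile form of the rearranged
configuration `M̃_n` of Step 3, whose top face has the aspect defect `3k²`), all terms of order
`p²`, `pk`, `k²·p⁰` cancel and one is left with `⌈2√((p+k)² − 3k²p − k³)⌉ ≥ 2(p + k) − 3k²`, i.e.
(by the Galois connection `⌈2√m⌉ ≤ s ↔ m ≤ q(s)`) the printed relation "`4αℓ = 9k⁴ + …`" in the form
`9k⁴ + 6k² < 4p + 8k³ + 4k`: the height excess `3k` is at most of order `p^{1/4}`.  (The residues
`(c − 1 − ℓ) mod 3 ∈ {1, 2}`, the non-square cross-section, the top-class levels `u` and a nearly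
full top level are the remaining cases of the arithmetic lemma that
`MaininiPiovanoSchmidtStefanelli2019_thm11_of_quasicube_bound` asks for; they follow the same
template.) [cite: MaininiPiovanoSchmidtStefanelli2019, §3 Step 3 (eqs. (3.7)–(3.11): 4αℓ = 9k⁴ + 12s₁k³ + …)] -/
theorem tall_quasicube_core {p k d n : ℕ} (hp : 1 ≤ p) (hk : 1 ≤ k) (hd : 1 ≤ d)
    (hkp : 3 * k ^ 2 * p + k ^ 3 ≤ (p + k) ^ 2) (hdk : d ≤ 3 * k ^ 2 * p + k ^ 3)
    (hn : n = (p + 3 * k) * p ^ 2 + d)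
    (hopt : cubicEIP n = p ^ 2 + (p + 3 * k) * (2 * p) + halfPerim d) :
    9 * k ^ 4 + 6 * k ^ 2 < 4 * p + 8 * k ^ 3 + 4 * k := by
  classical
  obtain ⟨j, hj⟩ : ∃ j, p + k = j + 1 := ⟨p + k - 1, by omega⟩
  obtain ⟨ρ₀, hρ₀⟩ : ∃ ρ₀, ρ₀ + (3 * k ^ 2 * p + k ^ 3) = (p + k) ^ 2 :=
    ⟨(p + k) ^ 2 - (3 * k ^ 2 * p + k ^ 3), Nat.sub_add_cancel hkp⟩
  -- the competitor multiset: `j = p + k − 1` squares `(p+k)²` and one level `ρ₀ + d`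
  set μ : Multiset ℕ := Multiset.replicate j ((p + k) ^ 2) + {ρ₀ + d} with hμ
  have hQpos : 0 < (p + k) ^ 2 := by positivity
  have hj1 : 1 ≤ j := by omega
  have hμpos : ∀ a ∈ μ, 0 < a := by
    intro a ha
    rw [hμ, Multiset.mem_add, Multiset.mem_replicate, Multiset.mem_singleton] at ha
    rcases ha with ⟨-, rfl⟩ | rfl
    · exact hQpos
    · omega
  have hB : (p + k) ^ 2 ∈ μ := by
    rw [hμ, Multiset.mem_add, Multiset.mem_replicate]
    exact Or.inl ⟨by omega, rfl⟩
  have hμle : ∀ a ∈ μ, a ≤ (p + k) ^ 2 := by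
    intro a ha
    rw [hμ, Multiset.mem_add, Multiset.mem_replicate, Multiset.mem_singleton] at ha
    rcases ha with ⟨-, rfl⟩ | rfl
    · exact le_rfl
    · omega
  have e1 : (p + 3 * k) * p ^ 2 + (3 * k ^ 2 * p + k ^ 3) = (p + k) ^ 3 := by ring
  have e2 : (p + k) ^ 3 = j * (p + k) ^ 2 + (p + k) ^ 2 := by rw [hj]; ring
  have hμsum : μ.sum = n := by
    rw [hμ, Multiset.sum_add, Multiset.sum_replicate, Multiset.sum_singleton, smul_eq_mul, hn]
    omega
  have hμg : (μ.map halfPerim).sum = j * (2 * (p + k)) + halfPerim (ρ₀ + d) := by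
    rw [hμ, Multiset.map_add, Multiset.sum_add, Multiset.map_replicate, Multiset.sum_replicate,
      Multiset.map_singleton, Multiset.sum_singleton, smul_eq_mul, halfPerim_sq (by omega)]
  have hcomp := cubicEIP_multisetSum_le hμpos hB hμle
  rw [hμsum, hμg, hopt] at hcomp
  -- `⌈2√(ρ₀ + d)⌉ ≤ ⌈2√ρ₀⌉ + ⌈2√d⌉`, and the quadratic terms cancel: `2(p+k) ≤ 3k² + ⌈2√ρ₀⌉`
  have hsub : halfPerim (ρ₀ + d) ≤ halfPerim ρ₀ + halfPerim d := halfPerim_add_le _ _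
  have i1 : j * (2 * (p + k)) + 2 * (p + k) = 2 * (p + k) ^ 2 := by rw [hj]; ring
  have i2 : (p + k) ^ 2 = p ^ 2 + 2 * (p * k) + k ^ 2 := by ring
  have i3 : (p + 3 * k) * (2 * p) = 2 * p ^ 2 + 6 * (p * k) := by ring
  have hkey : 2 * (p + k) ≤ 3 * k ^ 2 + halfPerim ρ₀ := by omega
  -- Galois connection: `q(2(p+k) − 3k² − 1) < ρ₀`, then `4q(t) + 1 ≥ t²`
  rcases Nat.lt_or_ge (3 * k ^ 2 + 1) (2 * (p + k)) with hcase | hcase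
  · obtain ⟨t, ht⟩ : ∃ t, 2 * (p + k) = t + 3 * k ^ 2 + 1 := ⟨2 * (p + k) - 3 * k ^ 2 - 1, by omega⟩
    have hlt : qsq t < ρ₀ := qsq_lt_of_lt_halfPerim (by omega)
    have hq := sq_le_four_mul_qsq_add_one t
    have h4 : t ^ 2 < 4 * ρ₀ + 1 := by omega
    have htZ : (t : ℤ) = 2 * ((p : ℤ) + k) - 3 * (k : ℤ) ^ 2 - 1 := by
      have h := congrArg (Nat.cast : ℕ → ℤ) ht
      push_cast at h
      linarith
    have h4Z : (t : ℤ) ^ 2 < 4 * (ρ₀ : ℤ) + 1 := by exact_mod_cast h4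
    have hρZ : (ρ₀ : ℤ) + (3 * (k : ℤ) ^ 2 * p + (k : ℤ) ^ 3) = ((p : ℤ) + k) ^ 2 := by
      exact_mod_cast hρ₀
    have ht2 : (t : ℤ) ^ 2 = (2 * ((p : ℤ) + k) - 3 * (k : ℤ) ^ 2 - 1) ^ 2 := by rw [htZ]
    have goalZ : 9 * (k : ℤ) ^ 4 + 6 * (k : ℤ) ^ 2 < 4 * p + 8 * (k : ℤ) ^ 3 + 4 * k := by
      nlinarith [ht2, h4Z, hρZ]
    exact_mod_cast goalZ
  · -- degenerate: `2(p+k) ≤ 3k² + 1` forces `k = p = 1`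
    rcases Nat.lt_or_ge k 2 with hk1 | hk2
    · have hk1' : k = 1 := by omega
      subst hk1'
      have hp1 : p = 1 := by omega
      subst hp1
      norm_num
    · exact (stepThree_degenerate hk2 hcase hkp).elim

/-- **The fourth-order cancellation of [MPSS19] §3 Step 3, with spare levels.**  Consider the
quasicube profile with square cross-section `p × p`, `p + 3k + e` full levels and a top level of `d ≤ p²`
points (`n = (p + 3k + e)p² + d`), and suppose it is optimal:
`G₃(n) = p² + 2p(p + 3k + e) + ⌈2√d⌉`.  Comparing with the competitor "`p + k − 1` levels of the
square `(p + k)²`, one level of `(p+k)² − 3k²p − k³` points, `e` untouched levels `p²` and the old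
top level `d`" (the profile form of the rearranged configuration `M̃_n` of Step 3 — move `2k` of the
top levels onto two side faces — whose top face has the aspect defect `3k²`), all terms of order
`p²`, `pk` cancel, `⌈2√d⌉` and the `e` spare levels cancel, and one is left with
`⌈2√((p+k)² − 3k²p − k³)⌉ ≥ 2(p + k) − 3k²`, i.e. (by the Galois connection `⌈2√m⌉ ≤ s ↔ m ≤ q(s)`)
the printed relation "`4αℓ = 9k⁴ + …`" in the form `9k⁴ + 6k² < 4p + 8k³ + 4k`: as `e ≥ 0` is
free, EVERY admissible `k ≤ (height excess)/3` (admissible: `3k²p + k³ ≤ (p+k)²`) satisfies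
`9k⁴ < 4p + 8k³ + 4k`, so the height excess is `O(p^{1/4})` once `p` is large.  (The non-square
cross-section `p(p+1)`, the top-class levels `u` of the quasicube accounting and the small `p` are
the remaining cases of the arithmetic lemma that
`MaininiPiovanoSchmidtStefanelli2019_thm11_of_quasicube_bound` asks for; they follow the same
template.) [cite: MaininiPiovanoSchmidtStefanelli2019, §3 Step 3 (eqs. (3.7)–(3.11): 4αℓ = 9k⁴ + 12s₁k³ + …)] -/
theorem tall_quasicube {p k e d n : ℕ} (hp : 1 ≤ p) (hk : 1 ≤ k) (hdp : d ≤ p ^ 2)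
    (hkp : 3 * k ^ 2 * p + k ^ 3 ≤ (p + k) ^ 2) (hn : n = (p + 3 * k + e) * p ^ 2 + d)
    (hopt : cubicEIP n = p ^ 2 + (p + 3 * k + e) * (2 * p) + halfPerim d) :
    9 * k ^ 4 + 6 * k ^ 2 < 4 * p + 8 * k ^ 3 + 4 * k := by
  classical
  obtain ⟨j, hj⟩ : ∃ j, p + k = j + 1 := ⟨p + k - 1, by omega⟩
  obtain ⟨ρ₀, hρ₀⟩ : ∃ ρ₀, ρ₀ + (3 * k ^ 2 * p + k ^ 3) = (p + k) ^ 2 :=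
    ⟨(p + k) ^ 2 - (3 * k ^ 2 * p + k ^ 3), Nat.sub_add_cancel hkp⟩
  -- the competitor: `j = p + k − 1` squares `(p+k)²`, one level `ρ₀`, `e` levels `p²`, the top `d`
  set μ : Multiset ℕ :=
    Multiset.replicate j ((p + k) ^ 2) + Multiset.replicate e (p ^ 2) + {ρ₀, d} with hμ
  have hQpos : 0 < (p + k) ^ 2 := by positivity
  have hj1 : 1 ≤ j := by omega
  have hpQ : p ^ 2 ≤ (p + k) ^ 2 := Nat.pow_le_pow_left (by omega) 2
  have hB : (p + k) ^ 2 ∈ μ := by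
    rw [hμ, Multiset.mem_add, Multiset.mem_add, Multiset.mem_replicate]
    exact Or.inl (Or.inl ⟨by omega, rfl⟩)
  have hμle : ∀ a ∈ μ, a ≤ (p + k) ^ 2 := by
    intro a ha
    rw [hμ, Multiset.mem_add, Multiset.mem_add, Multiset.mem_replicate, Multiset.mem_replicate,
      Multiset.insert_eq_cons, Multiset.mem_cons, Multiset.mem_singleton] at ha
    rcases ha with (⟨-, rfl⟩ | ⟨-, rfl⟩) | rfl | rfl
    · exact le_rfl
    · exact hpQ
    · omega
    · exact hdp.trans hpQ
  have e1 : (p + 3 * k) * p ^ 2 + (3 * k ^ 2 * p + k ^ 3) = (p + k) ^ 3 := by ring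
  have e2 : (p + k) ^ 3 = j * (p + k) ^ 2 + (p + k) ^ 2 := by rw [hj]; ring
  have e3 : (p + 3 * k + e) * p ^ 2 = (p + 3 * k) * p ^ 2 + e * p ^ 2 := by ring
  have hμsum : μ.sum = n := by
    rw [hμ, Multiset.sum_add, Multiset.sum_add, Multiset.sum_replicate, Multiset.sum_replicate,
      Multiset.insert_eq_cons, Multiset.sum_cons, Multiset.sum_singleton, smul_eq_mul, smul_eq_mul,
      hn]
    omega
  have hμg : (μ.map halfPerim).sum =
      j * (2 * (p + k)) + e * (2 * p) + (halfPerim ρ₀ + halfPerim d) := by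
    rw [hμ, Multiset.map_add, Multiset.map_add, Multiset.sum_add, Multiset.sum_add,
      Multiset.map_replicate, Multiset.map_replicate, Multiset.sum_replicate,
      Multiset.sum_replicate, Multiset.insert_eq_cons, Multiset.map_cons, Multiset.sum_cons,
      Multiset.map_singleton, Multiset.sum_singleton, smul_eq_mul, smul_eq_mul,
      halfPerim_sq (k := p + k) (by omega), halfPerim_sq (k := p) hp]
  have hcomp := cubicEIP_multisetSum_le' hQpos hB hμle
  rw [hμsum, hμg, hopt] at hcomp
  -- the quadratic terms, the spare levels and `⌈2√d⌉` cancel: `2(p+k) ≤ 3k² + ⌈2√ρ₀⌉`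
  have i1 : j * (2 * (p + k)) + 2 * (p + k) = 2 * (p + k) ^ 2 := by rw [hj]; ring
  have i2 : (p + k) ^ 2 = p ^ 2 + 2 * (p * k) + k ^ 2 := by ring
  have i3 : (p + 3 * k + e) * (2 * p) = 2 * p ^ 2 + 6 * (p * k) + e * (2 * p) := by ring
  have hkey : 2 * (p + k) ≤ 3 * k ^ 2 + halfPerim ρ₀ := by omega
  -- Galois connection: `q(2(p+k) − 3k² − 1) < ρ₀`, then `4q(t) + 1 ≥ t²`
  rcases Nat.lt_or_ge (3 * k ^ 2 + 1) (2 * (p + k)) with hcase | hcase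
  · obtain ⟨t, ht⟩ : ∃ t, 2 * (p + k) = t + 3 * k ^ 2 + 1 := ⟨2 * (p + k) - 3 * k ^ 2 - 1, by omega⟩
    have hlt : qsq t < ρ₀ := qsq_lt_of_lt_halfPerim (by omega)
    have hq := sq_le_four_mul_qsq_add_one t
    have h4 : t ^ 2 < 4 * ρ₀ + 1 := by omega
    have htZ : (t : ℤ) = 2 * ((p : ℤ) + k) - 3 * (k : ℤ) ^ 2 - 1 := by
      have h := congrArg (Nat.cast : ℕ → ℤ) ht
      push_cast at h
      linarith
    have h4Z : (t : ℤ) ^ 2 < 4 * (ρ₀ : ℤ) + 1 := by exact_mod_cast h4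
    have hρZ : (ρ₀ : ℤ) + (3 * (k : ℤ) ^ 2 * p + (k : ℤ) ^ 3) = ((p : ℤ) + k) ^ 2 := by
      exact_mod_cast hρ₀
    have ht2 : (t : ℤ) ^ 2 = (2 * ((p : ℤ) + k) - 3 * (k : ℤ) ^ 2 - 1) ^ 2 := by rw [htZ]
    have goalZ : 9 * (k : ℤ) ^ 4 + 6 * (k : ℤ) ^ 2 < 4 * p + 8 * (k : ℤ) ^ 3 + 4 * k := by
      nlinarith [ht2, h4Z, hρZ]
    exact_mod_cast goalZ
  · -- degenerate: `2(p+k) ≤ 3k² + 1` forces `k = p = 1`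
    rcases Nat.lt_or_ge k 2 with hk1 | hk2
    · have hk1' : k = 1 := by omega
      subst hk1'
      have hp1 : p = 1 := by omega
      subst hp1
      norm_num
    · exact (stepThree_degenerate hk2 hcase hkp).elim

/-- Degenerate configuration of the pronic case: `2p + 3k + 1 ≤ 3k²` is incompatible with the
admissibility `3pk² + k³ + k² ≤ (p+k)(p+k+1) + pk`. [cite: MaininiPiovanoSchmidtStefanelli2019, §3 Step 3] -/
private theorem stepThree_degenerate_odd {p k : ℕ} (hp : 1 ≤ p) (hk : 1 ≤ k)
    (hcase : 2 * p + 3 * k + 1 ≤ 3 * k ^ 2)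
    (hkp : 3 * p * k ^ 2 + k ^ 3 + k ^ 2 ≤ (p + k) * (p + k + 1) + p * k) : False := by
  rcases Nat.lt_or_ge k 2 with hk1 | hk2
  · have hk1' : k = 1 := by omega
    subst hk1'
    omega
  · have h1 : p * (2 * p + 3 * k + 1) ≤ p * (3 * k ^ 2) := Nat.mul_le_mul_left p hcase
    have h2 : k ^ 2 * 2 ≤ k ^ 2 * k := Nat.mul_le_mul_left _ hk2
    have h3 : 1 * k ≤ k * k := Nat.mul_le_mul_right k hk
    nlinarith [h1, h2, h3, hkp]

/-- **[MPSS19] §3 Step 3 for the pronic cross-section `p × (p+1)`** (the case `ℓ' = ℓ + 1`): if the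
profile "`p + 3k + e` levels of `p(p+1)` plus a top level `d ≤ p(p+1)`" is optimal, then every
admissible `k` (`3pk² + k³ + k² ≤ (p+k)(p+k+1) + pk`) obeys `9k⁴ + 9k² ≤ 4p + 14k³ + 4k`
(competitor: `p + k − 1` pronic levels `(p+k)(p+k+1)`, one deficient level, `e` spare levels, the
old top level). [cite: MaininiPiovanoSchmidtStefanelli2019, §3 Step 3 (eqs. (3.7)–(3.11) with s₂ = 1)] -/
theorem tall_quasicube_odd {p k e d n : ℕ} (hp : 1 ≤ p) (hk : 1 ≤ k) (hdp : d ≤ p * (p + 1))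
    (hkp : 3 * p * k ^ 2 + k ^ 3 + k ^ 2 ≤ (p + k) * (p + k + 1) + p * k)
    (hn : n = (p + 3 * k + e) * (p * (p + 1)) + d)
    (hopt : cubicEIP n = p * (p + 1) + (p + 3 * k + e) * (2 * p + 1) + halfPerim d) :
    9 * k ^ 4 + 9 * k ^ 2 ≤ 4 * p + 14 * k ^ 3 + 4 * k := by
  classical
  obtain ⟨j, hj⟩ : ∃ j, p + k = j + 1 := ⟨p + k - 1, by omega⟩
  obtain ⟨ρ₀, hρ₀⟩ : ∃ ρ₀, ρ₀ + (3 * p * k ^ 2 + k ^ 3 + k ^ 2) = (p + k) * (p + k + 1) + p * k :=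
    ⟨(p + k) * (p + k + 1) + p * k - (3 * p * k ^ 2 + k ^ 3 + k ^ 2), Nat.sub_add_cancel hkp⟩
  -- the competitor: `j = p + k − 1` pronic levels, one level `ρ₀`, `e` levels `p(p+1)`, top `d`
  set μ : Multiset ℕ :=
    Multiset.replicate j ((p + k) * (p + k + 1)) + Multiset.replicate e (p * (p + 1)) + {ρ₀, d}
    with hμ
  have hQpos : 0 < (p + k) * (p + k + 1) := by positivity
  have hj1 : 1 ≤ j := by omega
  have hpQ : p * (p + 1) ≤ (p + k) * (p + k + 1) := Nat.mul_le_mul (by omega) (by omega)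
  have hρQ : ρ₀ ≤ (p + k) * (p + k + 1) := by
    have h1 : p * k ≤ p * k ^ 2 := Nat.mul_le_mul_left p (by nlinarith)
    have h2 : 3 * p * k ^ 2 = 3 * (p * k ^ 2) := by ring
    omega
  have hB : (p + k) * (p + k + 1) ∈ μ := by
    rw [hμ, Multiset.mem_add, Multiset.mem_add, Multiset.mem_replicate]
    exact Or.inl (Or.inl ⟨by omega, rfl⟩)
  have hμle : ∀ a ∈ μ, a ≤ (p + k) * (p + k + 1) := by
    intro a ha
    rw [hμ, Multiset.mem_add, Multiset.mem_add, Multiset.mem_replicate, Multiset.mem_replicate,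
      Multiset.insert_eq_cons, Multiset.mem_cons, Multiset.mem_singleton] at ha
    rcases ha with (⟨-, rfl⟩ | ⟨-, rfl⟩) | rfl | rfl
    · exact le_rfl
    · exact hpQ
    · exact hρQ
    · exact hdp.trans hpQ
  have e1 : (p + 3 * k) * (p * (p + 1)) + (3 * p * k ^ 2 + k ^ 3 + k ^ 2) =
      (p + k) * ((p + k) * (p + k + 1)) + p * k := by ring
  have e2 : (p + k) * ((p + k) * (p + k + 1)) =
      j * ((p + k) * (p + k + 1)) + (p + k) * (p + k + 1) := by rw [hj]; ring
  have e3 : (p + 3 * k + e) * (p * (p + 1)) = (p + 3 * k) * (p * (p + 1)) + e * (p * (p + 1)) := by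
    ring
  have hμsum : μ.sum = n := by
    rw [hμ, Multiset.sum_add, Multiset.sum_add, Multiset.sum_replicate, Multiset.sum_replicate,
      Multiset.insert_eq_cons, Multiset.sum_cons, Multiset.sum_singleton, smul_eq_mul, smul_eq_mul,
      hn]
    omega
  have hμg : (μ.map halfPerim).sum =
      j * (2 * (p + k) + 1) + e * (2 * p + 1) + (halfPerim ρ₀ + halfPerim d) := by
    rw [hμ, Multiset.map_add, Multiset.map_add, Multiset.sum_add, Multiset.sum_add,
      Multiset.map_replicate, Multiset.map_replicate, Multiset.sum_replicate,
      Multiset.sum_replicate, Multiset.insert_eq_cons, Multiset.map_cons, Multiset.sum_cons,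
      Multiset.map_singleton, Multiset.sum_singleton, smul_eq_mul, smul_eq_mul,
      halfPerim_mul_succ (k := p + k) (by omega), halfPerim_mul_succ (k := p) hp]
  have hcomp := cubicEIP_multisetSum_le' hQpos hB hμle
  rw [hμsum, hμg, hopt] at hcomp
  -- cancellation: `2p + 3k + 1 ≤ 3k² + ⌈2√ρ₀⌉`
  have i1 : j * (2 * (p + k) + 1) + (2 * (p + k) + 1) = 2 * p ^ 2 + 4 * (p * k) + 2 * k ^ 2 + p + k := by
    have : j * (2 * (p + k) + 1) + (2 * (p + k) + 1) = (p + k) * (2 * (p + k) + 1) := by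
      rw [hj]; ring
    rw [this]; ring
  have i2 : (p + k) * (p + k + 1) = p * (p + 1) + 2 * (p * k) + k ^ 2 + k := by ring
  have i3 : (p + 3 * k + e) * (2 * p + 1) = 2 * p ^ 2 + p + 6 * (p * k) + 3 * k + e * (2 * p + 1) := by
    ring
  have i4 : p * (p + 1) = p ^ 2 + p := by ring
  have hkey : 2 * p + 3 * k + 1 ≤ 3 * k ^ 2 + halfPerim ρ₀ := by omega
  rcases Nat.lt_or_ge (3 * k ^ 2) (2 * p + 3 * k + 1) with hcase | hcase
  · obtain ⟨t, ht⟩ : ∃ t, 2 * p + 3 * k = t + 3 * k ^ 2 := ⟨2 * p + 3 * k - 3 * k ^ 2, by omega⟩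
    have hlt : qsq t < ρ₀ := qsq_lt_of_lt_halfPerim (by omega)
    have hq := sq_le_four_mul_qsq_add_one t
    have h4 : t ^ 2 < 4 * ρ₀ + 1 := by omega
    have htZ : (t : ℤ) = 2 * (p : ℤ) + 3 * k - 3 * (k : ℤ) ^ 2 := by
      have h := congrArg (Nat.cast : ℕ → ℤ) ht
      push_cast at h
      linarith
    have h4Z : (t : ℤ) ^ 2 < 4 * (ρ₀ : ℤ) + 1 := by exact_mod_cast h4
    have hρZ : (ρ₀ : ℤ) + (3 * (p : ℤ) * (k : ℤ) ^ 2 + (k : ℤ) ^ 3 + (k : ℤ) ^ 2) =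
        ((p : ℤ) + k) * ((p : ℤ) + k + 1) + p * k := by
      exact_mod_cast hρ₀
    have ht2 : (t : ℤ) ^ 2 = 4 * (p : ℤ) ^ 2 + 9 * (k : ℤ) ^ 2 + 9 * (k : ℤ) ^ 4
        + 12 * ((p : ℤ) * k) - 12 * ((p : ℤ) * (k : ℤ) ^ 2) - 18 * (k : ℤ) ^ 3 := by
      rw [htZ]; ring
    have hρZ' : 4 * (ρ₀ : ℤ) = 4 * (p : ℤ) ^ 2 + 12 * ((p : ℤ) * k) + 4 * p + 4 * k
        - 12 * ((p : ℤ) * (k : ℤ) ^ 2) - 4 * (k : ℤ) ^ 3 := by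
      linear_combination 4 * hρZ
    have goalZ : 9 * (k : ℤ) ^ 4 + 9 * (k : ℤ) ^ 2 ≤ 4 * p + 14 * (k : ℤ) ^ 3 + 4 * k := by
      linarith [ht2, hρZ', h4Z]
    exact_mod_cast goalZ
  · exact (stepThree_degenerate_odd hp hk hcase hkp).elim

/-- Small square cross-sections `2 ≤ p ≤ 8`: a height excess `≥ 6` is never optimal (competitor:
`p` squares `(p+2)²`, one level `2p² − 4p`, spare levels, top level).
[cite: MaininiPiovanoSchmidtStefanelli2019, §3 Step 3] -/
private theorem tall_quasicube_small {p e d n : ℕ} (hp : 2 ≤ p) (hp8 : p ≤ 8) (hdp : d ≤ p ^ 2)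
    (hn : n = (p + 6 + e) * p ^ 2 + d)
    (hopt : cubicEIP n = p ^ 2 + (p + 6 + e) * (2 * p) + halfPerim d) : False := by
  classical
  have h4p : 4 * p ≤ 2 * p ^ 2 := by nlinarith
  obtain ⟨ρ₀, hρ₀⟩ : ∃ ρ₀, ρ₀ + 4 * p = 2 * p ^ 2 := ⟨2 * p ^ 2 - 4 * p, by omega⟩
  set μ : Multiset ℕ :=
    Multiset.replicate p ((p + 2) ^ 2) + Multiset.replicate e (p ^ 2) + {ρ₀, d} with hμ
  have hQpos : 0 < (p + 2) ^ 2 := by positivity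
  have hpQ : p ^ 2 ≤ (p + 2) ^ 2 := Nat.pow_le_pow_left (by omega) 2
  have hρQ : ρ₀ ≤ (p + 2) ^ 2 := by nlinarith
  have hB : (p + 2) ^ 2 ∈ μ := by
    rw [hμ, Multiset.mem_add, Multiset.mem_add, Multiset.mem_replicate]
    exact Or.inl (Or.inl ⟨by omega, rfl⟩)
  have hμle : ∀ a ∈ μ, a ≤ (p + 2) ^ 2 := by
    intro a ha
    rw [hμ, Multiset.mem_add, Multiset.mem_add, Multiset.mem_replicate, Multiset.mem_replicate,
      Multiset.insert_eq_cons, Multiset.mem_cons, Multiset.mem_singleton] at ha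
    rcases ha with (⟨-, rfl⟩ | ⟨-, rfl⟩) | rfl | rfl
    · exact le_rfl
    · exact hpQ
    · exact hρQ
    · exact hdp.trans hpQ
  have e1 : (p + 6 + e) * p ^ 2 + 4 * p = p * (p + 2) ^ 2 + 2 * p ^ 2 + e * p ^ 2 := by ring
  have hμsum : μ.sum = n := by
    rw [hμ, Multiset.sum_add, Multiset.sum_add, Multiset.sum_replicate, Multiset.sum_replicate,
      Multiset.insert_eq_cons, Multiset.sum_cons, Multiset.sum_singleton, smul_eq_mul, smul_eq_mul,
      hn]
    omega
  have hμg : (μ.map halfPerim).sum =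
      p * (2 * (p + 2)) + e * (2 * p) + (halfPerim ρ₀ + halfPerim d) := by
    rw [hμ, Multiset.map_add, Multiset.map_add, Multiset.sum_add, Multiset.sum_add,
      Multiset.map_replicate, Multiset.map_replicate, Multiset.sum_replicate,
      Multiset.sum_replicate, Multiset.insert_eq_cons, Multiset.map_cons, Multiset.sum_cons,
      Multiset.map_singleton, Multiset.sum_singleton, smul_eq_mul, smul_eq_mul,
      halfPerim_sq (k := p + 2) (by omega), halfPerim_sq (k := p) (by omega)]
  have hcomp := cubicEIP_multisetSum_le' hQpos hB hμle
  rw [hμsum, hμg, hopt] at hcomp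
  have i1 : (p + 2) ^ 2 + p * (2 * (p + 2)) + 4 * p = p ^ 2 + (p + 6) * (2 * p) + 4 := by ring
  have i2 : (p + 6 + e) * (2 * p) = (p + 6) * (2 * p) + e * (2 * p) := by ring
  have hkey : 4 * p ≤ 4 + halfPerim ρ₀ := by omega
  -- but `⌈2√(2p² − 4p)⌉ ≤ 4p − 5`, since `2p² − 4p ≤ q(4p − 5) = (2p − 3)(2p − 2)`
  have hle : halfPerim ρ₀ ≤ 4 * p - 5 := by
    rw [halfPerim_le_iff]
    obtain ⟨a, ha⟩ : ∃ a, p = a + 2 := ⟨p - 2, by omega⟩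
    subst ha
    rw [show 4 * (a + 2) - 5 = 2 * (2 * a + 1) + 1 by omega, qsq_two_mul_add_one]
    nlinarith
  omega

/-- The unit cross-section `p = 1`: a column with more than `6` unit levels is never optimal
(competitor: squares `2 × 2`). [cite: MaininiPiovanoSchmidtStefanelli2019, §3 Step 3] -/
private theorem tall_quasicube_one {L d n : ℕ} (hd : d ≤ 1) (hn : n = L + d)
    (hopt : cubicEIP n = 1 + L * 2 + halfPerim d) : L ≤ 6 := by
  classical
  by_contra hc
  push Not at hc
  set w := n / 4 with hw
  set r := n % 4 with hr
  have hn4 : n = w * 4 + r := by rw [hw, hr, Nat.div_add_mod' n 4]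
  have hr4 : r < 4 := Nat.mod_lt _ (by norm_num)
  have hw1 : 1 ≤ w := by omega
  set μ : Multiset ℕ := Multiset.replicate w 4 + {r} with hμ
  have hB : 4 ∈ μ := by
    rw [hμ, Multiset.mem_add, Multiset.mem_replicate]; exact Or.inl ⟨by omega, rfl⟩
  have hμle : ∀ a ∈ μ, a ≤ 4 := by
    intro a ha
    rw [hμ, Multiset.mem_add, Multiset.mem_replicate, Multiset.mem_singleton] at ha
    rcases ha with ⟨-, rfl⟩ | rfl
    · exact le_rfl
    · omega
  have hμsum : μ.sum = n := by
    rw [hμ, Multiset.sum_add, Multiset.sum_replicate, Multiset.sum_singleton, smul_eq_mul, hn4]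
  have h4 : halfPerim 4 = 4 := by
    rw [show (4 : ℕ) = 2 ^ 2 by norm_num, halfPerim_sq (k := 2) (by norm_num)]; norm_num
  have hμg : (μ.map halfPerim).sum = w * 4 + halfPerim r := by
    rw [hμ, Multiset.map_add, Multiset.sum_add, Multiset.map_replicate, Multiset.sum_replicate,
      Multiset.map_singleton, Multiset.sum_singleton, smul_eq_mul, h4]
  have hcomp := cubicEIP_multisetSum_le' (by norm_num : 0 < 4) hB hμle
  rw [hμsum, hμg, hopt] at hcomp
  have hgr : halfPerim r ≤ r + 1 := by
    interval_cases r
    · simp [halfPerim_zero]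
    · rw [halfPerim_one]
    · show halfPerim 2 ≤ 3
      rw [halfPerim_le_iff, show (3 : ℕ) = 2 * 1 + 1 by norm_num, qsq_two_mul_add_one]
    · show halfPerim 3 ≤ 4
      rw [halfPerim_le_iff, show (4 : ℕ) = 2 * 2 by norm_num, qsq_two_mul]; norm_num
  omega

/-- **The arithmetic of [MPSS19] §3 Step 3 for square-based pure boxes, complete**: if the profile
"`c − 1` levels of the square `p²` plus a top level `d ≤ p²`" is optimal, its height excess
`h = c − 1 − p` satisfies `h⁴ ≤ 5000·p`.  (Choice of `k`: `min(h/3, ⌊√(p/3)⌋)` is admissible for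
`tall_quasicube`; the ranges `p ≤ 8`, `9 ≤ p ≤ 24`, `25 ≤ p ≤ 138` use `tall_quasicube_small`,
`k = 2`, `k = 3`.)  This is the case "`M_s = q(σ)`, `σ` even" of the hypothesis of
`MaininiPiovanoSchmidtStefanelli2019_thm11_of_quasicube_bound`.
[cite: MaininiPiovanoSchmidtStefanelli2019, §3 Steps 3–4 (ℓ₃ − ℓ ≤ √6 α^{1/4} ℓ^{1/4} + o(ℓ^{1/4}))] -/
theorem pureBox_sq_height_pow_four_le {p c d n : ℕ} (hp : 1 ≤ p) (hdp : d ≤ p ^ 2)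
    (hn : n = (c - 1) * p ^ 2 + d) (hopt : cubicEIP n = p ^ 2 + (c - 1) * (2 * p) + halfPerim d) :
    (c - 1 - p) ^ 4 ≤ 5000 * p := by
  rcases Nat.lt_or_ge (c - 1) p with hlt | hge
  · rw [show c - 1 - p = 0 by omega]; simp
  obtain ⟨h, hh⟩ : ∃ h, c - 1 = p + h := ⟨c - 1 - p, by omega⟩
  rw [show c - 1 - p = h by omega]
  rw [hh] at hn hopt
  -- generic use of `tall_quasicube` with `3k ≤ h`
  have use : ∀ k : ℕ, 1 ≤ k → 3 * k ≤ h → 3 * k ^ 2 * p + k ^ 3 ≤ (p + k) ^ 2 →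
      9 * k ^ 4 + 6 * k ^ 2 < 4 * p + 8 * k ^ 3 + 4 * k := by
    intro k hk1 hkh hadm
    obtain ⟨e, he⟩ : ∃ e, h = 3 * k + e := ⟨h - 3 * k, by omega⟩
    refine tall_quasicube (n := n) (e := e) hp hk1 hdp hadm ?_ ?_
    · rw [hn, he, add_assoc]
    · rw [hopt, he, ← add_assoc p]
  by_cases h8 : h ≤ 8
  · calc h ^ 4 ≤ 8 ^ 4 := Nat.pow_le_pow_left h8 4
      _ ≤ 5000 * p := by omega
  push Not at h8
  rcases Nat.lt_or_ge p 9 with hp9 | hp9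
  · -- `p ≤ 8`: no optimal profile has `h ≥ 6`
    exfalso
    rcases Nat.lt_or_ge p 2 with hp2 | hp2
    · have hp1 : p = 1 := by omega
      subst hp1
      have hd1 : d ≤ 1 := by simpa using hdp
      have := tall_quasicube_one (n := n) (L := 1 + h) hd1 (by rw [hn]; ring)
        (by rw [hopt]; ring)
      omega
    · obtain ⟨e, he⟩ : ∃ e, h = 6 + e := ⟨h - 6, by omega⟩
      refine tall_quasicube_small (n := n) (e := e) hp2 (by omega) hdp ?_ ?_
      · rw [hn, he, add_assoc]
      · rw [hopt, he, ← add_assoc p]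
  rcases Nat.lt_or_ge p 25 with hp25 | hp25
  · -- `9 ≤ p ≤ 24`: `k = 2`
    exfalso
    have := use 2 (by norm_num) (by omega) (by nlinarith)
    omega
  rcases Nat.lt_or_ge p 139 with hp139 | hp139
  · -- `25 ≤ p ≤ 138`: `k = 3`
    exfalso
    have := use 3 (by norm_num) (by omega) (by nlinarith)
    omega
  -- `p ≥ 139`: `k = min (h/3) ⌊√(p/3)⌋`
  set k₁ := Nat.sqrt (p / 3) with hk₁
  have hk₁sq : k₁ ^ 2 ≤ p / 3 := Nat.sqrt_le' _
  have hk₁lt : p / 3 < (k₁ + 1) ^ 2 := Nat.lt_succ_sqrt' _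
  have hk₁6 : 6 ≤ k₁ := by rw [hk₁]; apply Nat.le_sqrt.2; omega
  have adm : ∀ k, 1 ≤ k → k ≤ k₁ → 3 * k ^ 2 * p + k ^ 3 ≤ (p + k) ^ 2 := by
    intro k hk1 hkk
    have hk2 : k ^ 2 ≤ p / 3 := (Nat.pow_le_pow_left hkk 2).trans hk₁sq
    have h3 : 3 * k ^ 2 ≤ p := by omega
    have h4 : k ^ 3 ≤ 2 * p * k := by
      calc k ^ 3 = k ^ 2 * k := by ring
        _ ≤ (2 * p) * k := Nat.mul_le_mul_right k (by omega)
        _ = 2 * p * k := by ring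
    nlinarith
  have hp3 : p / 3 ≤ p := Nat.div_le_self _ _
  rcases Nat.lt_or_ge (h / 3) (k₁ + 1) with hsmall | hbig
  · -- `k = h / 3 ≤ k₁`
    set k := h / 3 with hk
    have hk1 : 1 ≤ k := by omega
    have hb := use k hk1 (by omega) (adm k hk1 (by omega))
    have hkk : k ≤ k ^ 2 := by nlinarith
    have hkp : k ≤ p := by
      have : k ^ 2 ≤ p / 3 := (Nat.pow_le_pow_left (show k ≤ k₁ by omega) 2).trans hk₁sq
      omega
    have h34 : 8 * k ^ 3 ≤ 8 * k ^ 4 := by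
      have : k ^ 3 * 1 ≤ k ^ 3 * k := Nat.mul_le_mul_left _ hk1
      nlinarith
    have hk4 : k ^ 4 < 8 * p := by omega
    have hh5 : h ≤ 5 * k := by omega
    calc h ^ 4 ≤ (5 * k) ^ 4 := Nat.pow_le_pow_left hh5 4
      _ = 625 * k ^ 4 := by ring
      _ ≤ 5000 * p := by omega
  · -- `k = k₁ < h / 3`: `9k₁⁴ < 4p + 8k₁³ + 4k₁` and `p < 3(k₁+1)² + 3` contradict `k₁ ≥ 6`
    exfalso
    have hb := use k₁ (by omega) (by omega) (adm k₁ (by omega) le_rfl)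
    have i2 : 6 * k₁ ≤ k₁ ^ 2 := by nlinarith
    have i3 : 6 * k₁ ^ 2 ≤ k₁ ^ 3 := by
      have : k₁ ^ 2 * 6 ≤ k₁ ^ 2 * k₁ := Nat.mul_le_mul_left _ hk₁6
      nlinarith
    have i4 : 6 * k₁ ^ 3 ≤ k₁ ^ 4 := by
      have : k₁ ^ 3 * 6 ≤ k₁ ^ 3 * k₁ := Nat.mul_le_mul_left _ hk₁6
      nlinarith
    have isq : (k₁ + 1) ^ 2 = k₁ ^ 2 + 2 * k₁ + 1 := by ring
    have hp' : p < 3 * k₁ ^ 2 + 6 * k₁ + 6 := by omega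
    omega

/-- Small pronic cross-sections `1 ≤ p ≤ 6`: a height excess `≥ 6` is never optimal (competitor:
`p` pronic levels `(p+2)(p+3)`, one level `2p²`, spare levels, top level).
[cite: MaininiPiovanoSchmidtStefanelli2019, §3 Step 3] -/
private theorem tall_quasicube_odd_small {p e d n : ℕ} (hp : 1 ≤ p) (hp6 : p ≤ 6)
    (hdp : d ≤ p * (p + 1)) (hn : n = (p + 6 + e) * (p * (p + 1)) + d)
    (hopt : cubicEIP n = p * (p + 1) + (p + 6 + e) * (2 * p + 1) + halfPerim d) : False := by
  classical
  set μ : Multiset ℕ :=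
    Multiset.replicate p ((p + 2) * (p + 3)) + Multiset.replicate e (p * (p + 1)) + {2 * p ^ 2, d}
    with hμ
  have hQpos : 0 < (p + 2) * (p + 3) := by positivity
  have hpQ : p * (p + 1) ≤ (p + 2) * (p + 3) := Nat.mul_le_mul (by omega) (by omega)
  have hρQ : 2 * p ^ 2 ≤ (p + 2) * (p + 3) := by nlinarith
  have hB : (p + 2) * (p + 3) ∈ μ := by
    rw [hμ, Multiset.mem_add, Multiset.mem_add, Multiset.mem_replicate]
    exact Or.inl (Or.inl ⟨by omega, rfl⟩)
  have hμle : ∀ a ∈ μ, a ≤ (p + 2) * (p + 3) := by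
    intro a ha
    rw [hμ, Multiset.mem_add, Multiset.mem_add, Multiset.mem_replicate, Multiset.mem_replicate,
      Multiset.insert_eq_cons, Multiset.mem_cons, Multiset.mem_singleton] at ha
    rcases ha with (⟨-, rfl⟩ | ⟨-, rfl⟩) | rfl | rfl
    · exact le_rfl
    · exact hpQ
    · exact hρQ
    · exact hdp.trans hpQ
  have e1 : (p + 6 + e) * (p * (p + 1)) = p * ((p + 2) * (p + 3)) + 2 * p ^ 2 + e * (p * (p + 1)) := by
    ring
  have hμsum : μ.sum = n := by
    rw [hμ, Multiset.sum_add, Multiset.sum_add, Multiset.sum_replicate, Multiset.sum_replicate,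
      Multiset.insert_eq_cons, Multiset.sum_cons, Multiset.sum_singleton, smul_eq_mul, smul_eq_mul,
      hn, e1]
    ring
  have hsucc : (p + 2) * (p + 3) = (p + 2) * (p + 2 + 1) := by ring
  have hμg : (μ.map halfPerim).sum =
      p * (2 * (p + 2) + 1) + e * (2 * p + 1) + (halfPerim (2 * p ^ 2) + halfPerim d) := by
    rw [hμ, Multiset.map_add, Multiset.map_add, Multiset.sum_add, Multiset.sum_add,
      Multiset.map_replicate, Multiset.map_replicate, Multiset.sum_replicate,
      Multiset.sum_replicate, Multiset.insert_eq_cons, Multiset.map_cons, Multiset.sum_cons,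
      Multiset.map_singleton, Multiset.sum_singleton, smul_eq_mul, smul_eq_mul, hsucc,
      halfPerim_mul_succ (k := p + 2) (by omega), halfPerim_mul_succ (k := p) hp]
  have hcomp := cubicEIP_multisetSum_le' hQpos hB hμle
  rw [hμsum, hμg, hopt] at hcomp
  have i1 : (p + 2) * (p + 3) + p * (2 * (p + 2) + 1) + 4 * p = p * (p + 1) + (p + 6) * (2 * p + 1) := by
    ring
  have i2 : (p + 6 + e) * (2 * p + 1) = (p + 6) * (2 * p + 1) + e * (2 * p + 1) := by ring
  have hkey : 4 * p ≤ halfPerim (2 * p ^ 2) := by omega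
  -- but `⌈2√(2p²)⌉ ≤ 4p − 1`, since `2p² ≤ q(4p − 1) = (2p − 1)·2p`
  have hle : halfPerim (2 * p ^ 2) ≤ 4 * p - 1 := by
    rw [halfPerim_le_iff]
    obtain ⟨a, ha⟩ : ∃ a, p = a + 1 := ⟨p - 1, by omega⟩
    subst ha
    rw [show 4 * (a + 1) - 1 = 2 * (2 * a + 1) + 1 by omega, qsq_two_mul_add_one]
    nlinarith
  omega

/-- Middle pronic cross-sections `7 ≤ p ≤ 18`: a height excess `≥ 9` is never optimal (competitor:
`p + 1` pronic levels `(p+3)(p+4)`, one level `2p² − 10p − 12`, spare levels, top level).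
[cite: MaininiPiovanoSchmidtStefanelli2019, §3 Step 3] -/
private theorem tall_quasicube_odd_mid {p e d n : ℕ} (hp : 7 ≤ p) (hp18 : p ≤ 18)
    (hdp : d ≤ p * (p + 1)) (hn : n = (p + 9 + e) * (p * (p + 1)) + d)
    (hopt : cubicEIP n = p * (p + 1) + (p + 9 + e) * (2 * p + 1) + halfPerim d) : False := by
  classical
  have h10 : 10 * p + 12 ≤ 2 * p ^ 2 := by nlinarith
  obtain ⟨ρ₀, hρ₀⟩ : ∃ ρ₀, ρ₀ + (10 * p + 12) = 2 * p ^ 2 := ⟨2 * p ^ 2 - (10 * p + 12), by omega⟩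
  set μ : Multiset ℕ :=
    Multiset.replicate (p + 1) ((p + 3) * (p + 4)) + Multiset.replicate e (p * (p + 1)) + {ρ₀, d}
    with hμ
  have hQpos : 0 < (p + 3) * (p + 4) := by positivity
  have hpQ : p * (p + 1) ≤ (p + 3) * (p + 4) := Nat.mul_le_mul (by omega) (by omega)
  have hρQ : ρ₀ ≤ (p + 3) * (p + 4) := by nlinarith
  have hB : (p + 3) * (p + 4) ∈ μ := by
    rw [hμ, Multiset.mem_add, Multiset.mem_add, Multiset.mem_replicate]
    exact Or.inl (Or.inl ⟨by omega, rfl⟩)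
  have hμle : ∀ a ∈ μ, a ≤ (p + 3) * (p + 4) := by
    intro a ha
    rw [hμ, Multiset.mem_add, Multiset.mem_add, Multiset.mem_replicate, Multiset.mem_replicate,
      Multiset.insert_eq_cons, Multiset.mem_cons, Multiset.mem_singleton] at ha
    rcases ha with (⟨-, rfl⟩ | ⟨-, rfl⟩) | rfl | rfl
    · exact le_rfl
    · exact hpQ
    · exact hρQ
    · exact hdp.trans hpQ
  have e1 : (p + 9 + e) * (p * (p + 1)) + (10 * p + 12) =
      (p + 1) * ((p + 3) * (p + 4)) + 2 * p ^ 2 + e * (p * (p + 1)) := by ring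
  have hμsum : μ.sum = n := by
    rw [hμ, Multiset.sum_add, Multiset.sum_add, Multiset.sum_replicate, Multiset.sum_replicate,
      Multiset.insert_eq_cons, Multiset.sum_cons, Multiset.sum_singleton, smul_eq_mul, smul_eq_mul,
      hn]
    omega
  have hsucc : (p + 3) * (p + 4) = (p + 3) * (p + 3 + 1) := by ring
  have hμg : (μ.map halfPerim).sum =
      (p + 1) * (2 * (p + 3) + 1) + e * (2 * p + 1) + (halfPerim ρ₀ + halfPerim d) := by
    rw [hμ, Multiset.map_add, Multiset.map_add, Multiset.sum_add, Multiset.sum_add,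
      Multiset.map_replicate, Multiset.map_replicate, Multiset.sum_replicate,
      Multiset.sum_replicate, Multiset.insert_eq_cons, Multiset.map_cons, Multiset.sum_cons,
      Multiset.map_singleton, Multiset.sum_singleton, smul_eq_mul, smul_eq_mul, hsucc,
      halfPerim_mul_succ (k := p + 3) (by omega), halfPerim_mul_succ (k := p) (by omega)]
  have hcomp := cubicEIP_multisetSum_le' hQpos hB hμle
  rw [hμsum, hμg, hopt] at hcomp
  have i1 : (p + 3) * (p + 4) + (p + 1) * (2 * (p + 3) + 1) + 4 * p =
      p * (p + 1) + (p + 9) * (2 * p + 1) + 10 := by ring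
  have i2 : (p + 9 + e) * (2 * p + 1) = (p + 9) * (2 * p + 1) + e * (2 * p + 1) := by ring
  have hkey : 4 * p ≤ 10 + halfPerim ρ₀ := by omega
  -- but `⌈2√ρ₀⌉ ≤ 4p − 11`, since `2p² − 10p − 12 ≤ q(4p − 11) = (2p − 6)(2p − 5)`
  have hle : halfPerim ρ₀ ≤ 4 * p - 11 := by
    rw [halfPerim_le_iff]
    obtain ⟨a, ha⟩ : ∃ a, p = a + 3 := ⟨p - 3, by omega⟩
    subst ha
    rw [show 4 * (a + 3) - 11 = 2 * (2 * a) + 1 by omega, qsq_two_mul_add_one]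
    nlinarith
  omega

/-- **The arithmetic of [MPSS19] §3 Step 3 for pronic-based pure boxes, complete**: if the profile
"`c − 1` levels of `p(p+1)` plus a top level `d ≤ p(p+1)`" is optimal, its height excess
`h = c − 1 − p` satisfies `h⁴ ≤ 5000·p`.  This is the case "`M_s = q(σ)`, `σ` odd, no top-class
levels" of the hypothesis of `MaininiPiovanoSchmidtStefanelli2019_thm11_of_quasicube_bound`.
[cite: MaininiPiovanoSchmidtStefanelli2019, §3 Steps 3–4] -/
theorem pureBox_pronic_height_pow_four_le {p c d n : ℕ} (hp : 1 ≤ p) (hdp : d ≤ p * (p + 1))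
    (hn : n = (c - 1) * (p * (p + 1)) + d)
    (hopt : cubicEIP n = p * (p + 1) + (c - 1) * (2 * p + 1) + halfPerim d) :
    (c - 1 - p) ^ 4 ≤ 5000 * p := by
  rcases Nat.lt_or_ge (c - 1) p with hlt | hge
  · rw [show c - 1 - p = 0 by omega]; simp
  obtain ⟨h, hh⟩ : ∃ h, c - 1 = p + h := ⟨c - 1 - p, by omega⟩
  rw [show c - 1 - p = h by omega]
  rw [hh] at hn hopt
  have use : ∀ k : ℕ, 1 ≤ k → 3 * k ≤ h →
      3 * p * k ^ 2 + k ^ 3 + k ^ 2 ≤ (p + k) * (p + k + 1) + p * k →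
      9 * k ^ 4 + 9 * k ^ 2 ≤ 4 * p + 14 * k ^ 3 + 4 * k := by
    intro k hk1 hkh hadm
    obtain ⟨e, he⟩ : ∃ e, h = 3 * k + e := ⟨h - 3 * k, by omega⟩
    refine tall_quasicube_odd (n := n) (e := e) hp hk1 hdp hadm ?_ ?_
    · rw [hn, he, add_assoc]
    · rw [hopt, he, ← add_assoc p]
  by_cases h8 : h ≤ 8
  · calc h ^ 4 ≤ 8 ^ 4 := Nat.pow_le_pow_left h8 4
      _ ≤ 5000 * p := by omega
  push Not at h8
  rcases Nat.lt_or_ge p 7 with hp7 | hp7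
  · exfalso
    obtain ⟨e, he⟩ : ∃ e, h = 6 + e := ⟨h - 6, by omega⟩
    refine tall_quasicube_odd_small (n := n) (e := e) hp (by omega) hdp ?_ ?_
    · rw [hn, he, add_assoc]
    · rw [hopt, he, ← add_assoc p]
  rcases Nat.lt_or_ge p 19 with hp19 | hp19
  · exfalso
    obtain ⟨e, he⟩ : ∃ e, h = 9 + e := ⟨h - 9, by omega⟩
    refine tall_quasicube_odd_mid (n := n) (e := e) hp7 (by omega) hdp ?_ ?_
    · rw [hn, he, add_assoc]
    · rw [hopt, he, ← add_assoc p]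
  rcases Nat.lt_or_ge p 105 with hp105 | hp105
  · -- `19 ≤ p ≤ 104`: `k = 3`
    exfalso
    have := use 3 (by norm_num) (by omega) (by nlinarith)
    omega
  -- `p ≥ 105`: `k = min (h/3) ⌊√(p/3)⌋`
  set k₁ := Nat.sqrt (p / 3) with hk₁
  have hk₁sq : k₁ ^ 2 ≤ p / 3 := Nat.sqrt_le' _
  have hk₁lt : p / 3 < (k₁ + 1) ^ 2 := Nat.lt_succ_sqrt' _
  have hk₁5 : 5 ≤ k₁ := by rw [hk₁]; apply Nat.le_sqrt.2; omega
  have hp3 : p / 3 ≤ p := Nat.div_le_self _ _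
  have adm : ∀ k, 1 ≤ k → k ≤ k₁ →
      3 * p * k ^ 2 + k ^ 3 + k ^ 2 ≤ (p + k) * (p + k + 1) + p * k := by
    intro k hk1 hkk
    have hk2 : k ^ 2 ≤ p / 3 := (Nat.pow_le_pow_left hkk 2).trans hk₁sq
    have h3 : 3 * k ^ 2 ≤ p := by omega
    have h4 : k ^ 3 ≤ 2 * p * k := by
      calc k ^ 3 = k ^ 2 * k := by ring
        _ ≤ (2 * p) * k := Nat.mul_le_mul_right k (by omega)
        _ = 2 * p * k := by ring
    nlinarith
  rcases Nat.lt_or_ge (h / 3) (k₁ + 1) with hsmall | hbig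
  · set k := h / 3 with hk
    have hk1 : 1 ≤ k := by omega
    have hb := use k hk1 (by omega) (adm k hk1 (by omega))
    have hkk : k ≤ k ^ 2 := by nlinarith
    have hkp : k ≤ p := by
      have : k ^ 2 ≤ p / 3 := (Nat.pow_le_pow_left (show k ≤ k₁ by omega) 2).trans hk₁sq
      omega
    -- `k⁴ ≤ 4p`: for `k ≥ 2`, `14k³ ≤ 7k⁴`; for `k = 1` trivially
    have hk4 : k ^ 4 ≤ 4 * p := by
      rcases Nat.lt_or_ge k 2 with hk2 | hk2
      · have hk1' : k = 1 := by omega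
        rw [hk1']; omega
      · have : k ^ 3 * 2 ≤ k ^ 3 * k := Nat.mul_le_mul_left _ hk2
        have h34 : 14 * k ^ 3 ≤ 7 * k ^ 4 := by nlinarith
        omega
    have hh5 : h ≤ 5 * k := by omega
    calc h ^ 4 ≤ (5 * k) ^ 4 := Nat.pow_le_pow_left hh5 4
      _ = 625 * k ^ 4 := by ring
      _ ≤ 5000 * p := by omega
  · exfalso
    have hb := use k₁ (by omega) (by omega) (adm k₁ (by omega) le_rfl)
    have i2 : 5 * k₁ ≤ k₁ ^ 2 := by nlinarith
    have i3 : 5 * k₁ ^ 2 ≤ k₁ ^ 3 := by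
      have : k₁ ^ 2 * 5 ≤ k₁ ^ 2 * k₁ := Nat.mul_le_mul_left _ hk₁5
      nlinarith
    have i4 : 5 * k₁ ^ 3 ≤ k₁ ^ 4 := by
      have : k₁ ^ 3 * 5 ≤ k₁ ^ 3 * k₁ := Nat.mul_le_mul_left _ hk₁5
      nlinarith
    have isq : (k₁ + 1) ^ 2 = k₁ ^ 2 + 2 * k₁ + 1 := by ring
    have hp' : p < 3 * k₁ ^ 2 + 6 * k₁ + 6 := by omega
    omega

/-- **[MPSS19] Theorem 1.1 reduced to the side-face case.**  The quasicube arithmetic demanded by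
`MaininiPiovanoSchmidtStefanelli2019_thm11_of_quasicube_bound` holds whenever the projection
`M_s` is a quasi-square (`pureBox_sq_height_pow_four_le`, `pureBox_pronic_height_pow_four_le`:
then there are no top-class levels); hence the vendored fact follows from the remaining case
`q(σ) < M_s < q(σ+1)` alone — the configurations with a side face `F²` of [MPSS19] §3 Step 2.
[cite: MaininiPiovanoSchmidtStefanelli2019, §3 Steps 2–5] -/
theorem MaininiPiovanoSchmidtStefanelli2019_thm11_of_sideFace_bound
    (hA : ∃ K : ℕ, ∀ n c M σ u d : ℕ, 2 ≤ σ → qsq σ < M → M < qsq (σ + 1) → u + 1 ≤ c →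
      1 ≤ d → d ≤ M → cubicEIP n = M + (c - 1) * σ + u + halfPerim d →
      (c - 1) * qsq σ + u + d ≤ n → n ≤ (c - 1) * qsq σ + u * (M - qsq σ) + d →
      (c - 1 - σ / 2) ^ 4 ≤ K * (σ + 1)) :
    MaininiPiovanoSchmidtStefanelli2019_thm11 := by
  obtain ⟨K, hK⟩ := hA
  refine MaininiPiovanoSchmidtStefanelli2019_thm11_of_quasicube_bound ⟨max K 5000, ?_⟩
  intro n c M σ u d hσ2 hQM hMQ huc hd1 hdM hopt hlo hhi
  rcases hQM.lt_or_eq with hlt | heq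
  · exact (hK n c M σ u d hσ2 hlt hMQ huc hd1 hdM hopt hlo hhi).trans
      (Nat.mul_le_mul_right _ (le_max_left _ _))
  · -- `M = q(σ)`: a pure box, `u = 0`, `n = (c-1) q(σ) + d`
    subst heq
    rw [Nat.sub_self, mul_zero, add_zero] at hhi
    have hu : u = 0 := by omega
    subst hu
    have hn : n = (c - 1) * qsq σ + d := by omega
    rw [add_zero] at hopt
    have h5000 : 5000 * (σ / 2) ≤ max K 5000 * (σ + 1) :=
      (Nat.mul_le_mul_right _ (le_max_right _ _)).trans' (Nat.mul_le_mul_left _ (by omega))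
    obtain ⟨p, hp | hp⟩ := Nat.even_or_odd' σ
    · -- `σ = 2p`, `q(σ) = p²`
      subst hp
      have hp1 : 1 ≤ p := by omega
      rw [qsq_two_mul] at hn hopt hdM
      have h := pureBox_sq_height_pow_four_le hp1 hdM hn
        (by rw [hopt, pow_two])
      rw [show 2 * p / 2 = p by omega] at h5000 ⊢
      exact h.trans h5000
    · -- `σ = 2p + 1`, `q(σ) = p(p+1)`
      subst hp
      have hp1 : 1 ≤ p := by omega
      rw [qsq_two_mul_add_one] at hn hopt hdM
      have h := pureBox_pronic_height_pow_four_le hp1 hdM hn hopt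
      rw [show (2 * p + 1) / 2 = p by omega] at h5000 ⊢
      exact h.trans h5000

end StepThree

/-! ### Towards the side face: alignment of the top-class levels ([MPSS19] §3 Step 2) -/

section SideFace

variable {μ : Multiset ℕ} {B : ℕ}

/-- **No two top-class levels fit, together with a quasi-square, under the maximum**: in an optimal
multiset with maximum `B`, `q(σ) ≤ B < q(σ+1)`, `σ ≥ 2`, any two levels `x, y > q(σ)` (counted with
multiplicity) satisfy `x + y > B + q(σ)` — otherwise replacing them by `q(σ)` and `x + y − q(σ) ≤ B`
saves one unit of half-perimeter.  (In [MPSS19] this is the alignment of the side strip `F²` into a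
rectangle `R(e, s'')` by removing 3-vacancies: all but one of the top-class levels carry more than
half of the maximal surplus.) [cite: MaininiPiovanoSchmidtStefanelli2019, Definition 2.2 (ii)–(iii) and §3 Step 2] -/
theorem IsOptimalLevels.topClass_add_gt (h : IsOptimalLevels μ B) {σ x y : ℕ} (hσ2 : 2 ≤ σ)
    (hQB : qsq σ ≤ B) (hBQ : B < qsq (σ + 1)) (hx : x ∈ μ) (hy : y ∈ μ.erase x)
    (hQx : qsq σ < x) (hQy : qsq σ < y) : B + qsq σ < x + y := by
  classical
  by_contra hle
  push Not at hle
  set Q := qsq σ with hQ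
  have hxB : x ≤ B := h.le x hx
  have hyB : y ≤ B := h.le y (Multiset.mem_of_mem_erase hy)
  have hxltB : x < B := by omega
  have hyltB : y < B := by omega
  set ρ := (μ.erase x).erase y with hρ
  have hμ : μ = x ::ₘ y ::ₘ ρ := by
    rw [hρ, Multiset.cons_erase hy, Multiset.cons_erase hx]
  set z := x + y - Q with hz
  set μ' := Q ::ₘ z ::ₘ ρ with hμ'
  have hQ1 : 1 ≤ Q := by
    rw [hQ]
    obtain ⟨τ, hτ⟩ : ∃ τ, σ = τ + 2 := ⟨σ - 2, by omega⟩
    rw [hτ, show τ + 2 = (τ + 1) + 1 by ring, qsq_succ]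
    omega
  have hz1 : Q < z := by omega
  have hzB : z ≤ B := by omega
  have hBρ : B ∈ ρ := by
    rw [hρ, Multiset.mem_erase_of_ne (by omega : B ≠ y), Multiset.mem_erase_of_ne (by omega : B ≠ x)]
    exact h.mem
  have hpos' : ∀ a ∈ μ', 0 < a := by
    intro a ha
    rw [hμ', Multiset.mem_cons, Multiset.mem_cons] at ha
    rcases ha with rfl | rfl | ha
    · omega
    · omega
    · exact h.pos a (Multiset.mem_of_mem_erase (Multiset.mem_of_mem_erase ha))
  have hle' : ∀ a ∈ μ', a ≤ B := by
    intro a ha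
    rw [hμ', Multiset.mem_cons, Multiset.mem_cons] at ha
    rcases ha with rfl | rfl | ha
    · exact hQB
    · exact hzB
    · exact h.le a (Multiset.mem_of_mem_erase (Multiset.mem_of_mem_erase ha))
  have hcomp := cubicEIP_multisetSum_le hpos' (Multiset.mem_cons_of_mem (Multiset.mem_cons_of_mem hBρ))
    hle'
  have hsum : μ'.sum = μ.sum := by
    rw [hμ', hμ, Multiset.sum_cons, Multiset.sum_cons, Multiset.sum_cons, Multiset.sum_cons, hz]
    omega
  -- the planar costs: `g(x) = g(y) = σ + 1`, `g(Q) = σ`, `g(z) ≤ σ + 1`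
  have hgx : halfPerim x = σ + 1 := halfPerim_eq_of (by omega) (hxB.trans hBQ.le) (by simpa using hQx)
  have hgy : halfPerim y = σ + 1 := halfPerim_eq_of (by omega) (hyB.trans hBQ.le) (by simpa using hQy)
  have hgQ : halfPerim Q = σ := by
    rw [hQ]
    refine halfPerim_eq_of (by omega) le_rfl ?_
    obtain ⟨τ, hτ⟩ : ∃ τ, σ = τ + 1 := ⟨σ - 1, by omega⟩
    rw [hτ, Nat.add_sub_cancel, qsq_succ]
    omega
  have hgz : halfPerim z ≤ σ + 1 := halfPerim_le_iff.2 (hzB.trans hBQ.le)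
  have hmap : (μ'.map halfPerim).sum + 1 ≤ (μ.map halfPerim).sum := by
    rw [hμ', hμ, Multiset.map_cons, Multiset.map_cons, Multiset.map_cons, Multiset.map_cons,
      Multiset.sum_cons, Multiset.sum_cons, Multiset.sum_cons, Multiset.sum_cons, hgx, hgy, hgQ]
    omega
  have hcost := h.cost
  rw [hsum] at hcomp
  omega

/-- `cubicEIP_multisetSum_le'` with `B` only an UPPER BOUND for the levels.
[cite: MaininiPiovanoSchmidtStefanelli2019, §2.2] -/
theorem cubicEIP_multisetSum_le_of_le {μ : Multiset ℕ} {B : ℕ}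
    (hle : ∀ a ∈ μ, a ≤ B) : cubicEIP μ.sum ≤ B + (μ.map halfPerim).sum := by
  classical
  by_cases hμ : μ.toFinset.Nonempty
  · obtain ⟨B₀, hB₀, hmax⟩ := Finset.exists_max_image μ.toFinset id hμ
    rw [Multiset.mem_toFinset] at hB₀
    have hmax' : ∀ a ∈ μ, a ≤ B₀ := fun a ha => hmax a (Multiset.mem_toFinset.2 ha)
    rcases Nat.eq_zero_or_pos B₀ with h0 | hpos
    · -- all levels are `0`
      have hall : ∀ a ∈ μ, a = 0 := fun a ha => by have := hmax' a ha; omega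
      rw [Multiset.sum_eq_zero hall, cubicEIP_zero]; exact Nat.zero_le _
    · exact (cubicEIP_multisetSum_le' hpos hB₀ hmax').trans
        (Nat.add_le_add_right (hle B₀ hB₀) _)
  · rw [Finset.not_nonempty_iff_eq_empty, Multiset.toFinset_eq_empty] at hμ
    subst hμ
    simp [cubicEIP_zero]

/-- The arithmetic tail of Step 3 (square case): from `2(p+k) ≤ 3k² + ⌈2√ρ₀⌉` with
`ρ₀ = (p+k)² − 3k²p − k³` to `9k⁴ + 6k² < 4p + 8k³ + 4k`.
[cite: MaininiPiovanoSchmidtStefanelli2019, §3 Step 3] -/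
private theorem stepThree_tail {p k ρ₀ : ℕ} (hp : 1 ≤ p) (hk : 1 ≤ k)
    (hkp : 3 * k ^ 2 * p + k ^ 3 ≤ (p + k) ^ 2) (hρ₀ : ρ₀ + (3 * k ^ 2 * p + k ^ 3) = (p + k) ^ 2)
    (hkey : 2 * (p + k) ≤ 3 * k ^ 2 + halfPerim ρ₀) :
    9 * k ^ 4 + 6 * k ^ 2 < 4 * p + 8 * k ^ 3 + 4 * k := by
  rcases Nat.lt_or_ge (3 * k ^ 2 + 1) (2 * (p + k)) with hcase | hcase
  · obtain ⟨t, ht⟩ : ∃ t, 2 * (p + k) = t + 3 * k ^ 2 + 1 := ⟨2 * (p + k) - 3 * k ^ 2 - 1, by omega⟩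
    have hlt : qsq t < ρ₀ := qsq_lt_of_lt_halfPerim (by omega)
    have hq := sq_le_four_mul_qsq_add_one t
    have h4 : t ^ 2 < 4 * ρ₀ + 1 := by omega
    have htZ : (t : ℤ) = 2 * ((p : ℤ) + k) - 3 * (k : ℤ) ^ 2 - 1 := by
      have h := congrArg (Nat.cast : ℕ → ℤ) ht
      push_cast at h
      linarith
    have h4Z : (t : ℤ) ^ 2 < 4 * (ρ₀ : ℤ) + 1 := by exact_mod_cast h4
    have hρZ : (ρ₀ : ℤ) + (3 * (k : ℤ) ^ 2 * p + (k : ℤ) ^ 3) = ((p : ℤ) + k) ^ 2 := by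
      exact_mod_cast hρ₀
    have ht2 : (t : ℤ) ^ 2 = (2 * ((p : ℤ) + k) - 3 * (k : ℤ) ^ 2 - 1) ^ 2 := by rw [htZ]
    have goalZ : 9 * (k : ℤ) ^ 4 + 6 * (k : ℤ) ^ 2 < 4 * p + 8 * (k : ℤ) ^ 3 + 4 * k := by
      nlinarith [ht2, h4Z, hρZ]
    exact_mod_cast goalZ
  · rcases Nat.lt_or_ge k 2 with hk1 | hk2
    · have hk1' : k = 1 := by omega
      subst hk1'
      have hp1 : p = 1 := by omega
      subst hp1
      norm_num
    · exact (stepThree_degenerate hk2 hcase hkp).elim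

/-- **Step 3 with a hosted side face (CASE I of the side-face analysis).**  As `tall_quasicube`, but
the tall profile carries a side strip: its cost identity has the extra `θ + u` of a projection
`M = p² + θ` (`1 ≤ θ ≤ p`) with `u` top-class levels, and its volume the surplus `S = Σ sⱼ` of at
most `u` rows `1 ≤ sⱼ ≤ θ`.  Hosting the rows on the competitor's big levels (`s₁`, at most
`p + k − 1` of them) and spare levels (`s₂`, at most `e`) costs the competitor exactly one unit per
row plus `θ` for the maximum, so the fourth-order inequality is unchanged:
`9k⁴ + 6k² < 4p + 8k³ + 4k`. [cite: MaininiPiovanoSchmidtStefanelli2019, §3 Steps 2–3] -/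
theorem tall_quasicube_hosted {p k e d n θ u : ℕ} {s₁ s₂ : Multiset ℕ} (hp : 1 ≤ p) (hk : 1 ≤ k)
    (hdp : d ≤ p ^ 2) (hkp : 3 * k ^ 2 * p + k ^ 3 ≤ (p + k) ^ 2) (hθ1 : 1 ≤ θ) (hθp : θ ≤ p)
    (hs₁ : ∀ t ∈ s₁, 1 ≤ t ∧ t ≤ θ) (hs₂ : ∀ t ∈ s₂, 1 ≤ t ∧ t ≤ θ)
    (hc₁ : Multiset.card s₁ ≤ p + k - 1) (hc₂ : Multiset.card s₂ ≤ e)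
    (hu : Multiset.card s₁ + Multiset.card s₂ ≤ u)
    (hn : n = (p + 3 * k + e) * p ^ 2 + (s₁.sum + s₂.sum) + d)
    (hopt : cubicEIP n = (p ^ 2 + θ) + (p + 3 * k + e) * (2 * p) + u + halfPerim d) :
    9 * k ^ 4 + 6 * k ^ 2 < 4 * p + 8 * k ^ 3 + 4 * k := by
  classical
  -- planar costs: hosted big level `σ' + 1`, hosted spare level `σ + 1`
  have hostcost : ∀ q t : ℕ, 1 ≤ q → 1 ≤ t → t ≤ q → halfPerim (q ^ 2 + t) = 2 * q + 1 := by
    intro q t hq ht htq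
    have e : q * (q + 1) = q ^ 2 + q := by ring
    refine halfPerim_eq_of (Nat.le_add_left 1 _) ?_ ?_
    · rw [qsq_two_mul_add_one]; omega
    · rw [Nat.add_sub_cancel, qsq_two_mul]; omega
  have hg₁ : ∀ t ∈ s₁, halfPerim ((p + k) ^ 2 + t) = 2 * (p + k) + 1 := fun t ht =>
    hostcost (p + k) t (by omega) (hs₁ t ht).1 ((hs₁ t ht).2.trans (by omega))
  have hg₂ : ∀ t ∈ s₂, halfPerim (p ^ 2 + t) = 2 * p + 1 := fun t ht =>
    hostcost p t hp (hs₂ t ht).1 ((hs₂ t ht).2.trans hθp)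
  obtain ⟨j, hj⟩ : ∃ j, p + k = j + 1 := ⟨p + k - 1, by omega⟩
  rw [hj, Nat.add_sub_cancel] at hc₁
  obtain ⟨ρ₀, hρ₀⟩ : ∃ ρ₀, ρ₀ + (3 * k ^ 2 * p + k ^ 3) = (p + k) ^ 2 :=
    ⟨(p + k) ^ 2 - (3 * k ^ 2 * p + k ^ 3), Nat.sub_add_cancel hkp⟩
  -- competitor: hosted big levels, plain big levels, hosted spare levels, plain spare levels, `ρ₀`, `d`
  set μ : Multiset ℕ :=
    s₁.map (fun t => (p + k) ^ 2 + t) + Multiset.replicate (j - Multiset.card s₁) ((p + k) ^ 2) +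
    (s₂.map (fun t => p ^ 2 + t) + Multiset.replicate (e - Multiset.card s₂) (p ^ 2)) + {ρ₀, d}
    with hμ
  have hpQ : p ^ 2 ≤ (p + k) ^ 2 := Nat.pow_le_pow_left (by omega) 2
  have hμle : ∀ a ∈ μ, a ≤ (p + k) ^ 2 + θ := by
    intro a ha
    simp only [hμ, Multiset.mem_add, Multiset.mem_map, Multiset.mem_replicate,
      Multiset.insert_eq_cons, Multiset.mem_cons, Multiset.mem_singleton] at ha
    rcases ha with ((⟨t, ht, rfl⟩ | ⟨-, rfl⟩) | (⟨t, ht, rfl⟩ | ⟨-, rfl⟩)) | rfl | rfl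
    · have := (hs₁ t ht).2; omega
    · omega
    · have := (hs₂ t ht).2; omega
    · omega
    · omega
    · omega
  -- volume
  have e1 : (p + 3 * k) * p ^ 2 + (3 * k ^ 2 * p + k ^ 3) = (p + k) ^ 3 := by ring
  have e2 : (p + k) ^ 3 = j * (p + k) ^ 2 + (p + k) ^ 2 := by rw [hj]; ring
  have e3 : (p + 3 * k + e) * p ^ 2 = (p + 3 * k) * p ^ 2 + e * p ^ 2 := by ring
  have hsum₁ : (s₁.map (fun t => (p + k) ^ 2 + t)).sum = Multiset.card s₁ * (p + k) ^ 2 + s₁.sum := by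
    rw [Multiset.sum_map_add, Multiset.map_const', Multiset.sum_replicate, Multiset.map_id',
      smul_eq_mul]
  have hsum₂ : (s₂.map (fun t => p ^ 2 + t)).sum = Multiset.card s₂ * p ^ 2 + s₂.sum := by
    rw [Multiset.sum_map_add, Multiset.map_const', Multiset.sum_replicate, Multiset.map_id',
      smul_eq_mul]
  have ej : (j - Multiset.card s₁) * (p + k) ^ 2 + Multiset.card s₁ * (p + k) ^ 2 = j * (p + k) ^ 2 := by
    rw [← Nat.add_mul, Nat.sub_add_cancel hc₁]
  have ee : (e - Multiset.card s₂) * p ^ 2 + Multiset.card s₂ * p ^ 2 = e * p ^ 2 := by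
    rw [← Nat.add_mul, Nat.sub_add_cancel hc₂]
  have hμsum : μ.sum = n := by
    rw [hμ, Multiset.sum_add, Multiset.sum_add, Multiset.sum_add, Multiset.sum_add, hsum₁, hsum₂,
      Multiset.sum_replicate, Multiset.sum_replicate, Multiset.insert_eq_cons, Multiset.sum_cons,
      Multiset.sum_singleton, smul_eq_mul, smul_eq_mul, hn]
    omega
  have hc₁' : s₁.map (fun t => halfPerim ((p + k) ^ 2 + t)) = s₁.map (fun _ => 2 * (p + k) + 1) :=
    Multiset.map_congr rfl hg₁
  have hc₂' : s₂.map (fun t => halfPerim (p ^ 2 + t)) = s₂.map (fun _ => 2 * p + 1) :=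
    Multiset.map_congr rfl hg₂
  have hmap₁ : ((s₁.map (fun t => (p + k) ^ 2 + t)).map halfPerim).sum =
      Multiset.card s₁ * (2 * (p + k) + 1) := by
    rw [Multiset.map_map, Function.comp_def, hc₁', Multiset.map_const', Multiset.sum_replicate,
      smul_eq_mul]
  have hmap₂ : ((s₂.map (fun t => p ^ 2 + t)).map halfPerim).sum =
      Multiset.card s₂ * (2 * p + 1) := by
    rw [Multiset.map_map, Function.comp_def, hc₂', Multiset.map_const', Multiset.sum_replicate,
      smul_eq_mul]
  have hμg : (μ.map halfPerim).sum =
      Multiset.card s₁ * (2 * (p + k) + 1) + (j - Multiset.card s₁) * (2 * (p + k)) +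
      (Multiset.card s₂ * (2 * p + 1) + (e - Multiset.card s₂) * (2 * p)) +
      (halfPerim ρ₀ + halfPerim d) := by
    rw [hμ, Multiset.map_add, Multiset.map_add, Multiset.map_add, Multiset.map_add,
      Multiset.sum_add, Multiset.sum_add, Multiset.sum_add, Multiset.sum_add, hmap₁, hmap₂,
      Multiset.map_replicate, Multiset.map_replicate, Multiset.sum_replicate,
      Multiset.sum_replicate, Multiset.insert_eq_cons, Multiset.map_cons, Multiset.sum_cons,
      Multiset.map_singleton, Multiset.sum_singleton, smul_eq_mul, smul_eq_mul,
      halfPerim_sq (k := p + k) (by omega), halfPerim_sq (k := p) hp]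
  have hcomp := cubicEIP_multisetSum_le_of_le (B := (p + k) ^ 2 + θ) hμle
  rw [hμsum, hμg, hopt] at hcomp
  -- bookkeeping: the hosted rows cost `card s₁ + card s₂ ≤ u`, the maximum `θ`; the rest is Step 3
  have ej' : (j - Multiset.card s₁) * (2 * (p + k)) + Multiset.card s₁ * (2 * (p + k)) =
      j * (2 * (p + k)) := by rw [← Nat.add_mul, Nat.sub_add_cancel hc₁]
  have ee' : (e - Multiset.card s₂) * (2 * p) + Multiset.card s₂ * (2 * p) = e * (2 * p) := by
    rw [← Nat.add_mul, Nat.sub_add_cancel hc₂]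
  have ec₁ : Multiset.card s₁ * (2 * (p + k) + 1) = Multiset.card s₁ * (2 * (p + k)) + Multiset.card s₁ := by
    ring
  have ec₂ : Multiset.card s₂ * (2 * p + 1) = Multiset.card s₂ * (2 * p) + Multiset.card s₂ := by
    ring
  have i1 : j * (2 * (p + k)) + 2 * (p + k) = 2 * (p + k) ^ 2 := by rw [hj]; ring
  have i2 : (p + k) ^ 2 = p ^ 2 + 2 * (p * k) + k ^ 2 := by ring
  have i3 : (p + 3 * k + e) * (2 * p) = 2 * p ^ 2 + 6 * (p * k) + e * (2 * p) := by ring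
  have hkey : 2 * (p + k) ≤ 3 * k ^ 2 + halfPerim ρ₀ := by omega
  exact stepThree_tail hp hk hkp hρ₀ hkey

/-- The arithmetic tail of Step 3 (pronic case). [cite: MaininiPiovanoSchmidtStefanelli2019, §3 Step 3] -/
private theorem stepThree_tail_odd {p k ρ₀ : ℕ} (hp : 1 ≤ p) (hk : 1 ≤ k)
    (hkp : 3 * p * k ^ 2 + k ^ 3 + k ^ 2 ≤ (p + k) * (p + k + 1) + p * k)
    (hρ₀ : ρ₀ + (3 * p * k ^ 2 + k ^ 3 + k ^ 2) = (p + k) * (p + k + 1) + p * k)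
    (hkey : 2 * p + 3 * k + 1 ≤ 3 * k ^ 2 + halfPerim ρ₀) :
    9 * k ^ 4 + 9 * k ^ 2 ≤ 4 * p + 14 * k ^ 3 + 4 * k := by
  rcases Nat.lt_or_ge (3 * k ^ 2) (2 * p + 3 * k + 1) with hcase | hcase
  · obtain ⟨t, ht⟩ : ∃ t, 2 * p + 3 * k = t + 3 * k ^ 2 := ⟨2 * p + 3 * k - 3 * k ^ 2, by omega⟩
    have hlt : qsq t < ρ₀ := qsq_lt_of_lt_halfPerim (by omega)
    have hq := sq_le_four_mul_qsq_add_one t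
    have h4 : t ^ 2 < 4 * ρ₀ + 1 := by omega
    have htZ : (t : ℤ) = 2 * (p : ℤ) + 3 * k - 3 * (k : ℤ) ^ 2 := by
      have h := congrArg (Nat.cast : ℕ → ℤ) ht
      push_cast at h
      linarith
    have h4Z : (t : ℤ) ^ 2 < 4 * (ρ₀ : ℤ) + 1 := by exact_mod_cast h4
    have hρZ : (ρ₀ : ℤ) + (3 * (p : ℤ) * (k : ℤ) ^ 2 + (k : ℤ) ^ 3 + (k : ℤ) ^ 2) =
        ((p : ℤ) + k) * ((p : ℤ) + k + 1) + p * k := by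
      exact_mod_cast hρ₀
    have ht2 : (t : ℤ) ^ 2 = 4 * (p : ℤ) ^ 2 + 9 * (k : ℤ) ^ 2 + 9 * (k : ℤ) ^ 4
        + 12 * ((p : ℤ) * k) - 12 * ((p : ℤ) * (k : ℤ) ^ 2) - 18 * (k : ℤ) ^ 3 := by
      rw [htZ]; ring
    have hρZ' : 4 * (ρ₀ : ℤ) = 4 * (p : ℤ) ^ 2 + 12 * ((p : ℤ) * k) + 4 * p + 4 * k
        - 12 * ((p : ℤ) * (k : ℤ) ^ 2) - 4 * (k : ℤ) ^ 3 := by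
      linear_combination 4 * hρZ
    have goalZ : 9 * (k : ℤ) ^ 4 + 9 * (k : ℤ) ^ 2 ≤ 4 * p + 14 * (k : ℤ) ^ 3 + 4 * k := by
      linarith [ht2, hρZ', h4Z]
    exact_mod_cast goalZ
  · exact (stepThree_degenerate_odd hp hk hcase hkp).elim

/-- **Step 3 with a hosted side face, pronic cross-section** (CASE I, `σ` odd): as
`tall_quasicube_odd` with a projection `M = p(p+1) + θ` (`θ ≤ p`), `u` top-class levels and a
surplus of at most `u` rows `sⱼ ≤ θ` hosted on the competitor's big and spare levels.
[cite: MaininiPiovanoSchmidtStefanelli2019, §3 Steps 2–3] -/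
theorem tall_quasicube_odd_hosted {p k e d n θ u : ℕ} {s₁ s₂ : Multiset ℕ} (hp : 1 ≤ p)
    (hk : 1 ≤ k) (hdp : d ≤ p * (p + 1))
    (hkp : 3 * p * k ^ 2 + k ^ 3 + k ^ 2 ≤ (p + k) * (p + k + 1) + p * k) (hθp : θ ≤ p)
    (hs₁ : ∀ t ∈ s₁, 1 ≤ t ∧ t ≤ θ) (hs₂ : ∀ t ∈ s₂, 1 ≤ t ∧ t ≤ θ)
    (hc₁ : Multiset.card s₁ ≤ p + k - 1) (hc₂ : Multiset.card s₂ ≤ e)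
    (hu : Multiset.card s₁ + Multiset.card s₂ ≤ u)
    (hn : n = (p + 3 * k + e) * (p * (p + 1)) + (s₁.sum + s₂.sum) + d)
    (hopt : cubicEIP n = (p * (p + 1) + θ) + (p + 3 * k + e) * (2 * p + 1) + u + halfPerim d) :
    9 * k ^ 4 + 9 * k ^ 2 ≤ 4 * p + 14 * k ^ 3 + 4 * k := by
  classical
  have hostcost : ∀ q t : ℕ, 1 ≤ q → 1 ≤ t → t ≤ q + 1 →
      halfPerim (q * (q + 1) + t) = 2 * q + 2 := by
    intro q t hq ht htq
    have e : (q + 1) ^ 2 = q * (q + 1) + (q + 1) := by ring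
    refine halfPerim_eq_of (by omega) ?_ ?_
    · rw [show 2 * q + 2 = 2 * (q + 1) by ring, qsq_two_mul]; omega
    · rw [show 2 * q + 2 - 1 = 2 * q + 1 by omega, qsq_two_mul_add_one]; omega
  have hg₁ : ∀ t ∈ s₁, halfPerim ((p + k) * (p + k + 1) + t) = 2 * (p + k) + 2 := fun t ht =>
    hostcost (p + k) t (by omega) (hs₁ t ht).1 ((hs₁ t ht).2.trans (by omega))
  have hg₂ : ∀ t ∈ s₂, halfPerim (p * (p + 1) + t) = 2 * p + 2 := fun t ht =>
    hostcost p t hp (hs₂ t ht).1 ((hs₂ t ht).2.trans (by omega))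
  obtain ⟨j, hj⟩ : ∃ j, p + k = j + 1 := ⟨p + k - 1, by omega⟩
  rw [hj, Nat.add_sub_cancel] at hc₁
  obtain ⟨ρ₀, hρ₀⟩ : ∃ ρ₀, ρ₀ + (3 * p * k ^ 2 + k ^ 3 + k ^ 2) = (p + k) * (p + k + 1) + p * k :=
    ⟨(p + k) * (p + k + 1) + p * k - (3 * p * k ^ 2 + k ^ 3 + k ^ 2), Nat.sub_add_cancel hkp⟩
  set μ : Multiset ℕ :=
    s₁.map (fun t => (p + k) * (p + k + 1) + t) +
      Multiset.replicate (j - Multiset.card s₁) ((p + k) * (p + k + 1)) +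
    (s₂.map (fun t => p * (p + 1) + t) + Multiset.replicate (e - Multiset.card s₂) (p * (p + 1))) +
    {ρ₀, d} with hμ
  have hpQ : p * (p + 1) ≤ (p + k) * (p + k + 1) := Nat.mul_le_mul (by omega) (by omega)
  have hρQ : ρ₀ ≤ (p + k) * (p + k + 1) := by
    have h1 : p * k ≤ p * k ^ 2 := Nat.mul_le_mul_left p (by nlinarith)
    have h2 : 3 * p * k ^ 2 = 3 * (p * k ^ 2) := by ring
    omega
  have hμle : ∀ a ∈ μ, a ≤ (p + k) * (p + k + 1) + θ := by
    intro a ha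
    simp only [hμ, Multiset.mem_add, Multiset.mem_map, Multiset.mem_replicate,
      Multiset.insert_eq_cons, Multiset.mem_cons, Multiset.mem_singleton] at ha
    rcases ha with ((⟨t, ht, rfl⟩ | ⟨-, rfl⟩) | (⟨t, ht, rfl⟩ | ⟨-, rfl⟩)) | rfl | rfl
    · have := (hs₁ t ht).2; omega
    · omega
    · have := (hs₂ t ht).2; omega
    · omega
    · omega
    · exact hdp.trans (by omega)
  have e1 : (p + 3 * k) * (p * (p + 1)) + (3 * p * k ^ 2 + k ^ 3 + k ^ 2) =
      (p + k) * ((p + k) * (p + k + 1)) + p * k := by ring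
  have e2 : (p + k) * ((p + k) * (p + k + 1)) =
      j * ((p + k) * (p + k + 1)) + (p + k) * (p + k + 1) := by rw [hj]; ring
  have e3 : (p + 3 * k + e) * (p * (p + 1)) = (p + 3 * k) * (p * (p + 1)) + e * (p * (p + 1)) := by
    ring
  have hsum₁ : (s₁.map (fun t => (p + k) * (p + k + 1) + t)).sum =
      Multiset.card s₁ * ((p + k) * (p + k + 1)) + s₁.sum := by
    rw [Multiset.sum_map_add, Multiset.map_const', Multiset.sum_replicate, Multiset.map_id',
      smul_eq_mul]
  have hsum₂ : (s₂.map (fun t => p * (p + 1) + t)).sum = Multiset.card s₂ * (p * (p + 1)) + s₂.sum := by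
    rw [Multiset.sum_map_add, Multiset.map_const', Multiset.sum_replicate, Multiset.map_id',
      smul_eq_mul]
  have ej : (j - Multiset.card s₁) * ((p + k) * (p + k + 1)) +
      Multiset.card s₁ * ((p + k) * (p + k + 1)) = j * ((p + k) * (p + k + 1)) := by
    rw [← Nat.add_mul, Nat.sub_add_cancel hc₁]
  have ee : (e - Multiset.card s₂) * (p * (p + 1)) + Multiset.card s₂ * (p * (p + 1)) =
      e * (p * (p + 1)) := by
    rw [← Nat.add_mul, Nat.sub_add_cancel hc₂]
  have hμsum : μ.sum = n := by
    rw [hμ, Multiset.sum_add, Multiset.sum_add, Multiset.sum_add, Multiset.sum_add, hsum₁, hsum₂,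
      Multiset.sum_replicate, Multiset.sum_replicate, Multiset.insert_eq_cons, Multiset.sum_cons,
      Multiset.sum_singleton, smul_eq_mul, smul_eq_mul, hn]
    omega
  have hc₁' : s₁.map (fun t => halfPerim ((p + k) * (p + k + 1) + t)) =
      s₁.map (fun _ => 2 * (p + k) + 2) := Multiset.map_congr rfl hg₁
  have hc₂' : s₂.map (fun t => halfPerim (p * (p + 1) + t)) = s₂.map (fun _ => 2 * p + 2) :=
    Multiset.map_congr rfl hg₂
  have hmap₁ : ((s₁.map (fun t => (p + k) * (p + k + 1) + t)).map halfPerim).sum =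
      Multiset.card s₁ * (2 * (p + k) + 2) := by
    rw [Multiset.map_map, Function.comp_def, hc₁', Multiset.map_const', Multiset.sum_replicate,
      smul_eq_mul]
  have hmap₂ : ((s₂.map (fun t => p * (p + 1) + t)).map halfPerim).sum =
      Multiset.card s₂ * (2 * p + 2) := by
    rw [Multiset.map_map, Function.comp_def, hc₂', Multiset.map_const', Multiset.sum_replicate,
      smul_eq_mul]
  have hμg : (μ.map halfPerim).sum =
      Multiset.card s₁ * (2 * (p + k) + 2) + (j - Multiset.card s₁) * (2 * (p + k) + 1) +
      (Multiset.card s₂ * (2 * p + 2) + (e - Multiset.card s₂) * (2 * p + 1)) +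
      (halfPerim ρ₀ + halfPerim d) := by
    rw [hμ, Multiset.map_add, Multiset.map_add, Multiset.map_add, Multiset.map_add,
      Multiset.sum_add, Multiset.sum_add, Multiset.sum_add, Multiset.sum_add, hmap₁, hmap₂,
      Multiset.map_replicate, Multiset.map_replicate, Multiset.sum_replicate,
      Multiset.sum_replicate, Multiset.insert_eq_cons, Multiset.map_cons, Multiset.sum_cons,
      Multiset.map_singleton, Multiset.sum_singleton, smul_eq_mul, smul_eq_mul,
      halfPerim_mul_succ (k := p + k) (by omega), halfPerim_mul_succ (k := p) hp]
  have hcomp := cubicEIP_multisetSum_le_of_le (B := (p + k) * (p + k + 1) + θ) hμle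
  rw [hμsum, hμg, hopt] at hcomp
  have ej' : (j - Multiset.card s₁) * (2 * (p + k) + 1) + Multiset.card s₁ * (2 * (p + k) + 1) =
      j * (2 * (p + k) + 1) := by rw [← Nat.add_mul, Nat.sub_add_cancel hc₁]
  have ee' : (e - Multiset.card s₂) * (2 * p + 1) + Multiset.card s₂ * (2 * p + 1) =
      e * (2 * p + 1) := by rw [← Nat.add_mul, Nat.sub_add_cancel hc₂]
  have ec₁ : Multiset.card s₁ * (2 * (p + k) + 2) =
      Multiset.card s₁ * (2 * (p + k) + 1) + Multiset.card s₁ := by ring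
  have ec₂ : Multiset.card s₂ * (2 * p + 2) = Multiset.card s₂ * (2 * p + 1) + Multiset.card s₂ := by
    ring
  have i1 : j * (2 * (p + k) + 1) + (2 * (p + k) + 1) =
      2 * p ^ 2 + 4 * (p * k) + 2 * k ^ 2 + p + k := by
    have : j * (2 * (p + k) + 1) + (2 * (p + k) + 1) = (p + k) * (2 * (p + k) + 1) := by
      rw [hj]; ring
    rw [this]; ring
  have i2 : (p + k) * (p + k + 1) = p * (p + 1) + 2 * (p * k) + k ^ 2 + k := by ring
  have i3 : (p + 3 * k + e) * (2 * p + 1) = 2 * p ^ 2 + p + 6 * (p * k) + 3 * k + e * (2 * p + 1) := by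
    ring
  have i4 : p * (p + 1) = p ^ 2 + p := by ring
  have hkey : 2 * p + 3 * k + 1 ≤ 3 * k ^ 2 + halfPerim ρ₀ := by omega
  exact stepThree_tail_odd hp hk hkp hρ₀ hkey

/-- **A-priori height bound from the accounting alone**: a profile satisfying the quasicube
accounting has at most `62208·σ + 1` levels (`(c−1)σ ≤ G₃(n) ≤ 3(⌊∛n⌋+1)²` and `n ≤ 3c·σ²`).  This
disposes of every bounded range of `σ` in the side-face case with a (huge but explicit) constant.
[cite: MaininiPiovanoSchmidtStefanelli2019, §3 eq. (3.2) (crude form)] -/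
theorem quasicube_levels_le {n c M σ u d : ℕ} (hσ : 1 ≤ σ) (hMQ : M < qsq (σ + 1)) (hd : d ≤ M)
    (huc : u + 1 ≤ c) (hopt : cubicEIP n = M + (c - 1) * σ + u + halfPerim d)
    (hhi : n ≤ (c - 1) * qsq σ + u * (M - qsq σ) + d) : c - 1 ≤ 62208 * σ := by
  -- `n ≤ 3 c σ²`
  have hQ1 : qsq (σ + 1) ≤ σ ^ 2 := by
    have := four_mul_qsq_le (σ + 1)
    nlinarith
  have hMσ : M ≤ σ ^ 2 := by omega
  have hQσ : qsq σ ≤ σ ^ 2 := (qsq_mono (Nat.le_succ σ)).trans hQ1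
  have hn : n ≤ 3 * (c * σ ^ 2) := by
    have h1 : (c - 1) * qsq σ ≤ c * σ ^ 2 := Nat.mul_le_mul (Nat.sub_le _ _) hQσ
    have h2 : u * (M - qsq σ) ≤ c * σ ^ 2 := Nat.mul_le_mul (by omega) ((Nat.sub_le _ _).trans hMσ)
    have h3 : d ≤ c * σ ^ 2 := hd.trans (hMσ.trans (Nat.le_mul_of_pos_left _ (by omega)))
    omega
  -- `(c-1)σ ≤ 3(m+1)² ≤ 12 m²` with `m³ ≤ n`
  set m := latticeRootFloor 3 n with hm
  obtain ⟨hm1, -⟩ := latticeRootFloor_three_spec n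
  have hG := cubicEIP_le_three_mul_sq n
  rw [← hm] at hG hm1
  have hcσ : (c - 1) * σ ≤ 3 * (m + 1) ^ 2 := by rw [hopt] at hG; omega
  rcases Nat.eq_zero_or_pos m with hm0 | hmpos
  · rw [hm0] at hcσ
    have : c - 1 ≤ 3 := by nlinarith
    omega
  have h12 : (c - 1) * σ ≤ 12 * m ^ 2 := by nlinarith
  -- cube it: `((c-1)σ)³ ≤ 1728 m⁶ ≤ 1728 n² ≤ 1728·9·c²σ⁴`
  have hcube : ((c - 1) * σ) ^ 3 ≤ 1728 * (m ^ 3) ^ 2 := by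
    calc ((c - 1) * σ) ^ 3 ≤ (12 * m ^ 2) ^ 3 := Nat.pow_le_pow_left h12 3
      _ = 1728 * (m ^ 3) ^ 2 := by ring
  have hm6 : (m ^ 3) ^ 2 ≤ n ^ 2 := Nat.pow_le_pow_left hm1 2
  have hn2 : n ^ 2 ≤ (3 * (c * σ ^ 2)) ^ 2 := Nat.pow_le_pow_left hn 2
  have hmain : (c - 1) ^ 3 * σ ^ 3 ≤ (15552 * c ^ 2 * σ) * σ ^ 3 := by
    have e : ((c - 1) * σ) ^ 3 = (c - 1) ^ 3 * σ ^ 3 := by ring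
    have e' : 1728 * (3 * (c * σ ^ 2)) ^ 2 = (15552 * c ^ 2 * σ) * σ ^ 3 := by ring
    rw [← e, ← e']
    exact hcube.trans ((Nat.mul_le_mul_left 1728 hm6).trans (Nat.mul_le_mul_left 1728 hn2))
  have hσ3 : 0 < σ ^ 3 := by positivity
  have hdiv : (c - 1) ^ 3 ≤ 15552 * c ^ 2 * σ := Nat.le_of_mul_le_mul_right hmain hσ3
  rcases Nat.lt_or_ge c 2 with hc2 | hc2
  · omega
  · obtain ⟨b, hb⟩ : ∃ b, c = b + 2 := ⟨c - 2, by omega⟩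
    subst hb
    rw [show b + 2 - 1 = b + 1 by omega] at hdiv ⊢
    have hc4 : (b + 2) ^ 2 ≤ 4 * (b + 1) ^ 2 := by nlinarith
    have h' : (b + 1) * (b + 1) ^ 2 ≤ (62208 * σ) * (b + 1) ^ 2 := by
      have e : (b + 1) ^ 3 = (b + 1) * (b + 1) ^ 2 := by ring
      have e' : 15552 * (4 * (b + 1) ^ 2) * σ = (62208 * σ) * (b + 1) ^ 2 := by ring
      rw [← e, ← e']
      exact hdiv.trans (Nat.mul_le_mul_right σ (Nat.mul_le_mul_left _ hc4))
    exact Nat.le_of_mul_le_mul_right h' (by positivity)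

end SideFace

end Literature.MathematicalPhysics.StatisticalMechanics
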